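import Literature.NumberTheory.Irrationality.Zudilin2004.BarnesSorokinIntegrals
import Literature.NumberTheory.Irrationality.Zudilin2004.GroupStructureZeta3Closed
import Literature.NumberTheory.Irrationality.BrownZudilin2022.BarnesDoubleProofs
import HarnessLib

/-!
# Zudilin 2004 §4 (Bailey's transformation for `ζ(3)`), 3/4 — the very-well-poised Barnes kernel, the induction step, the Sorokin parameter line, the analytic side of Dougall's theorem, the reflection Bailey ⇐ Sorokin (re-homed proofs)

**Zudilin 2004, §4 (Bailey's transformation and the Rhin–Viola group for `ζ(3)`) — the named facts `Literature.NumberTheory.Irrationality.Zudilin2004.baileyTransform`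
(the quantity (4.4) `F̃₅(B)/Π(B)` is unchanged by the generator `𝔞₁₂` of the group `𝔊`, for admissible integer parameters) and `…baileyTransformClosed`
(the same on the closed parameter box), `GroupStructureZeta3.lean` / `GroupStructureZeta3Closed.lean`, HOLD — EXACT names `…_holds`** ([Zudilin2004] W. Zudilin,
*Arithmetic of linear forms involving odd zeta values*, J. Théor. Nombres Bordeaux **16** (2004), §4, Lemma 7, Prop. 2 with (4.4)–(4.6); the analytic inputs are
Bailey's 1935 tract [Bailey1935] (Dougall's ₇F₆ summation, Whipple's transformation), the Barnes–Mellin representation of very-well-poised series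
[Zudilin2002CatalanRemarks], [Zudilin2002Zeta5], and Sorokin-type multiple integrals as treated in [Lai2024BallRivoal]).  Contents: (1, definitions
file) the rising factorial `rf`, the factorial weight `facQ` / `lamOf` of the level descent, the elementary symmetric functions `eS1 … eS5` of six
parameters; (2) Sorokin integrands and their bounds / convergence, Barnes–Mellin integrals with complex powers, the Barnes–Euler integral, its
continuation and cut-off, kernel bounds, Sorokin's first / last variable and Lemma 3; (3) uniform Gamma-ratio bounds, the very-well-poised Barnes
kernel and inner integral, the step of the induction, the Sorokin parameter line and holomorphy, the analytic side conditions of Dougall's theorem,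
holomorphy and continuation in `h₀`, the reflection `Bailey ⇐ Sorokin`; (4) Dougall's theorem (terminating and non-terminating, Zudilin's form, full
range, complex parameters), the very-well-poised induction, `vwp = integral` for positive parameters, and the two discharges.
RE-HOMED into `Literature/` by the Hodge foundations lane (`lit-hodgefound`, seat p20, generation 40): verbatim DECLARATION-LEVEL ports (the 229
declarations needed, in dependency order; each Part is a slice of one Summits module) of 50 theorem modules `Summits/KontsevichZagierPeriods/Zeta5Search/*.lean`
(Barnes*, Sorokin*, Dougall*, VWP*, HypergeometricWhipple, GammaRatioUniform, WedgeDictionary*, BaileyFromSorokinReflection); the namespace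
`Summit.KontsevichZagierPeriods.Zeta5Search` is re-rooted at `Literature.NumberTheory.Irrationality.Zudilin2004` (module sub-namespaces kept); the nine Barnes–Mellin / Barnes-cube
lemmas the tree already has (`Literature.NumberTheory.Irrationality.BrownZudilin2022.BarnesMellin/BarnesCube`, `BarnesDoubleProofs.lean`) are used, not re-declared; the two `_holds`
theorems carry the EXACT names.  No new named fact (D-0026); imports Mathlib/Literature only; every declaration carries the citation of the printed statement it
formalises or serves.  The Summits originals stay in place (transitional duplication).  WHAT THIS IS NOT: nothing here bears on the period conjecture or on the
irrationality of `ζ(5)`; it is the classical hypergeometric analysis behind Zudilin's group structure, re-proved in the tree's vocabulary.  (This is file 3 of 4.)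
-/

noncomputable section

/-!
## Part 1 — port of `Summits/KontsevichZagierPeriods/Zeta5Search/VWPInnerSwap.lean` (1 declarations kept)

# Swapping the series of `F_{k+1}` with the Barnes `t`-integral in the induction step

Declarations of this Part (verbatim port; each keeps its own docstring and citation): `integral_tsum_inner_eq`.

Reference keys (see `references.bib` and the declarations' citations): [Zudilin2004].
-/

section Part1

namespace Literature.NumberTheory.Irrationality.Zudilin2004.VWPInnerSwap

open _root_.MeasureTheory _root_.Set _root_.Filter
open scoped _root_.Real
open Literature.NumberTheory.Irrationality.Zudilin2004.VWPInnerBarnes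

variable {t₀ : ℝ} {α β : ℂ}

/-- **Term-by-term integration of the inner series** (corrected induction step, (d)–(f)): for `0 < t₀ < Re α, Re β`, real `c` with
`2t₀ ≤ c`, `1 ≤ c − t₀`, `Re α + Re β < c`, `ε = ±1`, `θ ≥ 0` with `Re α + Re β − 2t₀ < (c−2t₀)(1−θ)`, and coefficients `d : ℕ → ℂ` with
`Summable (μ ↦ ‖d μ‖ (c − t₀ + μ)^{−(c−2t₀)θ})`,
`∫ Γ(α+s)Γ(β+s) e^{iεπs} (Σ' μ, d μ · Γ(μ−s)/Γ(c+μ+s)) dy = 2π · Σ' μ, d μ · ((−1)^μ Γ(α+μ)Γ(β+μ)Γ(c−α−β)/(Γ(c−β+μ)Γ(c−α+μ)))`.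
[cite: Zudilin2004, §4 (supporting lemma)] -/
theorem integral_tsum_inner_eq (ht₀ : 0 < t₀) (hα : t₀ < α.re) (hβ : t₀ < β.re) {c : ℝ} (hc : 2 * t₀ ≤ c) (hc1 : 1 ≤ c - t₀)
    (hαβ : α.re + β.re < c) {ε : ℝ} (hε : ε = 1 ∨ ε = -1) {θ : ℝ} (hθ0 : 0 ≤ θ)
    (hq : α.re + β.re - 2 * t₀ < (c - 2 * t₀) * (1 - θ)) (d : ℕ → ℂ)
    (hd : Summable fun μ : ℕ => ‖d μ‖ * (c - t₀ + μ) ^ (-((c - 2 * t₀) * θ))) :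
    ∫ y : ℝ, Complex.Gamma (α + (-(t₀ : ℂ) + (y : ℂ) * Complex.I)) * Complex.Gamma (β + (-(t₀ : ℂ) + (y : ℂ) * Complex.I)) *
          Complex.exp (ε * π * Complex.I * (-(t₀ : ℂ) + (y : ℂ) * Complex.I)) *
        ∑' μ : ℕ, d μ * (Complex.Gamma ((μ : ℂ) - (-(t₀ : ℂ) + (y : ℂ) * Complex.I)) /
          Complex.Gamma ((c : ℂ) + μ + (-(t₀ : ℂ) + (y : ℂ) * Complex.I))) =
      2 * π * ∑' μ : ℕ, d μ * ((-1 : ℂ) ^ μ * (Complex.Gamma (α + μ) * Complex.Gamma (β + μ) * Complex.Gamma (c - α - β) /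
        (Complex.Gamma (c - β + μ) * Complex.Gamma (c - α + μ)))) := by
  have hεabs : |ε| ≤ 1 := by rcases hε with h | h <;> simp [h]
  obtain ⟨C, hC, hIn⟩ := exists_integral_norm_inner_le (α := α) (β := β) ht₀ hα hβ hc hc1 hεabs hθ0 hq
  -- the family of termwise integrands
  set F : ℕ → ℝ → ℂ := fun μ y =>
    d μ * (Complex.Gamma (α + (-(t₀ : ℂ) + (y : ℂ) * Complex.I)) * Complex.Gamma (β + (-(t₀ : ℂ) + (y : ℂ) * Complex.I)) *
        Complex.Gamma ((μ : ℂ) - (-(t₀ : ℂ) + (y : ℂ) * Complex.I)) /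
        Complex.Gamma ((c : ℂ) + μ + (-(t₀ : ℂ) + (y : ℂ) * Complex.I)) *
      Complex.exp (ε * π * Complex.I * (-(t₀ : ℂ) + (y : ℂ) * Complex.I))) with hF
  have hFint : ∀ μ, Integrable (F μ) := fun μ => ((hIn μ).1).const_mul (d μ)
  have hFsum : Summable fun μ => ∫ y : ℝ, ‖F μ y‖ := by
    refine Summable.of_nonneg_of_le (fun μ => integral_nonneg fun y => norm_nonneg _) (fun μ => ?_) (hd.mul_left C)
    have h1 : ∫ y : ℝ, ‖F μ y‖ = ‖d μ‖ * ∫ y : ℝ, ‖Complex.Gamma (α + (-(t₀ : ℂ) + (y : ℂ) * Complex.I)) *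
        Complex.Gamma (β + (-(t₀ : ℂ) + (y : ℂ) * Complex.I)) * Complex.Gamma ((μ : ℂ) - (-(t₀ : ℂ) + (y : ℂ) * Complex.I)) /
        Complex.Gamma ((c : ℂ) + μ + (-(t₀ : ℂ) + (y : ℂ) * Complex.I)) *
        Complex.exp (ε * π * Complex.I * (-(t₀ : ℂ) + (y : ℂ) * Complex.I))‖ := by
      rw [← integral_const_mul]
      refine integral_congr_ae (Eventually.of_forall fun y => ?_)
      simp only [hF, norm_mul]
    rw [h1]
    calc ‖d μ‖ * _ ≤ ‖d μ‖ * (C * (c - t₀ + μ) ^ (-((c - 2 * t₀) * θ))) :=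
          mul_le_mul_of_nonneg_left (hIn μ).2 (norm_nonneg _)
      _ = C * (‖d μ‖ * (c - t₀ + μ) ^ (-((c - 2 * t₀) * θ))) := by ring
  -- pointwise: the integrand is `Σ' μ, F μ y`
  have hpt : ∀ y : ℝ,
      Complex.Gamma (α + (-(t₀ : ℂ) + (y : ℂ) * Complex.I)) * Complex.Gamma (β + (-(t₀ : ℂ) + (y : ℂ) * Complex.I)) *
            Complex.exp (ε * π * Complex.I * (-(t₀ : ℂ) + (y : ℂ) * Complex.I)) *
          ∑' μ : ℕ, d μ * (Complex.Gamma ((μ : ℂ) - (-(t₀ : ℂ) + (y : ℂ) * Complex.I)) /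
            Complex.Gamma ((c : ℂ) + μ + (-(t₀ : ℂ) + (y : ℂ) * Complex.I))) =
        ∑' μ : ℕ, F μ y := by
    intro y
    rw [← tsum_mul_left]
    refine tsum_congr fun μ => ?_
    simp only [hF]
    ring
  simp_rw [hpt]
  rw [← integral_tsum_of_summable_integral_norm hFint hFsum, ← tsum_mul_left]
  refine tsum_congr fun μ => ?_
  -- termwise evaluation
  have hev := inner_barnes_eq (α := α) (β := β) ht₀ hα hβ (c := (c : ℂ)) (by simpa using hαβ) hε μ
  have hπ : (π : ℂ) ≠ 0 := by exact_mod_cast Real.pi_pos.ne'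
  have h2π : (2 * π : ℂ) ≠ 0 := mul_ne_zero two_ne_zero hπ
  rw [one_div_mul_eq_div, div_eq_iff h2π] at hev
  have hI : ∫ y : ℝ, F μ y = d μ * (((-1 : ℂ) ^ μ * (Complex.Gamma (α + μ) * Complex.Gamma (β + μ) *
      Complex.Gamma (c - α - β) / (Complex.Gamma (c - β + μ) * Complex.Gamma (c - α + μ)))) * (2 * π)) := by
    simp only [hF]
    rw [integral_const_mul, hev]
  rw [hI]
  ring

end Literature.NumberTheory.Irrationality.Zudilin2004.VWPInnerSwap

end Part1

/-!
## Part 2 — port of `Summits/KontsevichZagierPeriods/Zeta5Search/VWPStepCore.lean` (1 declarations kept)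

# The analytic core of the induction step for Zudilin's theorem

Declarations of this Part (verbatim port; each keeps its own docstring and citation): `step_core`.

Reference keys (see `references.bib` and the declarations' citations): [Zudilin2004].
-/

section Part2

namespace Literature.NumberTheory.Irrationality.Zudilin2004.VWPStepCore

open _root_.MeasureTheory _root_.Set _root_.Filter
open scoped _root_.Real
open Literature.NumberTheory.Irrationality.Zudilin2002 (nestedQ sorokinIntegrand)
open Literature.NumberTheory.Irrationality.Zudilin2004.SorokinLemma3First (lemma3_first)
open Literature.NumberTheory.Irrationality.Zudilin2004.VWPInnerSwap (integral_tsum_inner_eq)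

variable {t₀ : ℝ} {a₀ : ℂ} {a b : ℕ → ℂ}

/-- **The analytic core of the induction step**: for `k ≥ 1`, complex `a₀, a_j, b_j`, a real `c` and `t₀` with
`0 < t₀ < Re a₀`, `t₀ < Re a_0`, the cut condition `Re a₀ + Re a_0 < Re b_0`, `Re a₀ + Re a_0 < c`, `2t₀ ≤ c`, `1 ≤ c − t₀`, `ε = ±1`,
`θ ≥ 0` with `Re a₀ + Re a_0 − 2t₀ < (c−2t₀)(1−θ)`; integrability of the `J_{k+1}`-integrand and of the typed `J_k`-integrand at
`(t₀; Re a_{j+1} | Re b_{j+1})`; coefficients `D` with `Σ‖D_μ‖(c−t₀+μ)^{−(c−2t₀)θ} < ∞`; and the ABSTRACT INDUCTIVE HYPOTHESIS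
`∀ y, J_k(−s; a_{·+1} | b_{·+1}) = Γ(b_0+s)/Γ(−s) · R · Σ' μ, D μ · Γ(μ−s)/Γ(c+μ+s)` (`s = −t₀+iy`):
`J_{k+1}(a₀; a | b) = Γ(b_0−a_0)/Γ(a₀) · R · Σ' μ, D μ · ((−1)^μ Γ(a₀+μ)Γ(a_0+μ)Γ(c−a₀−a_0)/(Γ(c−a_0+μ)Γ(c−a₀+μ)))`.
[cite: Zudilin2004, §4 (supporting lemma)] -/
theorem step_core {k : ℕ} (hk : 1 ≤ k) (ht₀ : 0 < t₀) (ht₀' : t₀ < a₀.re) (hta : t₀ < (a 0).re)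
    (hb : a₀.re + (a 0).re < (b 0).re) {c : ℝ} (hcab : a₀.re + (a 0).re < c) (hc : 2 * t₀ ≤ c) (hc1 : 1 ≤ c - t₀)
    {ε : ℝ} (hε : ε = 1 ∨ ε = -1) {θ : ℝ} (hθ0 : 0 ≤ θ) (hq : a₀.re + (a 0).re - 2 * t₀ < (c - 2 * t₀) * (1 - θ))
    (hF : IntegrableOn (fun x : Fin (k + 1) → ℝ =>
      (∏ j : Fin (k + 1), ((x j : ℝ) : ℂ) ^ (a j - 1) * (1 - ((x j : ℝ) : ℂ)) ^ (b j - a j - 1)) *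
        ((nestedQ (List.ofFn x) : ℝ) : ℂ) ^ (-a₀)) (Set.pi univ fun _ : Fin (k + 1) => Icc (0 : ℝ) 1) volume)
    (hJ : IntegrableOn (sorokinIntegrand k t₀ (fun n => (a (n + 1)).re) (fun n => (b (n + 1)).re))
      (Set.pi univ fun _ : Fin k => Icc (0 : ℝ) 1) volume)
    (R : ℂ) (D : ℕ → ℂ) (hD : Summable fun μ : ℕ => ‖D μ‖ * (c - t₀ + μ) ^ (-((c - 2 * t₀) * θ)))
    (IH : ∀ y : ℝ,
      ∫ x' in Set.pi univ (fun _ : Fin k => Icc (0 : ℝ) 1),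
          (∏ j : Fin k, ((x' j : ℝ) : ℂ) ^ (a (j + 1) - 1) * (1 - ((x' j : ℝ) : ℂ)) ^ (b (j + 1) - a (j + 1) - 1)) *
            ((nestedQ (List.ofFn x') : ℝ) : ℂ) ^ (-(-(-(t₀ : ℂ) + (y : ℂ) * Complex.I))) =
        Complex.Gamma (b 0 + (-(t₀ : ℂ) + (y : ℂ) * Complex.I)) / Complex.Gamma (-(-(t₀ : ℂ) + (y : ℂ) * Complex.I)) * R *
          ∑' μ : ℕ, D μ * (Complex.Gamma ((μ : ℂ) - (-(t₀ : ℂ) + (y : ℂ) * Complex.I)) /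
            Complex.Gamma ((c : ℂ) + μ + (-(t₀ : ℂ) + (y : ℂ) * Complex.I)))) :
    ∫ x in Set.pi univ (fun _ : Fin (k + 1) => Icc (0 : ℝ) 1),
        (∏ j : Fin (k + 1), ((x j : ℝ) : ℂ) ^ (a j - 1) * (1 - ((x j : ℝ) : ℂ)) ^ (b j - a j - 1)) *
          ((nestedQ (List.ofFn x) : ℝ) : ℂ) ^ (-a₀) =
      Complex.Gamma (b 0 - a 0) / Complex.Gamma a₀ * R *
        ∑' μ : ℕ, D μ * ((-1 : ℂ) ^ μ * (Complex.Gamma (a₀ + μ) * Complex.Gamma (a 0 + μ) * Complex.Gamma (c - a₀ - a 0) /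
          (Complex.Gamma (c - a 0 + μ) * Complex.Gamma (c - a₀ + μ)))) := by
  rw [lemma3_first hk ht₀ ht₀' hta hb hε hF hJ]
  -- the cancellation of `Γ(−s)` and `Γ(b_0 + s)` on every fibre
  have hpt : ∀ y : ℝ,
      Complex.Gamma (a₀ + (-(t₀ : ℂ) + (y : ℂ) * Complex.I)) * Complex.Gamma (a 0 + (-(t₀ : ℂ) + (y : ℂ) * Complex.I)) *
              Complex.Gamma (-(-(t₀ : ℂ) + (y : ℂ) * Complex.I)) /
              Complex.Gamma (b 0 + (-(t₀ : ℂ) + (y : ℂ) * Complex.I)) *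
            Complex.exp (ε * π * Complex.I * (-(t₀ : ℂ) + (y : ℂ) * Complex.I)) *
          ∫ x' in Set.pi univ (fun _ : Fin k => Icc (0 : ℝ) 1),
            (∏ j : Fin k, ((x' j : ℝ) : ℂ) ^ (a (j + 1) - 1) * (1 - ((x' j : ℝ) : ℂ)) ^ (b (j + 1) - a (j + 1) - 1)) *
              ((nestedQ (List.ofFn x') : ℝ) : ℂ) ^ (-(-(-(t₀ : ℂ) + (y : ℂ) * Complex.I))) =
        R * (Complex.Gamma (a₀ + (-(t₀ : ℂ) + (y : ℂ) * Complex.I)) * Complex.Gamma (a 0 + (-(t₀ : ℂ) + (y : ℂ) * Complex.I)) *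
            Complex.exp (ε * π * Complex.I * (-(t₀ : ℂ) + (y : ℂ) * Complex.I)) *
          ∑' μ : ℕ, D μ * (Complex.Gamma ((μ : ℂ) - (-(t₀ : ℂ) + (y : ℂ) * Complex.I)) /
            Complex.Gamma ((c : ℂ) + μ + (-(t₀ : ℂ) + (y : ℂ) * Complex.I)))) := by
    intro y
    rw [IH y]
    have hG1 : Complex.Gamma (-(-(t₀ : ℂ) + (y : ℂ) * Complex.I)) ≠ 0 := Complex.Gamma_ne_zero_of_re_pos (by simp [ht₀])
    have hG2 : Complex.Gamma (b 0 + (-(t₀ : ℂ) + (y : ℂ) * Complex.I)) ≠ 0 :=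
      Complex.Gamma_ne_zero_of_re_pos (by simp; linarith)
    field_simp
  rw [integral_congr_ae (Eventually.of_forall hpt), integral_const_mul,
    integral_tsum_inner_eq (α := a₀) (β := a 0) ht₀ ht₀' hta hc hc1 hcab hε hθ0 hq D hD]
  have hπ : (π : ℂ) ≠ 0 := by exact_mod_cast Real.pi_pos.ne'
  set S : ℂ := ∑' μ : ℕ, D μ * ((-1 : ℂ) ^ μ * (Complex.Gamma (a₀ + μ) * Complex.Gamma (a 0 + μ) * Complex.Gamma (c - a₀ - a 0) /
    (Complex.Gamma (c - a 0 + μ) * Complex.Gamma (c - a₀ + μ)))) with hS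
  have h2π : (1 / (2 * π) : ℂ) * (2 * π) = 1 := by field_simp
  calc Complex.Gamma (b 0 - a 0) / Complex.Gamma a₀ * ((1 / (2 * π) : ℂ) * (R * (2 * π * S)))
      = Complex.Gamma (b 0 - a 0) / Complex.Gamma a₀ * R * ((1 / (2 * π) : ℂ) * (2 * π)) * S := by ring
    _ = _ := by rw [h2π]; ring

end Literature.NumberTheory.Irrationality.Zudilin2004.VWPStepCore

end Part2

/-!
## Part 3 — port of `Summits/KontsevichZagierPeriods/Zeta5Search/VWPStepAlgebra.lean` (5 declarations kept)

# The induction step for Zudilin's theorem in `h`-coordinates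

Declarations of this Part (verbatim port; each keeps its own docstring and citation): `prod_erase_one`, `prod_Icc_shifted`, `prod_Icc_one`, `prod_range_split`, `step`.

Reference keys (see `references.bib` and the declarations' citations): [Zudilin2004].
-/

section Part3

namespace Literature.NumberTheory.Irrationality.Zudilin2004.VWPStepAlgebra

open _root_.MeasureTheory _root_.Set _root_.Filter
open scoped _root_.Real
open Literature.NumberTheory.Irrationality.Zudilin2002 (nestedQ sorokinIntegrand)
open Literature.NumberTheory.Irrationality.Zudilin2004.VWPStepCore (step_core)

variable {t₀ : ℝ} {h : ℕ → ℂ}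

/-! ### 1. Finite-product bookkeeping -/

/-- Splitting the `i = 1` factor off the `F_{k+2}` product at shifted parameters `g` (`g₀ = h₀`, `g_i = h_{i+1}` for `i ≥ 2`):
`∏_{i<k+3} Φ(g_i) = Φ(g₁) · (Φ(h₀) · ∏_{i∈Icc 3 (k+3)} Φ(h_i))`. [cite: Zudilin2004, §4 (supporting lemma)] -/
theorem prod_erase_one (k : ℕ) (Φ : ℂ → ℂ) {g h : ℕ → ℂ} (hg0 : g 0 = h 0) (hg : ∀ i, 2 ≤ i → g i = h (i + 1)) :
    ∏ i ∈ Finset.range (k + 3), Φ (g i) = Φ (g 1) * (Φ (h 0) * ∏ i ∈ Finset.Icc 3 (k + 3), Φ (h i)) := by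
  rw [← Finset.mul_prod_erase (Finset.range (k + 3)) (fun i => Φ (g i)) (a := 1) (by simp)]
  congr 1
  have hset : (Finset.range (k + 3)).erase 1 = insert 0 (Finset.Icc 2 (k + 2)) := by ext i; simp; omega
  rw [hset, Finset.prod_insert (by simp), hg0]
  congr 1
  rw [show Finset.Icc 3 (k + 3) = Finset.Icc (2 + 1) (k + 2 + 1) by rfl, ← Finset.map_add_right_Icc, Finset.prod_map]
  refine Finset.prod_congr rfl fun i hi => ?_
  have hi2 : 2 ≤ i := (Finset.mem_Icc.1 hi).1
  rw [hg i hi2]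
  rfl

/-- The inductive prefactor at `g`: `∏_{i∈Icc 1 (k+1)} Γ(1+g₀−g_i−g_{i+1}) = Γ(1+h₀−g₁−h₃) · ∏_{i∈Icc 2 (k+1)} Γ(1+h₀−h_{i+1}−h_{i+2})` (`k ≥ 1`).
[cite: Zudilin2004, §4 (supporting lemma)] -/
theorem prod_Icc_shifted {k : ℕ} (hk : 1 ≤ k) {g h : ℕ → ℂ} (hg0 : g 0 = h 0) (hg : ∀ i, 2 ≤ i → g i = h (i + 1)) :
    ∏ i ∈ Finset.Icc 1 (k + 1), Complex.Gamma (1 + g 0 - g i - g (i + 1)) =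
      Complex.Gamma (1 + h 0 - g 1 - h 3) * ∏ i ∈ Finset.Icc 2 (k + 1), Complex.Gamma (1 + h 0 - h (i + 1) - h (i + 2)) := by
  have hset : Finset.Icc 1 (k + 1) = insert 1 (Finset.Icc 2 (k + 1)) := by ext i; simp; omega
  rw [hset, Finset.prod_insert (by simp), hg0, hg 2 le_rfl]
  congr 1
  refine Finset.prod_congr rfl fun i hi => ?_
  have hi2 : 2 ≤ i := (Finset.mem_Icc.1 hi).1
  rw [hg i hi2, hg (i + 1) (by omega)]

/-- The new prefactor: `∏_{i∈Icc 1 (k+2)} Γ(1+h₀−h_i−h_{i+1}) = Γ(1+h₀−h₁−h₂) · Γ(1+h₀−h₂−h₃) · ∏_{i∈Icc 2 (k+1)} Γ(1+h₀−h_{i+1}−h_{i+2})`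
(`k ≥ 1`). [cite: Zudilin2004, §4 (supporting lemma)] -/
theorem prod_Icc_one {k : ℕ} (hk : 1 ≤ k) (h : ℕ → ℂ) :
    ∏ i ∈ Finset.Icc 1 (k + 2), Complex.Gamma (1 + h 0 - h i - h (i + 1)) =
      Complex.Gamma (1 + h 0 - h 1 - h 2) * (Complex.Gamma (1 + h 0 - h 2 - h 3) *
        ∏ i ∈ Finset.Icc 2 (k + 1), Complex.Gamma (1 + h 0 - h (i + 1) - h (i + 2))) := by
  have hset : Finset.Icc 1 (k + 2) = insert (1 : ℕ) (insert (2 : ℕ) (Finset.Icc 3 (k + 2))) := by ext i; simp; omega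
  rw [hset, Finset.prod_insert (by simp), Finset.prod_insert (by simp)]
  congr 2
  rw [show Finset.Icc 3 (k + 2) = Finset.Icc (2 + 1) (k + 1 + 1) by rfl, ← Finset.map_add_right_Icc, Finset.prod_map]
  rfl

/-- The new series term: `∏_{i<k+4} Φ(h_i) = Φ(h₀)Φ(h₁)Φ(h₂) · ∏_{i∈Icc 3 (k+3)} Φ(h_i)`.
[cite: Zudilin2004, §4 (supporting lemma)] -/
theorem prod_range_split (k : ℕ) (Φ : ℂ → ℂ) (h : ℕ → ℂ) :
    ∏ i ∈ Finset.range (k + 4), Φ (h i) = Φ (h 0) * Φ (h 1) * Φ (h 2) * ∏ i ∈ Finset.Icc 3 (k + 3), Φ (h i) := by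
  have hset : Finset.range (k + 4) = insert (0 : ℕ) (insert (1 : ℕ) (insert (2 : ℕ) (Finset.Icc 3 (k + 3)))) := by
    ext i; simp; omega
  rw [hset, Finset.prod_insert (by simp), Finset.prod_insert (by simp), Finset.prod_insert (by simp)]
  ring

/-! ### 2. The step in `h`-coordinates -/

/-- **The induction step `S(k) ⇒ S(k+1)` on the sub-region, in `h`-coordinates** (`k ≥ 1`, `h₀` real).
Hypotheses: `0 < t₀ < Re h₁`, `t₀ < Re h₂`, the cut condition (C) `Re h₁ + Re h₂ < Re(1+h₀−h₃)`, `Re h₁ + Re h₂ < 1+h₀`,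
`t₀ ≤ h₀`, `ε = ±1`, `θ ≥ 0` with `Re h₁ + Re h₂ − 2t₀ < (1+h₀−2t₀)(1−θ)`, integrability of the `J_{k+1}`-integrand and of the typed
`J_k`-integrand at `(t₀; Re h_{j+3} | Re(1+h₀−h_{j+4}))`, the summability `Σ_μ ‖D_μ‖(1+h₀−t₀+μ)^{−(1+h₀−2t₀)θ} < ∞` of
`D_μ = (h₀+2μ)[Γ(h₀+μ)/Γ(1+μ)]∏_{i∈Icc 3 (k+3)}[Γ(h_i+μ)/Γ(1+h₀−h_i+μ)](−1)^{(k+3)μ}` (condition (J)), and the INDUCTIVE HYPOTHESIS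
`S(k)(g)` for every `y` and every `g` with `g₀ = h₀`, `g₁ = −s`, `g_i = h_{i+1}` (`i ≥ 2`).  Conclusion: `S(k+1)(h)`.
[cite: Zudilin2004, §4 (supporting lemma)] -/
theorem step {k : ℕ} (hk : 1 ≤ k) (h : ℕ → ℂ) (hreal : (h 0).im = 0) (ht₀ : 0 < t₀) (h1 : t₀ < (h 1).re) (h2 : t₀ < (h 2).re)
    (hC : (h 1).re + (h 2).re < (1 + h 0 - h 3).re) (h12 : (h 1).re + (h 2).re < 1 + (h 0).re)
    (hc1 : t₀ ≤ (h 0).re) {ε : ℝ} (hε : ε = 1 ∨ ε = -1) {θ : ℝ} (hθ0 : 0 ≤ θ)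
    (hq : (h 1).re + (h 2).re - 2 * t₀ < (1 + (h 0).re - 2 * t₀) * (1 - θ))
    (hF : IntegrableOn (fun x : Fin (k + 1) → ℝ =>
      (∏ j : Fin (k + 1), ((x j : ℝ) : ℂ) ^ (h (j + 2) - 1) * (1 - ((x j : ℝ) : ℂ)) ^ ((1 + h 0 - h (j + 3)) - h (j + 2) - 1)) *
        ((nestedQ (List.ofFn x) : ℝ) : ℂ) ^ (-h 1)) (Set.pi univ fun _ : Fin (k + 1) => Icc (0 : ℝ) 1) volume)
    (hJ : IntegrableOn (sorokinIntegrand k t₀ (fun n => (h (n + 1 + 2)).re) (fun n => (1 + h 0 - h (n + 1 + 3)).re))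
      (Set.pi univ fun _ : Fin k => Icc (0 : ℝ) 1) volume)
    (hD : Summable fun μ : ℕ => ‖(h 0 + 2 * (μ : ℂ)) * (Complex.Gamma (h 0 + μ) / Complex.Gamma (1 + h 0 - h 0 + μ) *
        ∏ i ∈ Finset.Icc 3 (k + 3), Complex.Gamma (h i + μ) / Complex.Gamma (1 + h 0 - h i + μ)) * (-1 : ℂ) ^ ((k + 3) * μ)‖ *
        (1 + (h 0).re - t₀ + μ) ^ (-((1 + (h 0).re - 2 * t₀) * θ)))
    (IH : ∀ (y : ℝ) (g : ℕ → ℂ), g 0 = h 0 → g 1 = -(-(t₀ : ℂ) + (y : ℂ) * Complex.I) → (∀ i, 2 ≤ i → g i = h (i + 1)) →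
      (∏ i ∈ Finset.Icc 1 (k + 1), Complex.Gamma (1 + g 0 - g i - g (i + 1))) / (Complex.Gamma (g 1) * Complex.Gamma (g (k + 2))) *
          (∑' μ : ℕ, (g 0 + 2 * (μ : ℂ)) * (∏ i ∈ Finset.range (k + 3), Complex.Gamma (g i + μ) / Complex.Gamma (1 + g 0 - g i + μ)) *
            (-1 : ℂ) ^ ((k + 3) * μ)) =
        ∫ x in Set.pi univ (fun _ : Fin k => Icc (0 : ℝ) 1),
          (∏ j : Fin k, ((x j : ℝ) : ℂ) ^ (g (j + 2) - 1) * (1 - ((x j : ℝ) : ℂ)) ^ ((1 + g 0 - g (j + 3)) - g (j + 2) - 1)) *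
            ((nestedQ (List.ofFn x) : ℝ) : ℂ) ^ (-g 1)) :
    (∏ i ∈ Finset.Icc 1 (k + 2), Complex.Gamma (1 + h 0 - h i - h (i + 1))) / (Complex.Gamma (h 1) * Complex.Gamma (h (k + 3))) *
        (∑' μ : ℕ, (h 0 + 2 * (μ : ℂ)) * (∏ i ∈ Finset.range (k + 4), Complex.Gamma (h i + μ) / Complex.Gamma (1 + h 0 - h i + μ)) *
          (-1 : ℂ) ^ ((k + 4) * μ)) =
      ∫ x in Set.pi univ (fun _ : Fin (k + 1) => Icc (0 : ℝ) 1),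
        (∏ j : Fin (k + 1), ((x j : ℝ) : ℂ) ^ (h (j + 2) - 1) * (1 - ((x j : ℝ) : ℂ)) ^ ((1 + h 0 - h (j + 3)) - h (j + 2) - 1)) *
          ((nestedQ (List.ofFn x) : ℝ) : ℂ) ^ (-h 1) := by
  -- the real `c = 1 + h₀`
  set c : ℝ := 1 + (h 0).re with hcdef
  have hh0 : ((h 0).re : ℂ) = h 0 := by
    apply Complex.ext <;> simp [hreal]
  have hcC : (c : ℂ) = 1 + h 0 := by rw [hcdef]; push_cast; rw [hh0]
  -- the constants of the abstract inductive hypothesis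
  set R : ℂ := (∏ i ∈ Finset.Icc 2 (k + 1), Complex.Gamma (1 + h 0 - h (i + 1) - h (i + 2))) / Complex.Gamma (h (k + 3)) with hR
  set D : ℕ → ℂ := fun μ => (h 0 + 2 * (μ : ℂ)) * (Complex.Gamma (h 0 + μ) / Complex.Gamma (1 + h 0 - h 0 + μ) *
      ∏ i ∈ Finset.Icc 3 (k + 3), Complex.Gamma (h i + μ) / Complex.Gamma (1 + h 0 - h i + μ)) * (-1 : ℂ) ^ ((k + 3) * μ) with hDdef
  -- (i) the inductive hypothesis in `step_core`'s shape
  have IH' : ∀ y : ℝ,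
      ∫ x' in Set.pi univ (fun _ : Fin k => Icc (0 : ℝ) 1),
          (∏ j : Fin k, ((x' j : ℝ) : ℂ) ^ ((fun n => h (n + 2)) (j + 1) - 1) *
              (1 - ((x' j : ℝ) : ℂ)) ^ ((fun n => 1 + h 0 - h (n + 3)) (j + 1) - (fun n => h (n + 2)) (j + 1) - 1)) *
            ((nestedQ (List.ofFn x') : ℝ) : ℂ) ^ (-(-(-(t₀ : ℂ) + (y : ℂ) * Complex.I))) =
        Complex.Gamma ((fun n => 1 + h 0 - h (n + 3)) 0 + (-(t₀ : ℂ) + (y : ℂ) * Complex.I)) /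
            Complex.Gamma (-(-(t₀ : ℂ) + (y : ℂ) * Complex.I)) * R *
          ∑' μ : ℕ, D μ * (Complex.Gamma ((μ : ℂ) - (-(t₀ : ℂ) + (y : ℂ) * Complex.I)) /
            Complex.Gamma ((c : ℂ) + μ + (-(t₀ : ℂ) + (y : ℂ) * Complex.I))) := by
    intro y
    set s : ℂ := -(t₀ : ℂ) + (y : ℂ) * Complex.I with hs
    set g : ℕ → ℂ := fun i => if i = 0 then h 0 else if i = 1 then -s else h (i + 1) with hgdef
    have hg0 : g 0 = h 0 := by simp [hgdef]
    have hg1 : g 1 = -s := by simp [hgdef]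
    have hg : ∀ i, 2 ≤ i → g i = h (i + 1) := fun i hi => by
      simp [hgdef, show i ≠ 0 by omega, show i ≠ 1 by omega]
    have hI := IH y g hg0 hg1 hg
    -- the integrand of `S(k)(g)` is the one of `step_core`
    have hint : (fun x : Fin k → ℝ =>
        (∏ j : Fin k, ((x j : ℝ) : ℂ) ^ (g (j + 2) - 1) * (1 - ((x j : ℝ) : ℂ)) ^ ((1 + g 0 - g (j + 3)) - g (j + 2) - 1)) *
          ((nestedQ (List.ofFn x) : ℝ) : ℂ) ^ (-g 1)) =
        fun x' => (∏ j : Fin k, ((x' j : ℝ) : ℂ) ^ ((fun n => h (n + 2)) (j + 1) - 1) *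
              (1 - ((x' j : ℝ) : ℂ)) ^ ((fun n => 1 + h 0 - h (n + 3)) (j + 1) - (fun n => h (n + 2)) (j + 1) - 1)) *
            ((nestedQ (List.ofFn x') : ℝ) : ℂ) ^ (-(-s)) := by
      funext x
      rw [hg1]
      congr 1
    rw [hint] at hI
    rw [← hI, prod_Icc_shifted hk hg0 hg, hg1, hg (k + 2) (by omega)]
    simp only [hg0]
    -- the series: split off `i = 1`
    have hser : ∀ μ : ℕ, (h 0 + 2 * (μ : ℂ)) * (∏ i ∈ Finset.range (k + 3), Complex.Gamma (g i + μ) / Complex.Gamma (1 + h 0 - g i + μ)) *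
          (-1 : ℂ) ^ ((k + 3) * μ) =
        D μ * (Complex.Gamma ((μ : ℂ) - s) / Complex.Gamma ((c : ℂ) + μ + s)) := by
      intro μ
      rw [prod_erase_one k (fun u => Complex.Gamma (u + μ) / Complex.Gamma (1 + h 0 - u + μ)) hg0 hg, hg1, hcC]
      simp only [hDdef]
      rw [show -s + (μ : ℂ) = μ - s by ring, show 1 + h 0 - -s + μ = 1 + h 0 + μ + s by ring]
      ring
    simp_rw [hser]
    simp only [zero_add]
    rw [show (k : ℕ) + 2 + 1 = k + 3 by ring, show 1 + h 0 - h 3 + s = 1 + h 0 - -s - h 3 by ring, hR]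
    ring
  -- (ii) apply the analytic core
  have hb : (h 1).re + ((fun n : ℕ => h (n + 2)) 0).re < ((fun n : ℕ => 1 + h 0 - h (n + 3)) 0).re := by simpa using hC
  have core := step_core (a₀ := h 1) (a := fun n => h (n + 2)) (b := fun n => 1 + h 0 - h (n + 3)) hk ht₀ h1
    (by simpa using h2) hb (c := c) (by rw [hcdef]; simpa using h12) (by rw [hcdef]; linarith) (by rw [hcdef]; linarith) hε hθ0
    (by rw [hcdef]; simpa using hq) hF hJ R D (by rw [hcdef]; simpa [hDdef] using hD) IH'
  rw [core]
  -- (iii) resum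
  rw [prod_Icc_one hk h, hR, ← tsum_mul_left, ← tsum_mul_left]
  refine tsum_congr fun μ => ?_
  rw [prod_range_split k (fun u => Complex.Gamma (u + μ) / Complex.Gamma (1 + h 0 - u + μ)) h, hDdef, hcC]
  simp only [zero_add]
  rw [show 1 + h 0 - h 3 - h 2 = 1 + h 0 - h 2 - h 3 by ring, show (k + 4) * μ = (k + 3) * μ + μ by ring, pow_add]
  ring

end Literature.NumberTheory.Irrationality.Zudilin2004.VWPStepAlgebra

end Part3

/-!
## Part 4 — port of `Summits/KontsevichZagierPeriods/Zeta5Search/SorokinParameterLine.lean` (10 declarations kept)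

# Zudilin's `J_k` along a complex line of parameters: pointwise structure and majorant

Declarations of this Part (verbatim port; each keeps its own docstring and citation): `cpow_add_eq_mul_exp`, `re_mul_log_le`, `abs_log_le_rpow`, `one_le_rpow_neg`, `integrand_line_eq`, `norm_exp_line_le`, `norm_L_le`, `sorokinIntegrand_mul_weight`, `weight_mono`, `norm_deriv_le`.

Reference keys (see `references.bib` and the declarations' citations): [Zudilin2004].
-/

section Part4

namespace Literature.NumberTheory.Irrationality.Zudilin2004.SorokinParameterLine

open _root_.MeasureTheory _root_.Set _root_.Filter
open Literature.NumberTheory.Irrationality.Zudilin2002 (nestedQ sorokinIntegrand)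
open Literature.NumberTheory.Irrationality.Zudilin2004.SorokinIntegrandBounds
open Literature.NumberTheory.Irrationality.Zudilin2004.SorokinLastVariable

/-! ### 1. Elementary one-variable facts on `(0,1]` -/

/-- `z^{p + w} = z^{p} · exp(log z · w)` for `z ≠ 0`. [cite: Zudilin2004, §4 (supporting lemma)] -/
theorem cpow_add_eq_mul_exp {z : ℂ} (hz : z ≠ 0) (p w : ℂ) : z ^ (p + w) = z ^ p * Complex.exp (Complex.log z * w) := by
  rw [Complex.cpow_add _ _ hz, Complex.cpow_def_of_ne_zero hz w]

/-- For `c ∈ (0,1]`, `‖t‖ ≤ ρ`: `Re(t · (w · log c)) ≤ −ρ‖w‖ log c`. [cite: Zudilin2004, §4 (supporting lemma)] -/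
theorem re_mul_log_le {c : ℝ} (hc : 0 < c) (hc1 : c ≤ 1) {t : ℂ} {ρ : ℝ} (ht : ‖t‖ ≤ ρ) (w : ℂ) :
    (t * (w * Complex.log (c : ℂ))).re ≤ -(ρ * ‖w‖) * Real.log c := by
  rw [← Complex.ofReal_log hc.le, ← mul_assoc, Complex.re_mul_ofReal]
  have hlog : Real.log c ≤ 0 := Real.log_nonpos hc.le hc1
  have hre : -(ρ * ‖w‖) ≤ (t * w).re := by
    have h1 : |(t * w).re| ≤ ‖t * w‖ := Complex.abs_re_le_norm _
    rw [norm_mul] at h1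
    have h2 : ‖t‖ * ‖w‖ ≤ ρ * ‖w‖ := mul_le_mul_of_nonneg_right ht (norm_nonneg _)
    linarith [neg_abs_le (t * w).re]
  exact mul_le_mul_of_nonpos_right hre hlog

/-- For `c ∈ (0,1]` and `δ > 0`: `|log c| ≤ c^{−δ}/δ`. [cite: Zudilin2004, §4 (supporting lemma)] -/
theorem abs_log_le_rpow {c δ : ℝ} (hc : 0 < c) (hc1 : c ≤ 1) (hδ : 0 < δ) : |Real.log c| ≤ c ^ (-δ) / δ := by
  rw [abs_of_nonpos (Real.log_nonpos hc.le hc1), ← Real.log_inv, Real.rpow_neg hc.le, ← Real.inv_rpow hc.le]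
  exact Real.log_le_rpow_div (inv_nonneg.2 hc.le) hδ

/-- For `c ∈ (0,1]` and `e ≥ 0`: `1 ≤ c^{−e}`. [cite: Zudilin2004, §4 (supporting lemma)] -/
theorem one_le_rpow_neg {c e : ℝ} (hc : 0 < c) (hc1 : c ≤ 1) (he : 0 ≤ e) : 1 ≤ c ^ (-e) :=
  Real.one_le_rpow_of_pos_of_le_one_of_nonpos hc hc1 (by linarith)

/-! ### 2. The factorisation along a line -/

/-- **`F_t = F_0 · e^{tL}`** on the open cube: the integrand at the parameters `(a₀ + t u₀; a_j + t u_j | b_j + t v_j)` is the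
integrand at `t = 0` times `exp(t · L(x))`, `L(x) = Σ_j (u_j log x_j + (v_j − u_j) log(1 − x_j)) − u₀ log Q_k(x)`.
[cite: Zudilin2004, §4 (supporting lemma)] -/
theorem integrand_line_eq {k : ℕ} (a₀ u₀ : ℂ) (a b u v : ℕ → ℂ) (t : ℂ) {x : Fin k → ℝ} (hx : ∀ j, x j ∈ Ioo (0 : ℝ) 1)
    (hQ : 0 < nestedQ (List.ofFn x)) :
    (∏ j : Fin k, ((x j : ℝ) : ℂ) ^ ((a j + t * u j) - 1) *
          (1 - ((x j : ℝ) : ℂ)) ^ ((b j + t * v j) - (a j + t * u j) - 1)) *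
        ((nestedQ (List.ofFn x) : ℝ) : ℂ) ^ (-(a₀ + t * u₀)) =
      ((∏ j : Fin k, ((x j : ℝ) : ℂ) ^ (a j - 1) * (1 - ((x j : ℝ) : ℂ)) ^ (b j - a j - 1)) *
          ((nestedQ (List.ofFn x) : ℝ) : ℂ) ^ (-a₀)) *
        Complex.exp (t * ((∑ j : Fin k, (u j * Complex.log ((x j : ℝ) : ℂ) + (v j - u j) * Complex.log (1 - ((x j : ℝ) : ℂ)))) +
          -u₀ * Complex.log ((nestedQ (List.ofFn x) : ℝ) : ℂ))) := by
  have hxz : ∀ j, ((x j : ℝ) : ℂ) ≠ 0 := fun j => by exact_mod_cast (hx j).1.ne'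
  have h1z : ∀ j, (1 : ℂ) - ((x j : ℝ) : ℂ) ≠ 0 := fun j => by
    rw [show (1 : ℂ) - ((x j : ℝ) : ℂ) = ((1 - x j : ℝ) : ℂ) by push_cast; ring]
    exact_mod_cast (by linarith [(hx j).2] : (1 - x j : ℝ) ≠ 0)
  have hQz : ((nestedQ (List.ofFn x) : ℝ) : ℂ) ≠ 0 := by exact_mod_cast hQ.ne'
  -- factor by factor
  have hj : ∀ j : Fin k, ((x j : ℝ) : ℂ) ^ ((a j + t * u j) - 1) * (1 - ((x j : ℝ) : ℂ)) ^ ((b j + t * v j) - (a j + t * u j) - 1) =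
      (((x j : ℝ) : ℂ) ^ (a j - 1) * (1 - ((x j : ℝ) : ℂ)) ^ (b j - a j - 1)) *
        Complex.exp (t * (u j * Complex.log ((x j : ℝ) : ℂ) + (v j - u j) * Complex.log (1 - ((x j : ℝ) : ℂ)))) := by
    intro j
    rw [show (a j + t * u j) - 1 = (a j - 1) + t * u j by ring,
      show (b j + t * v j) - (a j + t * u j) - 1 = (b j - a j - 1) + t * (v j - u j) by ring,
      cpow_add_eq_mul_exp (hxz j), cpow_add_eq_mul_exp (h1z j), mul_add, Complex.exp_add]
    ring_nf
  have hQ' : ((nestedQ (List.ofFn x) : ℝ) : ℂ) ^ (-(a₀ + t * u₀)) =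
      ((nestedQ (List.ofFn x) : ℝ) : ℂ) ^ (-a₀) * Complex.exp (t * (-u₀ * Complex.log ((nestedQ (List.ofFn x) : ℝ) : ℂ))) := by
    rw [show -(a₀ + t * u₀) = -a₀ + t * (-u₀) by ring, cpow_add_eq_mul_exp hQz]
    ring_nf
  rw [Finset.prod_congr rfl fun j _ => hj j, Finset.prod_mul_distrib, ← Complex.exp_sum, hQ', mul_add t, Complex.exp_add,
    Finset.mul_sum]
  ring

/-! ### 3. The majorant -/

/-- The real exponential weight: `‖exp(t L(x))‖ ≤ ∏_j x_j^{−ρ‖u_j‖}(1−x_j)^{−ρ‖v_j−u_j‖} · Q^{−ρ‖u₀‖}` for `‖t‖ ≤ ρ`.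
[cite: Zudilin2004, §4 (supporting lemma)] -/
theorem norm_exp_line_le {k : ℕ} (u₀ : ℂ) (u v : ℕ → ℂ) {t : ℂ} {ρ : ℝ} (ht : ‖t‖ ≤ ρ) {x : Fin k → ℝ}
    (hx : ∀ j, x j ∈ Ioo (0 : ℝ) 1) {Q : ℝ} (hQ : 0 < Q) (hQ1 : Q ≤ 1) :
    ‖Complex.exp (t * ((∑ j : Fin k, (u j * Complex.log ((x j : ℝ) : ℂ) + (v j - u j) * Complex.log (1 - ((x j : ℝ) : ℂ)))) +
          -u₀ * Complex.log ((Q : ℝ) : ℂ)))‖ ≤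
      (∏ j : Fin k, x j ^ (-(ρ * ‖u j‖)) * (1 - x j) ^ (-(ρ * ‖v j - u j‖))) * Q ^ (-(ρ * ‖u₀‖)) := by
  rw [Complex.norm_exp]
  have hsplit : (t * ((∑ j : Fin k, (u j * Complex.log ((x j : ℝ) : ℂ) + (v j - u j) * Complex.log (1 - ((x j : ℝ) : ℂ)))) +
        -u₀ * Complex.log ((Q : ℝ) : ℂ))).re =
      (∑ j : Fin k, ((t * (u j * Complex.log ((x j : ℝ) : ℂ))).re + (t * ((v j - u j) * Complex.log (((1 - x j : ℝ)) : ℂ))).re)) +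
        (t * (-u₀ * Complex.log ((Q : ℝ) : ℂ))).re := by
    rw [mul_add, Complex.add_re, Finset.mul_sum, Complex.re_sum]
    congr 1
    refine Finset.sum_congr rfl fun j _ => ?_
    rw [mul_add, Complex.add_re]
    push_cast
    ring_nf
  rw [hsplit, Real.exp_add, Real.exp_sum]
  refine mul_le_mul ?_ ?_ (Real.exp_pos _).le (Finset.prod_nonneg fun j _ => mul_nonneg (Real.rpow_nonneg (hx j).1.le _)
    (Real.rpow_nonneg (by linarith [(hx j).2]) _))
  · refine Finset.prod_le_prod (fun j _ => (Real.exp_pos _).le) fun j _ => ?_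
    have h0 := hx j
    have h1 : 0 < 1 - x j := by linarith [h0.2]
    rw [Real.exp_add, Real.rpow_def_of_pos h0.1, Real.rpow_def_of_pos h1]
    refine mul_le_mul (Real.exp_le_exp.2 ?_) (Real.exp_le_exp.2 ?_) (Real.exp_pos _).le (Real.exp_pos _).le
    · have := re_mul_log_le h0.1 h0.2.le ht (u j); linarith
    · have := re_mul_log_le h1 (by linarith [h0.1]) ht (v j - u j); linarith
  · rw [Real.rpow_def_of_pos hQ]
    refine Real.exp_le_exp.2 ?_
    have := re_mul_log_le hQ hQ1 ht (-u₀)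
    rw [norm_neg] at this
    linarith

/-- The logarithmic factor: `‖L(x)‖ ≤ (M/δ) · ∏_j x_j^{−δ}(1−x_j)^{−δ} · Q^{−δ}`, `M = ‖u₀‖ + Σ_j(‖u_j‖ + ‖v_j − u_j‖)`, `δ > 0`.
[cite: Zudilin2004, §4 (supporting lemma)] -/
theorem norm_L_le {k : ℕ} (u₀ : ℂ) (u v : ℕ → ℂ) {x : Fin k → ℝ} (hx : ∀ j, x j ∈ Ioo (0 : ℝ) 1) {Q : ℝ} (hQ : 0 < Q)
    (hQ1 : Q ≤ 1) {δ : ℝ} (hδ : 0 < δ) :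
    ‖(∑ j : Fin k, (u j * Complex.log ((x j : ℝ) : ℂ) + (v j - u j) * Complex.log (1 - ((x j : ℝ) : ℂ)))) +
        -u₀ * Complex.log ((Q : ℝ) : ℂ)‖ ≤
      ((‖u₀‖ + ∑ j : Fin k, (‖u j‖ + ‖v j - u j‖)) / δ) *
        ((∏ j : Fin k, x j ^ (-δ) * (1 - x j) ^ (-δ)) * Q ^ (-δ)) := by
  set P : ℝ := (∏ j : Fin k, x j ^ (-δ) * (1 - x j) ^ (-δ)) * Q ^ (-δ) with hP
  have h1x : ∀ j, 0 < 1 - x j := fun j => by linarith [(hx j).2]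
  have hfac : ∀ j, 1 ≤ x j ^ (-δ) * (1 - x j) ^ (-δ) := fun j =>
    one_le_mul_of_one_le_of_one_le (one_le_rpow_neg (hx j).1 (hx j).2.le hδ.le)
      (one_le_rpow_neg (h1x j) (by linarith [(hx j).1]) hδ.le)
  have hQδ : 1 ≤ Q ^ (-δ) := one_le_rpow_neg hQ hQ1 hδ.le
  -- `1 ≤ ∏ f` for real factors `≥ 1` (the tree's `Literature.NumberTheory.Sieve.GoldbachLinnik.one_le_prod_real`, inlined)
  have one_le_prod : ∀ s : Finset (Fin k), 1 ≤ ∏ i ∈ s, x i ^ (-δ) * (1 - x i) ^ (-δ) := fun s =>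
    calc (1 : ℝ) = ∏ _i ∈ s, (1 : ℝ) := by simp
      _ ≤ ∏ i ∈ s, x i ^ (-δ) * (1 - x i) ^ (-δ) := Finset.prod_le_prod (fun _ _ => zero_le_one) fun i _ => hfac i
  have hprod1 : 1 ≤ ∏ j : Fin k, x j ^ (-δ) * (1 - x j) ^ (-δ) := one_le_prod _
  have hP1 : ∀ j : Fin k, x j ^ (-δ) ≤ P ∧ (1 - x j) ^ (-δ) ≤ P := by
    intro j
    have herase : ∏ i : Fin k, x i ^ (-δ) * (1 - x i) ^ (-δ) =
        (x j ^ (-δ) * (1 - x j) ^ (-δ)) * ∏ i ∈ Finset.univ.erase j, x i ^ (-δ) * (1 - x i) ^ (-δ) :=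
      (Finset.mul_prod_erase _ _ (Finset.mem_univ j)).symm
    have hrest : 1 ≤ ∏ i ∈ Finset.univ.erase j, x i ^ (-δ) * (1 - x i) ^ (-δ) := one_le_prod _
    have ha : 0 ≤ x j ^ (-δ) := Real.rpow_nonneg (hx j).1.le _
    have hb : 0 ≤ (1 - x j) ^ (-δ) := Real.rpow_nonneg (h1x j).le _
    have hxj : 1 ≤ x j ^ (-δ) := one_le_rpow_neg (hx j).1 (hx j).2.le hδ.le
    have h1j : 1 ≤ (1 - x j) ^ (-δ) := one_le_rpow_neg (h1x j) (by linarith [(hx j).1]) hδ.le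
    rw [hP, herase]
    constructor <;> nlinarith [mul_nonneg ha hb, mul_nonneg (mul_nonneg ha hb) (le_trans zero_le_one hrest)]
  have hPQ : Q ^ (-δ) ≤ P := by
    rw [hP]; nlinarith [le_trans zero_le_one hQδ]
  have hP0 : 0 ≤ P := le_trans (Real.rpow_nonneg hQ.le _) hPQ
  -- termwise bounds
  have hlogx : ∀ j : Fin k, ‖Complex.log ((x j : ℝ) : ℂ)‖ ≤ P / δ := fun j => by
    rw [← Complex.ofReal_log (hx j).1.le, Complex.norm_real, Real.norm_eq_abs]
    exact (abs_log_le_rpow (hx j).1 (hx j).2.le hδ).trans (div_le_div_of_nonneg_right (hP1 j).1 hδ.le)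
  have hlog1 : ∀ j : Fin k, ‖Complex.log (1 - ((x j : ℝ) : ℂ))‖ ≤ P / δ := fun j => by
    rw [show (1 : ℂ) - ((x j : ℝ) : ℂ) = ((1 - x j : ℝ) : ℂ) by push_cast; ring, ← Complex.ofReal_log (h1x j).le,
      Complex.norm_real, Real.norm_eq_abs]
    exact (abs_log_le_rpow (h1x j) (by linarith [(hx j).1]) hδ).trans (div_le_div_of_nonneg_right (hP1 j).2 hδ.le)
  have hlogQ : ‖Complex.log ((Q : ℝ) : ℂ)‖ ≤ P / δ := by
    rw [← Complex.ofReal_log hQ.le, Complex.norm_real, Real.norm_eq_abs]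
    exact (abs_log_le_rpow hQ hQ1 hδ).trans (div_le_div_of_nonneg_right hPQ hδ.le)
  calc _ ≤ ‖∑ j : Fin k, (u j * Complex.log ((x j : ℝ) : ℂ) + (v j - u j) * Complex.log (1 - ((x j : ℝ) : ℂ)))‖ +
          ‖-u₀ * Complex.log ((Q : ℝ) : ℂ)‖ := norm_add_le _ _
    _ ≤ (∑ j : Fin k, (‖u j‖ * (P / δ) + ‖v j - u j‖ * (P / δ))) + ‖u₀‖ * (P / δ) := by
        refine add_le_add ((norm_sum_le _ _).trans (Finset.sum_le_sum fun j _ => (norm_add_le _ _).trans ?_)) ?_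
        · rw [norm_mul, norm_mul]
          exact add_le_add (mul_le_mul_of_nonneg_left (hlogx j) (norm_nonneg _))
            (mul_le_mul_of_nonneg_left (hlog1 j) (norm_nonneg _))
        · rw [norm_mul, norm_neg]
          exact mul_le_mul_of_nonneg_left hlogQ (norm_nonneg _)
    _ = _ := by
        simp_rw [← add_mul]
        rw [← Finset.sum_mul, hP]
        ring

/-- Merging real powers: the typed real integrand times the weight `∏ x_j^{−e}(1−x_j)^{−e}·Q^{−e}` is the typed real integrand at
the shifted parameters `(α₀ + e; α_j − e | β_j − 2e)`. [cite: Zudilin2004, §4 (supporting lemma)] -/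
theorem sorokinIntegrand_mul_weight (k : ℕ) (α₀ e : ℝ) (α β : ℕ → ℝ) {x : Fin k → ℝ} (hx : ∀ j, x j ∈ Ioo (0 : ℝ) 1)
    (hQ : 0 < nestedQ (List.ofFn x)) :
    sorokinIntegrand k α₀ α β x * ((∏ j : Fin k, x j ^ (-e) * (1 - x j) ^ (-e)) * nestedQ (List.ofFn x) ^ (-e)) =
      sorokinIntegrand k (α₀ + e) (fun n => α n - e) (fun n => β n - 2 * e) x := by
  have hxc : ∀ j, x j ∈ Icc (0 : ℝ) 1 := fun j => Ioo_subset_Icc_self (hx j)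
  rw [sorokinIntegrand_eq k _ _ _ hxc, sorokinIntegrand_eq k _ _ _ hxc, neg_zero, Real.rpow_zero, mul_one, mul_one]
  calc (∏ j : Fin k, x j ^ (α j - 1) * (1 - x j) ^ (β j - α j - 1)) * nestedQ (List.ofFn x) ^ (-α₀) *
          ((∏ j : Fin k, x j ^ (-e) * (1 - x j) ^ (-e)) * nestedQ (List.ofFn x) ^ (-e))
      = (∏ j : Fin k, (x j ^ (α j - 1) * (1 - x j) ^ (β j - α j - 1)) * (x j ^ (-e) * (1 - x j) ^ (-e))) *
          (nestedQ (List.ofFn x) ^ (-α₀) * nestedQ (List.ofFn x) ^ (-e)) := by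
        have hd : (∏ j : Fin k, (x j ^ (α j - 1) * (1 - x j) ^ (β j - α j - 1)) * (x j ^ (-e) * (1 - x j) ^ (-e))) =
            (∏ j : Fin k, x j ^ (α j - 1) * (1 - x j) ^ (β j - α j - 1)) * ∏ j : Fin k, x j ^ (-e) * (1 - x j) ^ (-e) :=
          Finset.prod_mul_distrib
        rw [hd]; ring
    _ = _ := by
        rw [← Real.rpow_add hQ, show -α₀ + -e = -(α₀ + e) by ring]
        congr 1
        refine Finset.prod_congr rfl fun j _ => ?_
        have h0 := (hx j).1
        have h1 : 0 < 1 - x j := by linarith [(hx j).2]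
        rw [mul_mul_mul_comm, ← Real.rpow_add h0, ← Real.rpow_add h1]
        congr 2 <;> ring

/-- Monotonicity of the weight in the exponent: `e ≤ e'` ⇒ `∏ x_j^{−e}(1−x_j)^{−e}Q^{−e} ≤ ∏ x_j^{−e'}(1−x_j)^{−e'}Q^{−e'}`.
[cite: Zudilin2004, §4 (supporting lemma)] -/
theorem weight_mono {k : ℕ} {e e' : ℝ} (hee : e ≤ e') {x : Fin k → ℝ} (hx : ∀ j, x j ∈ Ioo (0 : ℝ) 1) {Q : ℝ} (hQ : 0 < Q)
    (hQ1 : Q ≤ 1) :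
    (∏ j : Fin k, x j ^ (-e) * (1 - x j) ^ (-e)) * Q ^ (-e) ≤ (∏ j : Fin k, x j ^ (-e') * (1 - x j) ^ (-e')) * Q ^ (-e') := by
  have h1x : ∀ j, 0 < 1 - x j := fun j => by linarith [(hx j).2]
  refine mul_le_mul (Finset.prod_le_prod (fun j _ => mul_nonneg (Real.rpow_nonneg (hx j).1.le _) (Real.rpow_nonneg (h1x j).le _))
    fun j _ => mul_le_mul ?_ ?_ (Real.rpow_nonneg (h1x j).le _) (Real.rpow_nonneg (hx j).1.le _)) ?_ (Real.rpow_nonneg hQ.le _)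
    (Finset.prod_nonneg fun j _ => mul_nonneg (Real.rpow_nonneg (hx j).1.le _) (Real.rpow_nonneg (h1x j).le _))
  · exact Real.rpow_le_rpow_of_exponent_ge (hx j).1 (hx j).2.le (by linarith)
  · exact Real.rpow_le_rpow_of_exponent_ge (h1x j) (by linarith [(hx j).1]) (by linarith)
  · exact Real.rpow_le_rpow_of_exponent_ge hQ hQ1 (by linarith)

/-- **The majorant of `∂_t F_t`** on the open cube (`k ≥ 1`): for `η > 0`, `M = ‖u₀‖ + Σ_j(‖u_j‖ + ‖v_j − u_j‖)`, `δ = η/2`,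
`ρ = η/(2(M+1))` and `‖t‖ ≤ ρ`,
`‖F_0(x) · L(x) · exp(t L(x))‖ ≤ (M/δ) · [typed real integrand at (Re a₀ + η; Re a_j − η | Re b_j − 2η)](x)`.
[cite: Zudilin2004, §4 (supporting lemma)] -/
theorem norm_deriv_le {k : ℕ} (hk : 1 ≤ k) (a₀ u₀ : ℂ) (a b u v : ℕ → ℂ) {η : ℝ} (hη : 0 < η) {t : ℂ}
    (ht : ‖t‖ ≤ η / (2 * ((‖u₀‖ + ∑ j : Fin k, (‖u j‖ + ‖v j - u j‖)) + 1))) {x : Fin k → ℝ} (hx : ∀ j, x j ∈ Ioo (0 : ℝ) 1) :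
    ‖((∏ j : Fin k, ((x j : ℝ) : ℂ) ^ (a j - 1) * (1 - ((x j : ℝ) : ℂ)) ^ (b j - a j - 1)) *
          ((nestedQ (List.ofFn x) : ℝ) : ℂ) ^ (-a₀)) *
        ((∑ j : Fin k, (u j * Complex.log ((x j : ℝ) : ℂ) + (v j - u j) * Complex.log (1 - ((x j : ℝ) : ℂ)))) +
          -u₀ * Complex.log ((nestedQ (List.ofFn x) : ℝ) : ℂ)) *
        Complex.exp (t * ((∑ j : Fin k, (u j * Complex.log ((x j : ℝ) : ℂ) + (v j - u j) * Complex.log (1 - ((x j : ℝ) : ℂ)))) +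
          -u₀ * Complex.log ((nestedQ (List.ofFn x) : ℝ) : ℂ)))‖ ≤
      ((‖u₀‖ + ∑ j : Fin k, (‖u j‖ + ‖v j - u j‖)) / (η / 2)) *
        sorokinIntegrand k (a₀.re + η) (fun n => (a n).re - η) (fun n => (b n).re - 2 * η) x := by
  set M : ℝ := ‖u₀‖ + ∑ j : Fin k, (‖u j‖ + ‖v j - u j‖) with hM
  have hM0 : 0 ≤ M := by positivity
  have hQ := nestedQ_ofFn_mem_Ioo hk hx
  have hS₀ := norm_integrand k a₀ a b hx
  have hS₀nn : 0 ≤ sorokinIntegrand k a₀.re (fun n => (a n).re) (fun n => (b n).re) x := by rw [← hS₀]; exact norm_nonneg _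
  set ρ : ℝ := η / (2 * (M + 1)) with hρ
  have hρ0 : 0 ≤ ρ := by positivity
  have hL := norm_L_le u₀ u v hx hQ.1 hQ.2.le (half_pos hη)
  have hE := norm_exp_line_le u₀ u v ht hx hQ.1 hQ.2.le
  -- the exponential weight is dominated by the uniform weight with exponent `ρ M`
  have hE' : (∏ j : Fin k, x j ^ (-(ρ * ‖u j‖)) * (1 - x j) ^ (-(ρ * ‖v j - u j‖))) * nestedQ (List.ofFn x) ^ (-(ρ * ‖u₀‖)) ≤
      (∏ j : Fin k, x j ^ (-(ρ * M)) * (1 - x j) ^ (-(ρ * M))) * nestedQ (List.ofFn x) ^ (-(ρ * M)) := by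
    have h1x : ∀ j, 0 < 1 - x j := fun j => by linarith [(hx j).2]
    have hju : ∀ j : Fin k, ‖u j‖ ≤ M ∧ ‖v j - u j‖ ≤ M := fun j => by
      have hsum : ‖u j‖ + ‖v j - u j‖ ≤ ∑ i : Fin k, (‖u i‖ + ‖v i - u i‖) :=
        Finset.single_le_sum (f := fun i : Fin k => ‖u i‖ + ‖v i - u i‖) (fun i _ => by positivity) (Finset.mem_univ j)
      constructor <;> linarith [norm_nonneg u₀, norm_nonneg (u j), norm_nonneg (v j - u j)]
    have hu₀ : ‖u₀‖ ≤ M := by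
      have hsum : 0 ≤ ∑ i : Fin k, (‖u i‖ + ‖v i - u i‖) := Finset.sum_nonneg fun i _ => by positivity
      rw [hM]; linarith
    refine mul_le_mul (Finset.prod_le_prod (fun j _ => mul_nonneg (Real.rpow_nonneg (hx j).1.le _)
      (Real.rpow_nonneg (h1x j).le _)) fun j _ => mul_le_mul ?_ ?_ (Real.rpow_nonneg (h1x j).le _) (Real.rpow_nonneg (hx j).1.le _))
      ?_ (Real.rpow_nonneg hQ.1.le _) (Finset.prod_nonneg fun j _ => mul_nonneg (Real.rpow_nonneg (hx j).1.le _)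
        (Real.rpow_nonneg (h1x j).le _))
    · exact Real.rpow_le_rpow_of_exponent_ge (hx j).1 (hx j).2.le (by nlinarith [(hju j).1])
    · exact Real.rpow_le_rpow_of_exponent_ge (h1x j) (by linarith [(hx j).1]) (by nlinarith [(hju j).2])
    · exact Real.rpow_le_rpow_of_exponent_ge hQ.1 hQ.2.le (by nlinarith [hu₀])
  -- `δ + ρM ≤ η`
  have hρM : η / 2 + ρ * M ≤ η := by
    have : ρ * M ≤ η / 2 := by
      rw [hρ, div_mul_eq_mul_div, div_le_div_iff₀ (by positivity) (by norm_num)]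
      nlinarith
    linarith
  have hW := weight_mono hρM hx hQ.1 hQ.2.le
  -- assemble
  have hWnn : ∀ e : ℝ, 0 ≤ (∏ j : Fin k, x j ^ (-e) * (1 - x j) ^ (-e)) * nestedQ (List.ofFn x) ^ (-e) := fun e =>
    mul_nonneg (Finset.prod_nonneg fun j _ => mul_nonneg (Real.rpow_nonneg (hx j).1.le _)
      (Real.rpow_nonneg (by linarith [(hx j).2]) _)) (Real.rpow_nonneg hQ.1.le _)
  have hmerge : (∏ j : Fin k, x j ^ (-(η / 2)) * (1 - x j) ^ (-(η / 2))) * nestedQ (List.ofFn x) ^ (-(η / 2)) *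
      ((∏ j : Fin k, x j ^ (-(ρ * M)) * (1 - x j) ^ (-(ρ * M))) * nestedQ (List.ofFn x) ^ (-(ρ * M))) =
      (∏ j : Fin k, x j ^ (-(η / 2 + ρ * M)) * (1 - x j) ^ (-(η / 2 + ρ * M))) * nestedQ (List.ofFn x) ^ (-(η / 2 + ρ * M)) := by
    rw [mul_mul_mul_comm, ← Finset.prod_mul_distrib, ← Real.rpow_add hQ.1, show -(η / 2) + -(ρ * M) = -(η / 2 + ρ * M) by ring]
    congr 1
    refine Finset.prod_congr rfl fun j _ => ?_
    rw [mul_mul_mul_comm, ← Real.rpow_add (hx j).1, ← Real.rpow_add (by linarith [(hx j).2] : (0 : ℝ) < 1 - x j),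
      show -(η / 2) + -(ρ * M) = -(η / 2 + ρ * M) by ring]
  rw [norm_mul, norm_mul, hS₀]
  calc sorokinIntegrand k a₀.re (fun n => (a n).re) (fun n => (b n).re) x *
          ‖(∑ j : Fin k, (u j * Complex.log ((x j : ℝ) : ℂ) + (v j - u j) * Complex.log (1 - ((x j : ℝ) : ℂ)))) +
            -u₀ * Complex.log ((nestedQ (List.ofFn x) : ℝ) : ℂ)‖ *
          ‖Complex.exp (t * ((∑ j : Fin k, (u j * Complex.log ((x j : ℝ) : ℂ) +
            (v j - u j) * Complex.log (1 - ((x j : ℝ) : ℂ)))) + -u₀ * Complex.log ((nestedQ (List.ofFn x) : ℝ) : ℂ)))‖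
      ≤ sorokinIntegrand k a₀.re (fun n => (a n).re) (fun n => (b n).re) x *
          (M / (η / 2) * ((∏ j : Fin k, x j ^ (-(η / 2)) * (1 - x j) ^ (-(η / 2))) * nestedQ (List.ofFn x) ^ (-(η / 2)))) *
          ((∏ j : Fin k, x j ^ (-(ρ * M)) * (1 - x j) ^ (-(ρ * M))) * nestedQ (List.ofFn x) ^ (-(ρ * M))) :=
        mul_le_mul (mul_le_mul_of_nonneg_left hL hS₀nn) (hE.trans hE') (norm_nonneg _)
          (mul_nonneg hS₀nn (mul_nonneg (div_nonneg hM0 (by positivity)) (hWnn (η / 2))))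
    _ = M / (η / 2) * (sorokinIntegrand k a₀.re (fun n => (a n).re) (fun n => (b n).re) x *
          ((∏ j : Fin k, x j ^ (-(η / 2 + ρ * M)) * (1 - x j) ^ (-(η / 2 + ρ * M))) *
            nestedQ (List.ofFn x) ^ (-(η / 2 + ρ * M)))) := by rw [← hmerge]; ring
    _ ≤ M / (η / 2) * (sorokinIntegrand k a₀.re (fun n => (a n).re) (fun n => (b n).re) x *
          ((∏ j : Fin k, x j ^ (-η) * (1 - x j) ^ (-η)) * nestedQ (List.ofFn x) ^ (-η))) := by
        gcongr
    _ = _ := by rw [sorokinIntegrand_mul_weight k _ _ _ _ hx hQ.1]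

end Literature.NumberTheory.Irrationality.Zudilin2004.SorokinParameterLine

end Part4

/-!
## Part 5 — port of `Summits/KontsevichZagierPeriods/Zeta5Search/SorokinParameterHolomorphy.lean` (3 declarations kept)

# Holomorphy of Zudilin's `J_k` along complex lines of parameters

Declarations of this Part (verbatim port; each keeps its own docstring and citation): `measurable_L`, `hasDerivAt_line`, `differentiableAt_line`.

Reference keys (see `references.bib` and the declarations' citations): [Zudilin2004].
-/

section Part5

namespace Literature.NumberTheory.Irrationality.Zudilin2004.SorokinParameterHolomorphy

open _root_.MeasureTheory _root_.Set _root_.Filter _root_.Metric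
open scoped _root_.Topology
open Literature.NumberTheory.Irrationality.Zudilin2002 (nestedQ sorokinIntegrand)
open Literature.NumberTheory.Irrationality.Zudilin2004.SorokinIntegrandBounds
open Literature.NumberTheory.Irrationality.Zudilin2004.SorokinLastVariable
open Literature.NumberTheory.Irrationality.Zudilin2004.SorokinParameterLine

/-- Measurability of the logarithmic weight `L`. [cite: Zudilin2004, §4 (supporting lemma)] -/
theorem measurable_L (k : ℕ) (u₀ : ℂ) (u v : ℕ → ℂ) :
    Measurable fun x : Fin k → ℝ =>
      (∑ j : Fin k, (u j * Complex.log ((x j : ℝ) : ℂ) + (v j - u j) * Complex.log (1 - ((x j : ℝ) : ℂ)))) +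
        -u₀ * Complex.log ((nestedQ (List.ofFn x) : ℝ) : ℂ) := by
  have hQ : Measurable fun x : Fin k → ℝ => ((nestedQ (List.ofFn x) : ℝ) : ℂ) :=
    Complex.measurable_ofReal.comp (continuous_nestedQ_ofFn k).measurable
  refine (Finset.measurable_sum _ fun j _ => ?_).add ((Complex.measurable_log.comp hQ).const_mul _)
  have hj : Measurable fun x : Fin k → ℝ => ((x j : ℝ) : ℂ) := Complex.measurable_ofReal.comp (measurable_pi_apply j)
  exact ((Complex.measurable_log.comp hj).const_mul _).add ((Complex.measurable_log.comp (measurable_const.sub hj)).const_mul _)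

/-- **Holomorphy of `J_k` along a complex line of parameters** (`k ≥ 1`): if for some `η > 0` the typed real integrand at
`(Re a₀ + η; Re a_j − η | Re b_j − 2η)` is integrable on `[0,1]^k`, then
`t ↦ ∫_{[0,1]^k} ∏ x_j^{a_j+tu_j−1}(1−x_j)^{(b_j+tv_j)−(a_j+tu_j)−1} Q_k^{−(a₀+tu₀)} dx` has at `t = 0` the complex derivative
`∫_{[0,1]^k} [the integrand at t = 0] · L(x) dx`, `L(x) = Σ_j(u_j log x_j + (v_j−u_j) log(1−x_j)) − u₀ log Q_k(x)`.
[cite: Zudilin2004, §4 (supporting lemma)] -/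
theorem hasDerivAt_line {k : ℕ} (hk : 1 ≤ k) (a₀ u₀ : ℂ) (a b u v : ℕ → ℂ) {η : ℝ} (hη : 0 < η)
    (hJη : IntegrableOn (sorokinIntegrand k (a₀.re + η) (fun n => (a n).re - η) (fun n => (b n).re - 2 * η))
      (Set.pi univ fun _ : Fin k => Icc (0 : ℝ) 1) volume) :
    HasDerivAt (fun t : ℂ => ∫ x in Set.pi univ (fun _ : Fin k => Icc (0 : ℝ) 1),
        (∏ j : Fin k, ((x j : ℝ) : ℂ) ^ ((a j + t * u j) - 1) * (1 - ((x j : ℝ) : ℂ)) ^ ((b j + t * v j) - (a j + t * u j) - 1)) *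
          ((nestedQ (List.ofFn x) : ℝ) : ℂ) ^ (-(a₀ + t * u₀)))
      (∫ x in Set.pi univ (fun _ : Fin k => Icc (0 : ℝ) 1),
        ((∏ j : Fin k, ((x j : ℝ) : ℂ) ^ (a j - 1) * (1 - ((x j : ℝ) : ℂ)) ^ (b j - a j - 1)) *
            ((nestedQ (List.ofFn x) : ℝ) : ℂ) ^ (-a₀)) *
          ((∑ j : Fin k, (u j * Complex.log ((x j : ℝ) : ℂ) + (v j - u j) * Complex.log (1 - ((x j : ℝ) : ℂ)))) +
            -u₀ * Complex.log ((nestedQ (List.ofFn x) : ℝ) : ℂ))) 0 := by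
  -- names
  set μ : Measure (Fin k → ℝ) := (volume : Measure (Fin k → ℝ)).restrict (Set.pi univ fun _ : Fin k => Icc (0 : ℝ) 1) with hμ
  set F : ℂ → (Fin k → ℝ) → ℂ := fun t x =>
    (∏ j : Fin k, ((x j : ℝ) : ℂ) ^ ((a j + t * u j) - 1) * (1 - ((x j : ℝ) : ℂ)) ^ ((b j + t * v j) - (a j + t * u j) - 1)) *
      ((nestedQ (List.ofFn x) : ℝ) : ℂ) ^ (-(a₀ + t * u₀)) with hFdef
  set F₀ : (Fin k → ℝ) → ℂ := fun x =>
    (∏ j : Fin k, ((x j : ℝ) : ℂ) ^ (a j - 1) * (1 - ((x j : ℝ) : ℂ)) ^ (b j - a j - 1)) *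
      ((nestedQ (List.ofFn x) : ℝ) : ℂ) ^ (-a₀) with hF₀def
  set L : (Fin k → ℝ) → ℂ := fun x =>
    (∑ j : Fin k, (u j * Complex.log ((x j : ℝ) : ℂ) + (v j - u j) * Complex.log (1 - ((x j : ℝ) : ℂ)))) +
      -u₀ * Complex.log ((nestedQ (List.ofFn x) : ℝ) : ℂ) with hLdef
  set F' : ℂ → (Fin k → ℝ) → ℂ := fun t x => F₀ x * L x * Complex.exp (t * L x) with hF'def
  set M : ℝ := ‖u₀‖ + ∑ j : Fin k, (‖u j‖ + ‖v j - u j‖) with hM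
  have hM0 : 0 ≤ M := by positivity
  set ρ : ℝ := η / (2 * (M + 1)) with hρ
  have hρ0 : 0 < ρ := by positivity
  -- a.e. the point lies in the open cube
  have hae : (Set.pi univ fun _ : Fin k => Icc (0 : ℝ) 1) =ᵐ[volume] (Set.pi univ fun _ : Fin k => Ioo (0 : ℝ) 1) := by
    rw [volume_pi]; exact Measure.pi_Ioo_ae_eq_pi_Icc.symm
  have hopen : ∀ᵐ x ∂μ, ∀ j, x j ∈ Ioo (0 : ℝ) 1 := by
    rw [hμ, Measure.restrict_congr_set hae]
    filter_upwards [ae_restrict_mem (MeasurableSet.univ_pi fun _ => measurableSet_Ioo)] with x hx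
    exact fun j => hx j (mem_univ _)
  -- the value at `t = 0`
  have hF0 : F 0 = F₀ := by
    funext x; rw [hFdef, hF₀def]; simp only [zero_mul, add_zero]
  -- measurability in `x`
  have hF_meas : ∀ᶠ t in 𝓝 (0 : ℂ), AEStronglyMeasurable (F t) μ := Eventually.of_forall fun t =>
    (measurable_integrand k (a₀ + t * u₀) (fun n => a n + t * u n) (fun n => b n + t * v n)).aestronglyMeasurable
  have hF'_meas : AEStronglyMeasurable (F' 0) μ := by
    rw [hF'def]
    exact (((measurable_integrand k a₀ a b).mul (measurable_L k u₀ u v)).mul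
      ((measurable_const.mul (measurable_L k u₀ u v)).cexp)).aestronglyMeasurable
  -- integrability at `t = 0` (dominated by the perturbed real integrand)
  have hF_int : Integrable (F 0) μ := by
    rw [hF0]
    refine hJη.mono' (measurable_integrand k a₀ a b).aestronglyMeasurable ?_
    filter_upwards [hopen] with x hx
    have hQ := nestedQ_ofFn_mem_Ioo hk hx
    rw [hF₀def]
    simp only
    rw [norm_integrand k a₀ a b hx, ← sorokinIntegrand_mul_weight k _ η _ _ hx hQ.1]
    have hS0 : 0 ≤ sorokinIntegrand k a₀.re (fun n => (a n).re) (fun n => (b n).re) x := by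
      rw [← norm_integrand k a₀ a b hx]; exact norm_nonneg _
    refine le_mul_of_one_le_right hS0 ?_
    have h1x : ∀ j, 0 < 1 - x j := fun j => by linarith [(hx j).2]
    calc (1 : ℝ) = (∏ _j : Fin k, (1 : ℝ)) * 1 := by simp
      _ ≤ (∏ j : Fin k, x j ^ (-η) * (1 - x j) ^ (-η)) * nestedQ (List.ofFn x) ^ (-η) :=
        mul_le_mul (Finset.prod_le_prod (fun _ _ => zero_le_one) fun j _ =>
            one_le_mul_of_one_le_of_one_le (one_le_rpow_neg (hx j).1 (hx j).2.le hη.le)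
              (one_le_rpow_neg (h1x j) (by linarith [(hx j).1]) hη.le))
          (one_le_rpow_neg hQ.1 hQ.2.le hη.le) zero_le_one
          (Finset.prod_nonneg fun j _ => mul_nonneg (Real.rpow_nonneg (hx j).1.le _) (Real.rpow_nonneg (h1x j).le _))
  -- the bound on the derivative, on the ball `‖t‖ < ρ`
  have h_bound : ∀ᵐ x ∂μ, ∀ t ∈ ball (0 : ℂ) ρ, ‖F' t x‖ ≤
      M / (η / 2) * sorokinIntegrand k (a₀.re + η) (fun n => (a n).re - η) (fun n => (b n).re - 2 * η) x := by
    filter_upwards [hopen] with x hx t ht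
    have ht' : ‖t‖ ≤ η / (2 * ((‖u₀‖ + ∑ j : Fin k, (‖u j‖ + ‖v j - u j‖)) + 1)) := by
      rw [mem_ball, dist_zero_right] at ht; exact ht.le
    rw [hF'def, hF₀def, hLdef]
    exact norm_deriv_le hk a₀ u₀ a b u v hη ht' hx
  have hbound_int : Integrable (fun x => M / (η / 2) *
      sorokinIntegrand k (a₀.re + η) (fun n => (a n).re - η) (fun n => (b n).re - 2 * η) x) μ := hJη.const_mul _
  -- differentiability of the integrand in `t`
  have h_diff : ∀ᵐ x ∂μ, ∀ t ∈ ball (0 : ℂ) ρ, HasDerivAt (fun t => F t x) (F' t x) t := by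
    filter_upwards [hopen] with x hx t _
    have hQ := nestedQ_ofFn_mem_Ioo hk hx
    have hline : (fun t => F t x) = fun t => F₀ x * Complex.exp (t * L x) := by
      funext t
      rw [hFdef, hF₀def, hLdef]
      exact integrand_line_eq a₀ u₀ a b u v t hx hQ.1
    rw [hline]
    show HasDerivAt (fun t => F₀ x * Complex.exp (t * L x)) (F₀ x * L x * Complex.exp (t * L x)) t
    have h := (((hasDerivAt_id t).mul_const (L x)).cexp).const_mul (F₀ x)
    simp only [id] at h
    exact h.congr_deriv (by ring)
  exact (hasDerivAt_integral_of_dominated_loc_of_deriv_le (ball_mem_nhds (0 : ℂ) hρ0) hF_meas hF_int hF'_meas h_bound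
    hbound_int h_diff).2.congr_deriv (by simp only [hF'def, hF₀def, hLdef, zero_mul, Complex.exp_zero, mul_one])

/-- The corresponding differentiability statement. [cite: Zudilin2004, §4 (supporting lemma)] -/
theorem differentiableAt_line {k : ℕ} (hk : 1 ≤ k) (a₀ u₀ : ℂ) (a b u v : ℕ → ℂ) {η : ℝ} (hη : 0 < η)
    (hJη : IntegrableOn (sorokinIntegrand k (a₀.re + η) (fun n => (a n).re - η) (fun n => (b n).re - 2 * η))
      (Set.pi univ fun _ : Fin k => Icc (0 : ℝ) 1) volume) :
    DifferentiableAt ℂ (fun t : ℂ => ∫ x in Set.pi univ (fun _ : Fin k => Icc (0 : ℝ) 1),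
        (∏ j : Fin k, ((x j : ℝ) : ℂ) ^ ((a j + t * u j) - 1) * (1 - ((x j : ℝ) : ℂ)) ^ ((b j + t * v j) - (a j + t * u j) - 1)) *
          ((nestedQ (List.ofFn x) : ℝ) : ℂ) ^ (-(a₀ + t * u₀))) 0 :=
  (hasDerivAt_line hk a₀ u₀ a b u v hη hJη).differentiableAt

end Literature.NumberTheory.Irrationality.Zudilin2004.SorokinParameterHolomorphy

end Part5

/-!
## Part 6 — port of `Summits/KontsevichZagierPeriods/Zeta5Search/SorokinCornerPerturb.lean` (3 declarations kept)

# The corner conditions of `J_k` are open: a uniform perturbation room `η`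

Declarations of this Part (verbatim port; each keeps its own docstring and citation): `sum_perturb`, `exists_perturb`, `exists_integrable_perturb`.

Reference keys (see `references.bib` and the declarations' citations): [Zudilin2004].
-/

section Part6

namespace Literature.NumberTheory.Irrationality.Zudilin2004.SorokinCornerPerturb

open _root_.MeasureTheory _root_.Set _root_.Finset
open Literature.NumberTheory.Irrationality.Zudilin2002 (sorokinIntegrand)
open Literature.NumberTheory.Irrationality.Zudilin2004.SorokinConvergence

/-- The perturbed chain sum: `Σ_{m≤i}((b_{2m} − 2η) − (a_{2m} − η)) = Σ_{m≤i}(b_{2m} − a_{2m}) − (i+1)η`.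
[cite: Zudilin2004, §4 (supporting lemma)] -/
theorem sum_perturb (a b : ℕ → ℝ) (η : ℝ) (n : ℕ) :
    ∑ m ∈ range n, ((b (2 * m) - 2 * η) - (a (2 * m) - η)) = (∑ m ∈ range n, (b (2 * m) - a (2 * m))) - n * η := by
  rw [Finset.sum_congr rfl fun m _ => (by ring : (b (2 * m) - 2 * η) - (a (2 * m) - η) = (b (2 * m) - a (2 * m)) - η),
    sum_sub_distrib, sum_const, card_range, nsmul_eq_mul]

/-- **A uniform room `η`**: if the edge conditions `0 < a_j < b_j` (`j < k`) and the corner conditions of `J_k` hold at `(a₀; a | b)`,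
then for some `η > 0` they hold at `(a₀ + η; a_j − η | b_j − 2η)`. [cite: Zudilin2004, §4 (supporting lemma)] -/
theorem exists_perturb {k : ℕ} (hk : 1 ≤ k) (a₀ : ℝ) (a b : ℕ → ℝ) (hE : ∀ j, j < k → 0 < a j ∧ a j < b j)
    (hA : ∀ i, 2 * i + 2 ≤ k → a₀ < (∑ m ∈ range (i + 1), (b (2 * m) - a (2 * m))) + a (2 * i + 1))
    (hAodd : Odd k → a₀ < ∑ m ∈ range ((k + 1) / 2), (b (2 * m) - a (2 * m))) :
    ∃ η : ℝ, 0 < η ∧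
      (∀ j, j < k → 0 < a j - η ∧ a j - η < b j - 2 * η) ∧
      (∀ i, 2 * i + 2 ≤ k →
        a₀ + η < (∑ m ∈ range (i + 1), ((b (2 * m) - 2 * η) - (a (2 * m) - η))) + (a (2 * i + 1) - η)) ∧
      (Odd k → a₀ + η < ∑ m ∈ range ((k + 1) / 2), ((b (2 * m) - 2 * η) - (a (2 * m) - η))) := by
  classical
  -- the finite set of (positive) gaps
  set G : Finset ℝ := ((range k).image fun j => a j) ∪ ((range k).image fun j => b j - a j) ∪
      ((range (k / 2)).image fun i => (∑ m ∈ range (i + 1), (b (2 * m) - a (2 * m))) + a (2 * i + 1) - a₀) ∪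
      (if Odd k then {(∑ m ∈ range ((k + 1) / 2), (b (2 * m) - a (2 * m))) - a₀} else ∅) with hG
  have hne : G.Nonempty := ⟨a 0, by
    rw [hG]; simp only [Finset.mem_union, Finset.mem_image, Finset.mem_range]
    exact Or.inl (Or.inl (Or.inl ⟨0, hk, rfl⟩))⟩
  have hpos : ∀ g ∈ G, 0 < g := by
    intro g hg
    rw [hG] at hg
    simp only [Finset.mem_union, Finset.mem_image, Finset.mem_range] at hg
    rcases hg with ((⟨j, hj, rfl⟩ | ⟨j, hj, rfl⟩) | ⟨i, hi, rfl⟩) | hg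
    · exact (hE j hj).1
    · linarith [(hE j hj).2]
    · have := hA i (by omega); linarith
    · split_ifs at hg with hodd
      · rw [Finset.mem_singleton] at hg; rw [hg]; linarith [hAodd hodd]
      · simp at hg
  set g : ℝ := G.min' hne with hg
  have hg0 : 0 < g := (Finset.lt_min'_iff G hne).2 hpos
  have hle : ∀ x ∈ G, g ≤ x := fun x hx => Finset.min'_le G x hx
  refine ⟨g / (2 * ((k : ℝ) + 3)), by positivity, fun j hj => ?_, fun i hi => ?_, fun hodd => ?_⟩
  · have h1 : g ≤ a j := hle _ (by rw [hG]; simp only [Finset.mem_union, Finset.mem_image, Finset.mem_range]; exact Or.inl (Or.inl (Or.inl ⟨j, hj, rfl⟩)))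
    have h2 : g ≤ b j - a j := hle _ (by rw [hG]; simp only [Finset.mem_union, Finset.mem_image, Finset.mem_range]; exact Or.inl (Or.inl (Or.inr ⟨j, hj, rfl⟩)))
    have hk0 : (0 : ℝ) < 2 * ((k : ℝ) + 3) := by positivity
    have h3 : g / (2 * ((k : ℝ) + 3)) < g := by
      rw [div_lt_iff₀ hk0]; nlinarith
    constructor <;> linarith
  · have h1 : g ≤ (∑ m ∈ range (i + 1), (b (2 * m) - a (2 * m))) + a (2 * i + 1) - a₀ :=
      hle _ (by rw [hG]; simp only [Finset.mem_union, Finset.mem_image, Finset.mem_range]; exact Or.inl (Or.inr ⟨i, by omega, rfl⟩))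
    rw [sum_perturb]
    have hik : ((i : ℝ) + 1 + 2) * (g / (2 * ((k : ℝ) + 3))) ≤ g / 2 := by
      rw [← mul_div_assoc, div_le_div_iff₀ (by positivity) (by norm_num)]
      have : (i : ℝ) + 3 ≤ (k : ℝ) + 3 := by
        have : (i : ℝ) ≤ k := by exact_mod_cast (by omega : i ≤ k)
        linarith
      nlinarith
    push_cast
    nlinarith
  · have h1 : g ≤ (∑ m ∈ range ((k + 1) / 2), (b (2 * m) - a (2 * m))) - a₀ :=
      hle _ (by rw [hG]; simp only [Finset.mem_union, hodd, if_true, Finset.mem_singleton]; exact Or.inr trivial)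
    rw [sum_perturb]
    have hck : ((((k + 1) / 2 : ℕ) : ℝ) + 1) * (g / (2 * ((k : ℝ) + 3))) ≤ g / 2 := by
      rw [← mul_div_assoc, div_le_div_iff₀ (by positivity) (by norm_num)]
      have : (((k + 1) / 2 : ℕ) : ℝ) ≤ k := by exact_mod_cast (by omega : (k + 1) / 2 ≤ k)
      nlinarith
    nlinarith

/-- **Integrability at perturbed parameters from the corner conditions alone** (`k ≥ 1`, `a₀ ≥ 0`): there is `η > 0` with
the typed real integrand at `(a₀ + η; a_j − η | b_j − 2η)` integrable on `[0,1]^k` — the hypothesis `hJη` of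
`SorokinParameterHolomorphy.hasDerivAt_line`. [cite: Zudilin2004, §4 (supporting lemma)] -/
theorem exists_integrable_perturb {k : ℕ} (hk : 1 ≤ k) {a₀ : ℝ} (ha₀ : 0 ≤ a₀) (a b : ℕ → ℝ)
    (hE : ∀ j, j < k → 0 < a j ∧ a j < b j)
    (hA : ∀ i, 2 * i + 2 ≤ k → a₀ < (∑ m ∈ range (i + 1), (b (2 * m) - a (2 * m))) + a (2 * i + 1))
    (hAodd : Odd k → a₀ < ∑ m ∈ range ((k + 1) / 2), (b (2 * m) - a (2 * m))) :
    ∃ η : ℝ, 0 < η ∧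
      IntegrableOn (sorokinIntegrand k (a₀ + η) (fun n => a n - η) (fun n => b n - 2 * η))
        (Set.pi univ fun _ : Fin k => Icc (0 : ℝ) 1) volume := by
  obtain ⟨η, hη, hE', hA', hAodd'⟩ := exists_perturb hk a₀ a b hE hA hAodd
  exact ⟨η, hη, integrableOn_sorokinIntegrand hk (by linarith) hE' hA' hAodd'⟩

end Literature.NumberTheory.Irrationality.Zudilin2004.SorokinCornerPerturb

end Part6

/-!
## Part 7 — port of `Summits/KontsevichZagierPeriods/Zeta5Search/SorokinHolomorphyH0.lean` (1 declarations kept)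

# Holomorphy of Zudilin's `J_k` in the parameter `h₀`

Declarations of this Part (verbatim port; each keeps its own docstring and citation): `differentiableAt_shift`.

Reference keys (see `references.bib` and the declarations' citations): [Zudilin2004].
-/

section Part7

namespace Literature.NumberTheory.Irrationality.Zudilin2004.SorokinHolomorphyH0

open _root_.MeasureTheory _root_.Set _root_.Filter
open Literature.NumberTheory.Irrationality.Zudilin2002 (nestedQ sorokinIntegrand)
open Literature.NumberTheory.Irrationality.Zudilin2004.SorokinParameterHolomorphy (differentiableAt_line)
open Literature.NumberTheory.Irrationality.Zudilin2004.SorokinCornerPerturb (exists_integrable_perturb)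

/-- **`J_k` is holomorphic in `h₀`**: for `k ≥ 1`, complex `a₀` (`Re a₀ ≥ 0`), `a_j`, `c_j`, and a point `z` at which the corner conditions
hold for `(Re a₀; Re a_j | Re(1+z−c_j))` (edges `0 < Re a_j < Re(1+z−c_j)`, the mixed corners and, for odd `k`, the deepest corner),
`w ↦ ∫_{[0,1]^k} ∏_{j<k} x_j^{a_j−1}(1−x_j)^{(1+w−c_j)−a_j−1} · Q_k(x)^{−a₀} dx` is complex-differentiable at `z`.
[cite: Zudilin2004, §4 (supporting lemma)] -/
theorem differentiableAt_shift {k : ℕ} (hk : 1 ≤ k) (a₀ : ℂ) (ha₀ : 0 ≤ a₀.re) (a c : ℕ → ℂ) (z : ℂ)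
    (hE : ∀ j, j < k → 0 < (a j).re ∧ (a j).re < (1 + z - c j).re)
    (hA : ∀ i, 2 * i + 2 ≤ k →
      a₀.re < (∑ m ∈ Finset.range (i + 1), ((1 + z - c (2 * m)).re - (a (2 * m)).re)) + (a (2 * i + 1)).re)
    (hAodd : Odd k → a₀.re < ∑ m ∈ Finset.range ((k + 1) / 2), ((1 + z - c (2 * m)).re - (a (2 * m)).re)) :
    DifferentiableAt ℂ (fun w : ℂ => ∫ x in Set.pi univ (fun _ : Fin k => Icc (0 : ℝ) 1),
      (∏ j : Fin k, ((x j : ℝ) : ℂ) ^ (a j - 1) * (1 - ((x j : ℝ) : ℂ)) ^ ((1 + w - c j) - a j - 1)) *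
        ((nestedQ (List.ofFn x) : ℝ) : ℂ) ^ (-a₀)) z := by
  -- the `η`-room
  obtain ⟨η, hη, hJη⟩ := exists_integrable_perturb hk ha₀ (fun n => (a n).re) (fun n => (1 + z - c n).re) hE hA hAodd
  -- differentiability of `t ↦ J(…, b_j + t)` at `t = 0`
  have hd := differentiableAt_line hk a₀ 0 a (fun n => 1 + z - c n) (fun _ => 0) (fun _ => 1) hη hJη
  simp only [mul_zero, add_zero, mul_one] at hd
  -- recenter: `w = z + t`
  have hcomp : (fun w : ℂ => ∫ x in Set.pi univ (fun _ : Fin k => Icc (0 : ℝ) 1),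
      (∏ j : Fin k, ((x j : ℝ) : ℂ) ^ (a j - 1) * (1 - ((x j : ℝ) : ℂ)) ^ ((1 + w - c j) - a j - 1)) *
        ((nestedQ (List.ofFn x) : ℝ) : ℂ) ^ (-a₀)) =
      (fun t : ℂ => ∫ x in Set.pi univ (fun _ : Fin k => Icc (0 : ℝ) 1),
        (∏ j : Fin k, ((x j : ℝ) : ℂ) ^ (a j - 1) * (1 - ((x j : ℝ) : ℂ)) ^ ((1 + z - c j + t) - a j - 1)) *
          ((nestedQ (List.ofFn x) : ℝ) : ℂ) ^ (-a₀)) ∘ fun w => w - z := by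
    funext w
    simp only [Function.comp]
    congr 1
    funext x
    congr 1
    refine Finset.prod_congr rfl fun j _ => ?_
    rw [show 1 + z - c j + (w - z) = 1 + w - c j by ring]
  rw [hcomp]
  refine DifferentiableAt.comp z ?_ (differentiableAt_id.sub_const z)
  simpa using hd

end Literature.NumberTheory.Irrationality.Zudilin2004.SorokinHolomorphyH0

end Part7

/-!
## Part 8 — port of `Summits/KontsevichZagierPeriods/Zeta5Search/DougallTerminatingGamma.lean` (1 declarations kept)

# Dougall's terminating very-well-poised `₅F₄` sum in Gamma form over `ℂ`

Declarations of this Part (verbatim port; each keeps its own docstring and citation): `add_nat_ne_zero`.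

Reference keys (see `references.bib` and the declarations' citations): [Zudilin2004].
-/

section Part8

namespace Literature.NumberTheory.Irrationality.Zudilin2004.DougallTerminatingGamma

open _root_.Finset

/-- Off the poles, `x + i ≠ 0` for every natural `i`. [cite: Zudilin2004, §4 (supporting lemma)] -/
theorem add_nat_ne_zero {x : ℂ} (hx : ∀ n : ℕ, x ≠ -(n : ℂ)) (i : ℕ) : x + i ≠ 0 :=
  fun h => hx i (by linear_combination h)

end Literature.NumberTheory.Irrationality.Zudilin2004.DougallTerminatingGamma

end Part8

/-!
## Part 9 — port of `Summits/KontsevichZagierPeriods/Zeta5Search/DougallCarlsonSides.lean` (2 declarations kept)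

# The two sides of the Carlson function for Dougall's `₅F₄` sum, at the integers

Declarations of this Part (verbatim port; each keeps its own docstring and citation): `differentiableAt_gamma_side`, `differentiableOn_gamma_side`.

Reference keys (see `references.bib` and the declarations' citations): [Zudilin2004].
-/

section Part9

namespace Literature.NumberTheory.Irrationality.Zudilin2004.DougallCarlsonSides

open _root_.Finset
open Literature.NumberTheory.Irrationality.Zudilin2004.DougallTerminatingGamma

/-- **B5c — holomorphy of the Gamma side** at every `z` where its two numerator Gammas have no pole
(`h₀+1+z, h₀−h₁−h₂+1+z ∉ −ℕ`); the denominator Gammas enter through the entire function `1/Γ`.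
[cite: Zudilin2004, §4 (supporting lemma)] -/
theorem differentiableAt_gamma_side (h₀ h₁ h₂ : ℂ) {z : ℂ} (hz1 : ∀ n : ℕ, h₀ + 1 + z ≠ -(n : ℂ))
    (hz2 : ∀ n : ℕ, h₀ - h₁ - h₂ + 1 + z ≠ -(n : ℂ)) :
    DifferentiableAt ℂ (fun z : ℂ => Complex.Gamma h₁ * Complex.Gamma h₂ * Complex.Gamma (h₀ + 1 + z) *
        Complex.Gamma (h₀ - h₁ - h₂ + 1 + z) /
        (Complex.Gamma (h₀ - h₁ - h₂ + 1) * Complex.Gamma (h₀ - h₁ + 1 + z) * Complex.Gamma (h₀ - h₂ + 1 + z))) z := by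
  have e : (fun z : ℂ => Complex.Gamma h₁ * Complex.Gamma h₂ * Complex.Gamma (h₀ + 1 + z) *
        Complex.Gamma (h₀ - h₁ - h₂ + 1 + z) /
        (Complex.Gamma (h₀ - h₁ - h₂ + 1) * Complex.Gamma (h₀ - h₁ + 1 + z) * Complex.Gamma (h₀ - h₂ + 1 + z))) =
      fun z : ℂ => (Complex.Gamma h₁ * Complex.Gamma h₂ * (Complex.Gamma (h₀ - h₁ - h₂ + 1))⁻¹) *
        (Complex.Gamma (h₀ + 1 + z) * Complex.Gamma (h₀ - h₁ - h₂ + 1 + z) *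
          ((Complex.Gamma (h₀ - h₁ + 1 + z))⁻¹ * (Complex.Gamma (h₀ - h₂ + 1 + z))⁻¹)) := by
    funext z; ring
  rw [e]
  have d1 : DifferentiableAt ℂ (fun z : ℂ => Complex.Gamma (h₀ + 1 + z)) z :=
    (Complex.differentiableAt_Gamma _ (fun m => hz1 m)).comp z (by fun_prop)
  have d2 : DifferentiableAt ℂ (fun z : ℂ => Complex.Gamma (h₀ - h₁ - h₂ + 1 + z)) z :=
    (Complex.differentiableAt_Gamma _ (fun m => hz2 m)).comp z (by fun_prop)
  have d3 : DifferentiableAt ℂ (fun z : ℂ => (Complex.Gamma (h₀ - h₁ + 1 + z))⁻¹) z :=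
    DifferentiableAt.comp (g := fun s : ℂ => (Complex.Gamma s)⁻¹) (f := fun z : ℂ => h₀ - h₁ + 1 + z) z
      Complex.differentiable_one_div_Gamma.differentiableAt (by fun_prop)
  have d4 : DifferentiableAt ℂ (fun z : ℂ => (Complex.Gamma (h₀ - h₂ + 1 + z))⁻¹) z :=
    DifferentiableAt.comp (g := fun s : ℂ => (Complex.Gamma s)⁻¹) (f := fun z : ℂ => h₀ - h₂ + 1 + z) z
      Complex.differentiable_one_div_Gamma.differentiableAt (by fun_prop)
  exact ((d1.mul d2).mul (d3.mul d4)).const_mul _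

/-- **B5c — the Gamma side is holomorphic on every right half-plane clear of its poles**: for real `c` with
`c ≥ −Re(h₀+1)` and `c ≥ −Re(h₀−h₁−h₂+1)`, on `{z | c < Re z}`. [cite: Zudilin2004, §4 (supporting lemma)] -/
theorem differentiableOn_gamma_side (h₀ h₁ h₂ : ℂ) {c : ℝ} (hc1 : -(h₀ + 1).re ≤ c) (hc2 : -(h₀ - h₁ - h₂ + 1).re ≤ c) :
    DifferentiableOn ℂ (fun z : ℂ => Complex.Gamma h₁ * Complex.Gamma h₂ * Complex.Gamma (h₀ + 1 + z) *
        Complex.Gamma (h₀ - h₁ - h₂ + 1 + z) /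
        (Complex.Gamma (h₀ - h₁ - h₂ + 1) * Complex.Gamma (h₀ - h₁ + 1 + z) * Complex.Gamma (h₀ - h₂ + 1 + z)))
      {z : ℂ | c < z.re} := by
  intro z hz
  simp only [Complex.add_re, Complex.sub_re, Complex.one_re] at hc1 hc2
  refine (differentiableAt_gamma_side h₀ h₁ h₂ ?_ ?_).differentiableWithinAt
  · intro n h
    have := congrArg Complex.re h
    simp at this
    have hz' : c < z.re := hz
    linarith [n.cast_nonneg (α := ℝ)]
  · intro n h
    have := congrArg Complex.re h
    simp at this
    have hz' : c < z.re := hz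
    linarith [n.cast_nonneg (α := ℝ)]

end Literature.NumberTheory.Irrationality.Zudilin2004.DougallCarlsonSides

end Part9

/-!
## Part 10 — port of `Summits/KontsevichZagierPeriods/Zeta5Search/DougallSeriesSide.lean` (1 declarations kept)

# The series side of Dougall's Carlson function: termwise bound, holomorphy, boundedness

Declarations of this Part (verbatim port; each keeps its own docstring and citation): `norm_neg_add_nat_le`.

Reference keys (see `references.bib` and the declarations' citations): [Zudilin2004].
-/

section Part10

namespace Literature.NumberTheory.Irrationality.Zudilin2004.DougallSeriesSide

open _root_.Finset _root_.Filter

variable {h₀ : ℝ} {z : ℂ}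

/-- **Factor comparison**: for `h₀ > −1` and `Re z > −(1+h₀)/2`, `|i − z| ≤ |h₀+1+z+i|` for every natural `i`.
[cite: Zudilin2004, §4 (supporting lemma)] -/
theorem norm_neg_add_nat_le (hh : -1 < h₀) (hz : -(1 + h₀) / 2 < z.re) (i : ℕ) :
    ‖-z + (i : ℂ)‖ ≤ ‖(h₀ : ℂ) + 1 + z + i‖ := by
  rw [Complex.norm_def, Complex.norm_def]
  refine Real.sqrt_le_sqrt ?_
  rw [Complex.normSq_apply, Complex.normSq_apply]
  simp only [Complex.add_re, Complex.neg_re, Complex.natCast_re, Complex.add_im, Complex.neg_im,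
    Complex.natCast_im, Complex.ofReal_re, Complex.ofReal_im, Complex.one_re, Complex.one_im]
  have hi : (0 : ℝ) ≤ i := i.cast_nonneg
  nlinarith [mul_nonneg (show (0 : ℝ) ≤ h₀ + 1 + 2 * z.re by linarith) (show (0 : ℝ) ≤ h₀ + 1 + 2 * i by linarith)]

end Literature.NumberTheory.Irrationality.Zudilin2004.DougallSeriesSide

end Part10

/-!
## Part 11 — port of `Summits/KontsevichZagierPeriods/Zeta5Search/DougallGammaSideBound.lean` (5 declarations kept)

# Polynomial growth of the Gamma side of Dougall's Carlson function

Declarations of this Part (verbatim port; each keeps its own docstring and citation): `norm_betaIntegrand`, `norm_betaIntegral_le`, `norm_Gamma_div_Gamma_add_le`, `norm_Gamma_add_div_Gamma_le`, `real_betaIntegral_nonneg`.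

Reference keys (see `references.bib` and the declarations' citations): [Zudilin2004].
-/

section Part11

namespace Literature.NumberTheory.Irrationality.Zudilin2004.DougallGammaSideBound

open _root_.MeasureTheory _root_.Set _root_.Filter

/-- Norm of the Beta integrand on `(0,1)`. [cite: Zudilin2004, §4 (supporting lemma)] -/
theorem norm_betaIntegrand {t : ℝ} (ht : t ∈ Ioo (0 : ℝ) 1) (u v : ℂ) :
    ‖(t : ℂ) ^ (u - 1) * (1 - (t : ℂ)) ^ (v - 1)‖ = t ^ (u.re - 1) * (1 - t) ^ (v.re - 1) := by
  have h1 : 0 < 1 - t := by linarith [ht.2]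
  rw [norm_mul, Complex.norm_cpow_eq_rpow_re_of_pos ht.1,
    show (1 : ℂ) - (t : ℂ) = ((1 - t : ℝ) : ℂ) by push_cast; ring, Complex.norm_cpow_eq_rpow_re_of_pos h1]
  simp

/-- **`‖B(u,v)‖ ≤ ∫₀¹ t^{a−1}(1−t)^{Re v−1} dt`** for `0 < a ≤ Re u` and `0 < Re v` (on `(0,1)` the modulus of the
integrand is `t^{Re u−1}(1−t)^{Re v−1} ≤ t^{a−1}(1−t)^{Re v−1}`). [cite: Zudilin2004, §4 (supporting lemma)] -/
theorem norm_betaIntegral_le {u v : ℂ} {a : ℝ} (ha : 0 < a) (hau : a ≤ u.re) (hv : 0 < v.re) :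
    ‖Complex.betaIntegral u v‖ ≤ ∫ t in Ioo (0 : ℝ) 1, t ^ (a - 1) * (1 - t) ^ (v.re - 1) := by
  have hu : 0 < u.re := lt_of_lt_of_le ha hau
  have hconv := Complex.betaIntegral_convergent hu hv
  unfold Complex.betaIntegral
  calc ‖∫ x in (0 : ℝ)..1, (x : ℂ) ^ (u - 1) * (1 - (x : ℂ)) ^ (v - 1)‖
      ≤ ∫ x in Set.uIoc (0 : ℝ) 1, ‖(x : ℂ) ^ (u - 1) * (1 - (x : ℂ)) ^ (v - 1)‖ :=
        intervalIntegral.norm_integral_le_integral_norm_uIoc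
    _ = ∫ x in Ioo (0 : ℝ) 1, ‖(x : ℂ) ^ (u - 1) * (1 - (x : ℂ)) ^ (v - 1)‖ := by
        rw [uIoc_of_le zero_le_one, integral_Ioc_eq_integral_Ioo]
    _ ≤ ∫ t in Ioo (0 : ℝ) 1, t ^ (a - 1) * (1 - t) ^ (v.re - 1) := by
        refine setIntegral_mono_on ((hconv.norm).1.mono_set Ioo_subset_Ioc_self)
          (Literature.Analysis.SpecialFunctions.integrableOn_Ioo_rpow_mul_one_sub_rpow ha hv) measurableSet_Ioo
          fun t ht => ?_
        rw [norm_betaIntegrand ht]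
        have h1 : 0 ≤ (1 - t) ^ (v.re - 1) := Real.rpow_nonneg (by linarith [ht.2]) _
        exact mul_le_mul_of_nonneg_right
          (Real.rpow_le_rpow_of_exponent_ge ht.1 ht.2.le (by linarith)) h1

/-- **The decaying ratio is bounded**: for real `b > 0` and `0 < a ≤ Re s`,
`‖Γ(s)/Γ(s+b)‖ ≤ (∫₀¹ t^{a−1}(1−t)^{b−1} dt)/Γ(b)` (from `Γ(s)Γ(b) = Γ(s+b)B(s,b)`).
[cite: Zudilin2004, §4 (supporting lemma)] -/
theorem norm_Gamma_div_Gamma_add_le {s : ℂ} {a b : ℝ} (ha : 0 < a) (has : a ≤ s.re) (hb : 0 < b) :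
    ‖Complex.Gamma s / Complex.Gamma (s + b)‖ ≤
      (∫ t in Ioo (0 : ℝ) 1, t ^ (a - 1) * (1 - t) ^ (b - 1)) / Real.Gamma b := by
  have hs : 0 < s.re := lt_of_lt_of_le ha has
  have hbc : 0 < ((b : ℂ)).re := by simpa using hb
  have key := Complex.Gamma_mul_Gamma_eq_betaIntegral hs hbc
  have hΓsb : Complex.Gamma (s + b) ≠ 0 := Complex.Gamma_ne_zero_of_re_pos (by simp; linarith)
  have hΓb : Complex.Gamma (b : ℂ) ≠ 0 := Complex.Gamma_ne_zero_of_re_pos hbc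
  have hΓbR : 0 < Real.Gamma b := Real.Gamma_pos_of_pos hb
  have e : Complex.Gamma s / Complex.Gamma (s + b) = Complex.betaIntegral s b / Complex.Gamma (b : ℂ) := by
    field_simp
    linear_combination key
  rw [e, norm_div, Complex.Gamma_ofReal, Complex.norm_real, Real.norm_of_nonneg hΓbR.le]
  exact div_le_div_of_nonneg_right (by simpa using norm_betaIntegral_le (v := (b : ℂ)) ha has hbc) hΓbR.le

/-- **The fractional part of the growing ratio**: for `0 ≤ θ < 1` and `0 < a ≤ Re s`,
`‖Γ(s+θ)/Γ(s)‖ ≤ ‖s‖·(∫₀¹ t^{a+θ−1}(1−t)^{−θ} dt)/Γ(1−θ)` (from `Γ(s+θ)Γ(1−θ) = Γ(s+1)B(s+θ,1−θ)`, `Γ(s+1) = sΓ(s)`).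
[cite: Zudilin2004, §4 (supporting lemma)] -/
theorem norm_Gamma_add_div_Gamma_le {s : ℂ} {a θ : ℝ} (ha : 0 < a) (has : a ≤ s.re) (hθ0 : 0 ≤ θ) (hθ1 : θ < 1) :
    ‖Complex.Gamma (s + θ) / Complex.Gamma s‖ ≤
      ‖s‖ * ((∫ t in Ioo (0 : ℝ) 1, t ^ (a + θ - 1) * (1 - t) ^ ((1 - θ) - 1)) / Real.Gamma (1 - θ)) := by
  have hs : 0 < s.re := lt_of_lt_of_le ha has
  have hsθ : 0 < (s + θ).re := by simp; linarith
  have h1θ : 0 < (((1 - θ : ℝ)) : ℂ).re := by simp; linarith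
  have key := Complex.Gamma_mul_Gamma_eq_betaIntegral hsθ h1θ
  rw [show s + (θ : ℂ) + ((1 - θ : ℝ) : ℂ) = s + 1 by push_cast; ring,
    Complex.Gamma_add_one _ (by intro h; rw [h] at hs; simp at hs)] at key
  have hΓs : Complex.Gamma s ≠ 0 := Complex.Gamma_ne_zero_of_re_pos hs
  have hΓ1 : Complex.Gamma (((1 - θ : ℝ)) : ℂ) ≠ 0 := Complex.Gamma_ne_zero_of_re_pos h1θ
  have hΓ1R : 0 < Real.Gamma (1 - θ) := Real.Gamma_pos_of_pos (by linarith)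
  have e : Complex.Gamma (s + θ) / Complex.Gamma s =
      s * (Complex.betaIntegral (s + θ) ((1 - θ : ℝ)) / Complex.Gamma (((1 - θ : ℝ)) : ℂ)) := by
    field_simp
    linear_combination key
  rw [e, norm_mul, norm_div, Complex.Gamma_ofReal, Complex.norm_real, Real.norm_of_nonneg hΓ1R.le]
  refine mul_le_mul_of_nonneg_left ?_ (norm_nonneg _)
  refine div_le_div_of_nonneg_right ?_ hΓ1R.le
  have h := norm_betaIntegral_le (u := s + θ) (v := ((1 - θ : ℝ) : ℂ)) (a := a + θ) (by linarith)
    (by simp; linarith) h1θ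
  simpa using h

/-- Nonnegativity of the real Beta integrals used as constants. [cite: Zudilin2004, §4 (supporting lemma)] -/
theorem real_betaIntegral_nonneg (a b : ℝ) : 0 ≤ ∫ t in Ioo (0 : ℝ) 1, t ^ (a - 1) * (1 - t) ^ (b - 1) :=
  setIntegral_nonneg measurableSet_Ioo fun t ht =>
    mul_nonneg (Real.rpow_nonneg ht.1.le _) (Real.rpow_nonneg (by linarith [ht.2]) _)

end Literature.NumberTheory.Irrationality.Zudilin2004.DougallGammaSideBound

end Part11

/-!
## Part 12 — port of `Summits/KontsevichZagierPeriods/Zeta5Search/DougallCoefficientBounds.lean` (10 declarations kept)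

# Wendel's inequalities and polynomial-order bounds for real Gamma ratios

Declarations of this Part (verbatim port; each keeps its own docstring and citation): `Gamma_add_le_rpow_mul_Gamma`, `mul_rpow_mul_Gamma_le_Gamma_add`, `Gamma_add_nat_eq`, `Gamma_add_le_rpow_mul_Gamma_of_nonneg`, `Gamma_add_ge`, `Gamma_ratio_le`, `dougallCoeff_le`, `summable_dougallCoeff`, `dougallCoeff_complex`, `summable_norm_dougallCoeff_complex`.

Reference keys (see `references.bib` and the declarations' citations): [Zudilin2004].
-/

section Part12

namespace Literature.NumberTheory.Irrationality.Zudilin2004.DougallCoefficientBounds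

open _root_.Finset _root_.Filter _root_.Real

/-! ### 1. Wendel's inequalities -/

/-- **Wendel (upper)**: `Γ(x+θ) ≤ x^θ·Γ(x)` for `x > 0`, `0 ≤ θ ≤ 1` (log-convexity of `Γ` between `x` and `x+1`).
[cite: Zudilin2004, §4 (supporting lemma)] -/
theorem Gamma_add_le_rpow_mul_Gamma {x θ : ℝ} (hx : 0 < x) (h0 : 0 ≤ θ) (h1 : θ ≤ 1) :
    Real.Gamma (x + θ) ≤ x ^ θ * Real.Gamma x := by
  have hΓ : 0 < Real.Gamma x := Real.Gamma_pos_of_pos hx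
  rcases h0.eq_or_lt with h0' | h0'
  · rw [← h0']; simp
  rcases h1.lt_or_eq with h1' | h1'
  · have key := Real.Gamma_mul_add_mul_le_rpow_Gamma_mul_rpow_Gamma hx (by linarith : 0 < x + 1)
      (by linarith : 0 < 1 - θ) h0' (by ring)
    rw [show (1 - θ) * x + θ * (x + 1) = x + θ by ring, Real.Gamma_add_one hx.ne',
      Real.mul_rpow hx.le hΓ.le] at key
    calc Real.Gamma (x + θ) ≤ Real.Gamma x ^ (1 - θ) * (x ^ θ * Real.Gamma x ^ θ) := key
      _ = x ^ θ * (Real.Gamma x ^ (1 - θ) * Real.Gamma x ^ θ) := by ring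
      _ = x ^ θ * Real.Gamma x := by rw [← Real.rpow_add hΓ, show (1 - θ) + θ = 1 by ring, Real.rpow_one]
  · rw [h1', Real.Gamma_add_one hx.ne', Real.rpow_one]

/-- **Wendel (lower)**: `x·(x+θ)^{θ−1}·Γ(x) ≤ Γ(x+θ)` for `x > 0`, `0 ≤ θ ≤ 1`.
[cite: Zudilin2004, §4 (supporting lemma)] -/
theorem mul_rpow_mul_Gamma_le_Gamma_add {x θ : ℝ} (hx : 0 < x) (h0 : 0 ≤ θ) (h1 : θ ≤ 1) :
    x * (x + θ) ^ (θ - 1) * Real.Gamma x ≤ Real.Gamma (x + θ) := by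
  have hxθ : 0 < x + θ := by linarith
  have h := Gamma_add_le_rpow_mul_Gamma hxθ (by linarith : 0 ≤ 1 - θ) (by linarith : 1 - θ ≤ 1)
  rw [show x + θ + (1 - θ) = x + 1 by ring, Real.Gamma_add_one hx.ne'] at h
  have hpow : 0 < (x + θ) ^ (θ - 1) := Real.rpow_pos_of_pos hxθ _
  have e : (x + θ) ^ (θ - 1) * (x + θ) ^ (1 - θ) = 1 := by
    rw [← Real.rpow_add hxθ, show (θ - 1) + (1 - θ) = 0 by ring, Real.rpow_zero]
  calc x * (x + θ) ^ (θ - 1) * Real.Gamma x = (x + θ) ^ (θ - 1) * (x * Real.Gamma x) := by ring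
    _ ≤ (x + θ) ^ (θ - 1) * ((x + θ) ^ (1 - θ) * Real.Gamma (x + θ)) := mul_le_mul_of_nonneg_left h hpow.le
    _ = Real.Gamma (x + θ) := by rw [← mul_assoc, e, one_mul]

/-! ### 2. Real shifts by an arbitrary `a ≥ 0` -/

/-- `Γ(y + n) = Γ(y)·∏_{i<n}(y+i)` for `y > 0`. [cite: Zudilin2004, §4 (supporting lemma)] -/
theorem Gamma_add_nat_eq (y : ℝ) (hy : 0 < y) (n : ℕ) :
    Real.Gamma (y + n) = Real.Gamma y * ∏ i ∈ range n, (y + i) := by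
  induction n with
  | zero => simp
  | succ n ih =>
    rw [Nat.cast_succ, ← add_assoc, Real.Gamma_add_one (by positivity), ih, prod_range_succ]
    ring

/-- **Upper shift bound**: `Γ(x+a) ≤ (x+a)^a·Γ(x)` for `x ≥ 1`, `a ≥ 0`. [cite: Zudilin2004, §4 (supporting lemma)] -/
theorem Gamma_add_le_rpow_mul_Gamma_of_nonneg {x a : ℝ} (hx : 1 ≤ x) (ha : 0 ≤ a) :
    Real.Gamma (x + a) ≤ (x + a) ^ a * Real.Gamma x := by
  set n : ℕ := ⌊a⌋₊ with hn
  set θ : ℝ := a - n with hθ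
  have hθ0 : 0 ≤ θ := by rw [hθ]; linarith [Nat.floor_le ha]
  have hθ1 : θ < 1 := by rw [hθ]; linarith [Nat.lt_floor_add_one a]
  have hx0 : 0 < x := by linarith
  have hΓ : 0 < Real.Gamma x := Real.Gamma_pos_of_pos hx0
  have hxθ : 0 < x + θ := by linarith
  have e1 : x + a = (x + θ) + n := by rw [hθ]; ring
  have hprod : ∏ i ∈ range n, (x + θ + i) ≤ (x + a) ^ (n : ℝ) := by
    rw [Real.rpow_natCast]
    calc ∏ i ∈ range n, (x + θ + i) ≤ ∏ _i ∈ range n, (x + a) := by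
          refine prod_le_prod (fun i _ => by positivity) fun i hi => ?_
          have : (i : ℝ) + 1 ≤ n := by exact_mod_cast mem_range.1 hi
          linarith
      _ = (x + a) ^ n := by simp
  have hW : Real.Gamma (x + θ) ≤ (x + a) ^ θ * Real.Gamma x :=
    (Gamma_add_le_rpow_mul_Gamma hx0 hθ0 hθ1.le).trans
      (mul_le_mul_of_nonneg_right (Real.rpow_le_rpow hx0.le (by linarith) hθ0) hΓ.le)
  have e2 : (x + a) ^ a = (x + a) ^ θ * (x + a) ^ (n : ℝ) := by
    rw [← Real.rpow_add (by linarith)]; congr 1; rw [hθ]; ring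
  rw [show Real.Gamma (x + a) = Real.Gamma ((x + θ) + n) by rw [e1], Gamma_add_nat_eq _ hxθ n, e2]
  calc Real.Gamma (x + θ) * ∏ i ∈ range n, (x + θ + i)
      ≤ ((x + a) ^ θ * Real.Gamma x) * (x + a) ^ (n : ℝ) :=
        mul_le_mul hW hprod (prod_nonneg fun i _ => by positivity) (by positivity)
    _ = (x + a) ^ θ * (x + a) ^ (n : ℝ) * Real.Gamma x := by ring

/-- **Lower shift bound**: `x^b·Γ(x) ≤ 2·Γ(x+b)` for `x ≥ 1`, `b ≥ 0`. [cite: Zudilin2004, §4 (supporting lemma)] -/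
theorem Gamma_add_ge {x b : ℝ} (hx : 1 ≤ x) (hb : 0 ≤ b) : x ^ b * Real.Gamma x ≤ 2 * Real.Gamma (x + b) := by
  set m : ℕ := ⌊b⌋₊ with hm
  set φ : ℝ := b - m with hφ
  have hφ0 : 0 ≤ φ := by rw [hφ]; linarith [Nat.floor_le hb]
  have hφ1 : φ < 1 := by rw [hφ]; linarith [Nat.lt_floor_add_one b]
  have hx0 : 0 < x := by linarith
  have hΓ : 0 < Real.Gamma x := Real.Gamma_pos_of_pos hx0
  have hxφ : 0 < x + φ := by linarith
  have e1 : x + b = (x + φ) + m := by rw [hφ]; ring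
  -- the integer part: `∏ (x+φ+i) ≥ x^m`
  have hprod : x ^ (m : ℝ) ≤ ∏ i ∈ range m, (x + φ + i) := by
    rw [Real.rpow_natCast]
    calc x ^ m = ∏ _i ∈ range m, x := by simp
      _ ≤ ∏ i ∈ range m, (x + φ + i) :=
          prod_le_prod (fun i _ => hx0.le) fun i _ => by linarith [(i.cast_nonneg : (0 : ℝ) ≤ i)]
  -- the fractional part: `x^φ Γ(x) ≤ 2 Γ(x+φ)` from Wendel's lower bound and `(x+φ)^{φ−1} ≥ (2x)^{φ−1}`
  have hfrac : x ^ φ * Real.Gamma x ≤ 2 * Real.Gamma (x + φ) := by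
    have hW := mul_rpow_mul_Gamma_le_Gamma_add hx0 hφ0 hφ1.le
    have h2x : (x + φ) ^ (φ - 1) ≥ (2 * x) ^ (φ - 1) :=
      Real.rpow_le_rpow_of_nonpos hxφ (by linarith) (by linarith)
    have e2 : (2 * x) ^ (φ - 1) = 2 ^ (φ - 1) * (x ^ φ * x⁻¹) := by
      rw [Real.mul_rpow (by norm_num) hx0.le, Real.rpow_sub hx0, Real.rpow_one, div_eq_mul_inv]
    have h2φ : (1 : ℝ) / 2 ≤ 2 ^ (φ - 1) := by
      rw [show (1 : ℝ) / 2 = 2 ^ (-1 : ℝ) by norm_num]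
      exact Real.rpow_le_rpow_of_exponent_le (by norm_num) (by linarith)
    have key : x * (2 * x) ^ (φ - 1) * Real.Gamma x ≤ Real.Gamma (x + φ) :=
      le_trans (by gcongr) hW
    rw [e2] at key
    have e3 : x * (2 ^ (φ - 1) * (x ^ φ * x⁻¹)) * Real.Gamma x = 2 ^ (φ - 1) * (x ^ φ * Real.Gamma x) := by
      field_simp
    rw [e3] at key
    have hpos : 0 ≤ x ^ φ * Real.Gamma x := by positivity
    nlinarith
  have e2 : x ^ b = x ^ φ * x ^ (m : ℝ) := by rw [← Real.rpow_add hx0]; congr 1; rw [hφ]; ring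
  rw [show Real.Gamma (x + b) = Real.Gamma ((x + φ) + m) by rw [e1], Gamma_add_nat_eq _ hxφ m, e2]
  calc x ^ φ * x ^ (m : ℝ) * Real.Gamma x = (x ^ φ * Real.Gamma x) * x ^ (m : ℝ) := by ring
    _ ≤ (2 * Real.Gamma (x + φ)) * ∏ i ∈ range m, (x + φ + i) :=
        mul_le_mul hfrac hprod (by positivity) (by positivity)
    _ = 2 * (Real.Gamma (x + φ) * ∏ i ∈ range m, (x + φ + i)) := by ring

/-- **Two-sided polynomial order of a Gamma ratio (upper bound)**: for `a, b ≥ 0` and `x ≥ max 1 a`,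
`Γ(x+a)/Γ(x+b) ≤ 2^{1+a}·x^{a−b}`. [cite: Zudilin2004, §4 (supporting lemma)] -/
theorem Gamma_ratio_le {x a b : ℝ} (hx : 1 ≤ x) (hxa : a ≤ x) (ha : 0 ≤ a) (hb : 0 ≤ b) :
    Real.Gamma (x + a) / Real.Gamma (x + b) ≤ 2 ^ (1 + a) * x ^ (a - b) := by
  have hx0 : 0 < x := by linarith
  have hΓ : 0 < Real.Gamma x := Real.Gamma_pos_of_pos hx0
  have hΓb : 0 < Real.Gamma (x + b) := Real.Gamma_pos_of_pos (by linarith)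
  have h1 := Gamma_add_le_rpow_mul_Gamma_of_nonneg hx ha
  have h2 := Gamma_add_ge hx hb
  have h3 : (x + a) ^ a ≤ (2 * x) ^ a := Real.rpow_le_rpow (by linarith) (by linarith) ha
  rw [div_le_iff₀ hΓb]
  have e : (2 : ℝ) ^ (1 + a) * x ^ (a - b) * Real.Gamma (x + b) =
      (2 * x) ^ a * (x ^ b)⁻¹ * (2 * Real.Gamma (x + b)) := by
    rw [Real.rpow_add (by norm_num), Real.rpow_one, Real.mul_rpow (by norm_num) hx0.le, Real.rpow_sub hx0]
    field_simp
  rw [e]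
  have hxb : 0 < x ^ b := Real.rpow_pos_of_pos hx0 _
  calc Real.Gamma (x + a) ≤ (x + a) ^ a * Real.Gamma x := h1
    _ = (x + a) ^ a * (x ^ b)⁻¹ * (x ^ b * Real.Gamma x) := by field_simp
    _ ≤ (2 * x) ^ a * (x ^ b)⁻¹ * (2 * Real.Gamma (x + b)) := by gcongr

/-! ### 3. The Dougall coefficients: polynomial order and summability -/

/-- **Order of the Dougall coefficients**: for real `h₀, h₁, h₂ > 0` with `h₁, h₂ < h₀+1` there is `K` with
`(h₀+2μ)·Γ(h₀+μ)Γ(h₁+μ)Γ(h₂+μ)/(Γ(μ+1)Γ(h₀−h₁+1+μ)Γ(h₀−h₂+1+μ)) ≤ K·μ^{2(h₁+h₂)−h₀−2}` for all naturals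
`μ ≥ max(1, h₀, h₁, h₂)`. [cite: Zudilin2004, §4 (supporting lemma)] -/
theorem dougallCoeff_le (h₀ h₁ h₂ : ℝ) (hh₀ : 0 < h₀) (hh₁ : 0 < h₁) (hh₂ : 0 < h₂) (h1' : h₁ < h₀ + 1)
    (h2' : h₂ < h₀ + 1) :
    ∃ K : ℝ, ∀ μ : ℕ, max 1 (max h₀ (max h₁ h₂)) ≤ (μ : ℝ) →
      (h₀ + 2 * μ) * (Real.Gamma (h₀ + μ) * Real.Gamma (h₁ + μ) * Real.Gamma (h₂ + μ)) /
          (Real.Gamma ((μ : ℝ) + 1) * Real.Gamma (h₀ - h₁ + 1 + μ) * Real.Gamma (h₀ - h₂ + 1 + μ)) ≤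
        K * (μ : ℝ) ^ (2 * (h₁ + h₂) - h₀ - 2) := by
  refine ⟨3 * 2 ^ (1 + h₀) * 2 ^ (1 + h₁) * 2 ^ (1 + h₂), fun μ hμ => ?_⟩
  set x : ℝ := (μ : ℝ) with hx
  have hx1 : 1 ≤ x := le_trans (le_max_left _ _) hμ
  have hx0 : 0 < x := by linarith
  have hxh₀ : h₀ ≤ x := le_trans ((le_max_left _ _).trans (le_max_right _ _)) hμ
  have hxh₁ : h₁ ≤ x := le_trans (((le_max_left _ _).trans (le_max_right _ _)).trans (le_max_right _ _)) hμ
  have hxh₂ : h₂ ≤ x := le_trans (((le_max_right _ _).trans (le_max_right _ _)).trans (le_max_right _ _)) hμ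
  -- the three ratios
  have r0 := Gamma_ratio_le (a := h₀) (b := 1) hx1 hxh₀ hh₀.le zero_le_one
  have r1 := Gamma_ratio_le (a := h₁) (b := h₀ - h₁ + 1) hx1 hxh₁ hh₁.le (by linarith)
  have r2 := Gamma_ratio_le (a := h₂) (b := h₀ - h₂ + 1) hx1 hxh₂ hh₂.le (by linarith)
  have hG1 : 0 < Real.Gamma (x + 1) := Real.Gamma_pos_of_pos (by linarith)
  have hG2 : 0 < Real.Gamma (x + (h₀ - h₁ + 1)) := Real.Gamma_pos_of_pos (by linarith)
  have hG3 : 0 < Real.Gamma (x + (h₀ - h₂ + 1)) := Real.Gamma_pos_of_pos (by linarith)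
  have hP0 : 0 ≤ Real.Gamma (x + h₀) / Real.Gamma (x + 1) := by positivity
  have hP1 : 0 ≤ Real.Gamma (x + h₁) / Real.Gamma (x + (h₀ - h₁ + 1)) := by positivity
  have hP2 : 0 ≤ Real.Gamma (x + h₂) / Real.Gamma (x + (h₀ - h₂ + 1)) := by positivity
  have e : (h₀ + 2 * x) * (Real.Gamma (h₀ + x) * Real.Gamma (h₁ + x) * Real.Gamma (h₂ + x)) /
        (Real.Gamma (x + 1) * Real.Gamma (h₀ - h₁ + 1 + x) * Real.Gamma (h₀ - h₂ + 1 + x)) =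
      (h₀ + 2 * x) * (Real.Gamma (x + h₀) / Real.Gamma (x + 1)) *
        (Real.Gamma (x + h₁) / Real.Gamma (x + (h₀ - h₁ + 1))) * (Real.Gamma (x + h₂) / Real.Gamma (x + (h₀ - h₂ + 1))) := by
    rw [add_comm h₀ x, add_comm h₁ x, add_comm h₂ x, add_comm (h₀ - h₁ + 1) x, add_comm (h₀ - h₂ + 1) x]
    field_simp
  rw [e]
  have hlin : h₀ + 2 * x ≤ 3 * x ^ (1 : ℝ) := by rw [Real.rpow_one]; linarith
  have hE : (3 * x ^ (1 : ℝ)) * (2 ^ (1 + h₀) * x ^ (h₀ - 1)) * (2 ^ (1 + h₁) * x ^ (h₁ - (h₀ - h₁ + 1))) *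
      (2 ^ (1 + h₂) * x ^ (h₂ - (h₀ - h₂ + 1))) =
      (3 * 2 ^ (1 + h₀) * 2 ^ (1 + h₁) * 2 ^ (1 + h₂)) * x ^ (2 * (h₁ + h₂) - h₀ - 2) := by
    have : x ^ (1 : ℝ) * x ^ (h₀ - 1) * x ^ (h₁ - (h₀ - h₁ + 1)) * x ^ (h₂ - (h₀ - h₂ + 1)) =
        x ^ (2 * (h₁ + h₂) - h₀ - 2) := by
      rw [← Real.rpow_add hx0, ← Real.rpow_add hx0, ← Real.rpow_add hx0]; congr 1; ring
    rw [← this]; ring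
  rw [← hE]
  have h3x : 0 ≤ 3 * x ^ (1 : ℝ) := by positivity
  exact mul_le_mul (mul_le_mul (mul_le_mul hlin r0 hP0 h3x) r1 hP1 (by positivity)) r2 hP2 (by positivity)

/-- **Summability of the Dougall coefficients** for real `h₀, h₁, h₂ > 0` with `2(h₁+h₂) < 1+h₀` (then `h₁, h₂ < h₀+1`
automatically): `Σ_μ (h₀+2μ)Γ(h₀+μ)Γ(h₁+μ)Γ(h₂+μ)/(Γ(μ+1)Γ(h₀−h₁+1+μ)Γ(h₀−h₂+1+μ)) < ∞`.
[cite: Zudilin2004, §4 (supporting lemma)] -/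
theorem summable_dougallCoeff (h₀ h₁ h₂ : ℝ) (hh₀ : 0 < h₀) (hh₁ : 0 < h₁) (hh₂ : 0 < h₂)
    (hsum : 2 * (h₁ + h₂) < 1 + h₀) :
    Summable fun μ : ℕ => (h₀ + 2 * μ) * (Real.Gamma (h₀ + μ) * Real.Gamma (h₁ + μ) * Real.Gamma (h₂ + μ)) /
      (Real.Gamma ((μ : ℝ) + 1) * Real.Gamma (h₀ - h₁ + 1 + μ) * Real.Gamma (h₀ - h₂ + 1 + μ)) := by
  obtain ⟨K, hK⟩ := dougallCoeff_le h₀ h₁ h₂ hh₀ hh₁ hh₂ (by linarith) (by linarith)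
  have hp : 2 * (h₁ + h₂) - h₀ - 2 < -1 := by linarith
  have hg : Summable fun μ : ℕ => K * (μ : ℝ) ^ (2 * (h₁ + h₂) - h₀ - 2) :=
    ((Real.summable_nat_rpow.2 hp).mul_left K)
  refine Summable.of_norm_bounded_eventually_nat hg ?_
  rw [Filter.eventually_atTop]
  refine ⟨⌈max 1 (max h₀ (max h₁ h₂))⌉₊, fun μ hμ => ?_⟩
  have hμ' : max 1 (max h₀ (max h₁ h₂)) ≤ (μ : ℝ) := le_trans (Nat.le_ceil _) (by exact_mod_cast hμ)
  have hnn : 0 ≤ (h₀ + 2 * μ) * (Real.Gamma (h₀ + μ) * Real.Gamma (h₁ + μ) * Real.Gamma (h₂ + μ)) /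
      (Real.Gamma ((μ : ℝ) + 1) * Real.Gamma (h₀ - h₁ + 1 + μ) * Real.Gamma (h₀ - h₂ + 1 + μ)) := by
    have := Real.Gamma_pos_of_pos (show 0 < h₀ + μ by positivity)
    have := Real.Gamma_pos_of_pos (show 0 < h₁ + μ by positivity)
    have := Real.Gamma_pos_of_pos (show 0 < h₂ + μ by positivity)
    have := Real.Gamma_pos_of_pos (show 0 < (μ : ℝ) + 1 by positivity)
    have := Real.Gamma_pos_of_pos (show 0 < h₀ - h₁ + 1 + μ by linarith [(μ.cast_nonneg : (0:ℝ) ≤ μ)])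
    have := Real.Gamma_pos_of_pos (show 0 < h₀ - h₂ + 1 + μ by linarith [(μ.cast_nonneg : (0:ℝ) ≤ μ)])
    positivity
  rw [Real.norm_of_nonneg hnn]
  exact hK μ hμ'

/-- **Bridge to the complex coefficients** of `DougallCarlsonSides` / `DougallSeriesSide` at real parameters.
[cite: Zudilin2004, §4 (supporting lemma)] -/
theorem dougallCoeff_complex (h₀ h₁ h₂ : ℝ) (μ : ℕ) :
    ((h₀ : ℂ) + 2 * μ) * (Complex.Gamma ((h₀ : ℂ) + μ) * Complex.Gamma ((h₁ : ℂ) + μ) * Complex.Gamma ((h₂ : ℂ) + μ)) /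
        (Complex.Gamma ((μ : ℂ) + 1) * Complex.Gamma ((h₀ : ℂ) - h₁ + 1 + μ) * Complex.Gamma ((h₀ : ℂ) - h₂ + 1 + μ)) =
      (((h₀ + 2 * μ) * (Real.Gamma (h₀ + μ) * Real.Gamma (h₁ + μ) * Real.Gamma (h₂ + μ)) /
        (Real.Gamma ((μ : ℝ) + 1) * Real.Gamma (h₀ - h₁ + 1 + μ) * Real.Gamma (h₀ - h₂ + 1 + μ)) : ℝ) : ℂ) := by
  push_cast
  simp only [← Complex.Gamma_ofReal]
  push_cast
  ring

/-- **Absolute summability of the complex Dougall coefficients** (input `hc` of `DougallSeriesSide.differentiableOn_series`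
and `norm_series_le`) for real `h₀, h₁, h₂ > 0` with `2(h₁+h₂) < 1+h₀`. [cite: Zudilin2004, §4 (supporting lemma)] -/
theorem summable_norm_dougallCoeff_complex (h₀ h₁ h₂ : ℝ) (hh₀ : 0 < h₀) (hh₁ : 0 < h₁) (hh₂ : 0 < h₂)
    (hsum : 2 * (h₁ + h₂) < 1 + h₀) :
    Summable fun μ : ℕ => ‖((h₀ : ℂ) + 2 * μ) *
      (Complex.Gamma ((h₀ : ℂ) + μ) * Complex.Gamma ((h₁ : ℂ) + μ) * Complex.Gamma ((h₂ : ℂ) + μ)) /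
        (Complex.Gamma ((μ : ℂ) + 1) * Complex.Gamma ((h₀ : ℂ) - h₁ + 1 + μ) * Complex.Gamma ((h₀ : ℂ) - h₂ + 1 + μ))‖ := by
  have h := (summable_dougallCoeff h₀ h₁ h₂ hh₀ hh₁ hh₂ hsum).abs
  refine h.congr fun μ => ?_
  rw [dougallCoeff_complex, Complex.norm_real, Real.norm_eq_abs]

end Literature.NumberTheory.Irrationality.Zudilin2004.DougallCoefficientBounds

end Part12

/-!
## Part 13 — port of `Summits/KontsevichZagierPeriods/Zeta5Search/DougallNonterminating.lean` (1 declarations kept)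

# Dougall's non-terminating `₅F₄` sum (real parameters, Carlson range)

Declarations of this Part (verbatim port; each keeps its own docstring and citation): `norm_add_pos_ge`.

Reference keys (see `references.bib` and the declarations' citations): [Zudilin2004].
-/

section Part13

namespace Literature.NumberTheory.Irrationality.Zudilin2004.DougallNonterminating

open _root_.Filter _root_.Set
open scoped _root_.Topology
open Literature.NumberTheory.Irrationality.Zudilin2004.DougallCarlsonSides (differentiableOn_gamma_side)
open Literature.NumberTheory.Irrationality.Zudilin2004.DougallCoefficientBounds (summable_norm_dougallCoeff_complex)

/-- On `{Re z ≥ 0}`, for real `A > 0`: `‖z + A‖ ≥ (‖z‖ + A)/2`. [cite: Zudilin2004, §4 (supporting lemma)] -/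
theorem norm_add_pos_ge {A : ℝ} (hA : 0 < A) {z : ℂ} (hz : 0 ≤ z.re) : (‖z‖ + A) / 2 ≤ ‖z + A‖ := by
  have h1 : ‖z‖ ≤ ‖z + A‖ := by
    rw [Complex.norm_def, Complex.norm_def]
    refine Real.sqrt_le_sqrt ?_
    rw [Complex.normSq_apply, Complex.normSq_apply]
    simp only [Complex.add_re, Complex.ofReal_re, Complex.add_im, Complex.ofReal_im]
    nlinarith
  have h2 : A ≤ ‖z + A‖ := by
    calc A ≤ (z + A).re := by simp; linarith
      _ ≤ ‖z + A‖ := Complex.re_le_norm _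
  linarith

end Literature.NumberTheory.Irrationality.Zudilin2004.DougallNonterminating

end Part13

/-!
## Part 14 — port of `Summits/KontsevichZagierPeriods/Zeta5Search/DougallZudilinForm.lean` (1 declarations kept)

# Zudilin's (9): the closed form of the very-well-poised `F₃` (Carlson range)

Declarations of this Part (verbatim port; each keeps its own docstring and citation): `ne_neg_nat_of_pos`.

Reference keys (see `references.bib` and the declarations' citations): [Zudilin2004].
-/

section Part14

namespace Literature.NumberTheory.Irrationality.Zudilin2004.DougallZudilinForm

open _root_.Finset _root_.Filter

/-- A positive real is not a pole of `Γ` (as a complex number). [cite: Zudilin2004, §4 (supporting lemma)] -/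
theorem ne_neg_nat_of_pos {x : ℝ} (hx : 0 < x) : ∀ n : ℕ, (x : ℂ) ≠ -(n : ℂ) := by
  intro n h
  have := congrArg Complex.re h
  simp at this
  linarith [n.cast_nonneg (α := ℝ)]

end Literature.NumberTheory.Irrationality.Zudilin2004.DougallZudilinForm

end Part14

/-!
## Part 15 — port of `Summits/KontsevichZagierPeriods/Zeta5Search/DougallParameterHolomorphy.lean` (3 declarations kept)

# The series of Zudilin's (9) is holomorphic in the parameter `h₁`

Declarations of this Part (verbatim port; each keeps its own docstring and citation): `summable_fourGamma`, `norm_Gamma_add_nat_le`, `differentiableAt_term`.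

Reference keys (see `references.bib` and the declarations' citations): [Zudilin2004].
-/

section Part15

namespace Literature.NumberTheory.Irrationality.Zudilin2004.DougallParameterHolomorphy

open _root_.Finset _root_.Filter _root_.Set _root_.Metric
open Literature.NumberTheory.Irrationality.Zudilin2004.DougallCoefficientBounds (Gamma_add_nat_eq Gamma_ratio_le
  dougallCoeff_le dougallCoeff_complex)

/-- **Summability of the real four-Gamma term**: for `h₀, x, h₂, h₃ > 0` with `x+h₂+h₃ < 1+h₀`,
`Σ_μ (h₀+2μ)Γ(h₀+μ)Γ(x+μ)Γ(h₂+μ)Γ(h₃+μ)/(Γ(μ+1)Γ(h₀−x+1+μ)Γ(h₀−h₂+1+μ)Γ(h₀−h₃+1+μ)) < ∞` (the term is `O(μ^{2(x+h₂+h₃)−2h₀−3})`).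
[cite: Zudilin2004, §4 (supporting lemma)] -/
theorem summable_fourGamma (h₀ x h₂ h₃ : ℝ) (hh₀ : 0 < h₀) (hx : 0 < x) (hh₂ : 0 < h₂) (hh₃ : 0 < h₃)
    (hs : x + h₂ + h₃ < 1 + h₀) :
    Summable fun μ : ℕ => (h₀ + 2 * μ) *
      (Real.Gamma (h₀ + μ) * Real.Gamma (x + μ) * Real.Gamma (h₂ + μ) * Real.Gamma (h₃ + μ)) /
      (Real.Gamma ((μ : ℝ) + 1) * Real.Gamma (h₀ - x + 1 + μ) * Real.Gamma (h₀ - h₂ + 1 + μ) *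
        Real.Gamma (h₀ - h₃ + 1 + μ)) := by
  obtain ⟨K, hK⟩ := dougallCoeff_le h₀ h₂ h₃ hh₀ hh₂ hh₃ (by linarith) (by linarith)
  have hp : 2 * (h₂ + h₃) - h₀ - 2 + (x - (h₀ - x + 1)) < -1 := by linarith
  have hg : Summable fun μ : ℕ => K * 2 ^ (1 + x) * (μ : ℝ) ^ (2 * (h₂ + h₃) - h₀ - 2 + (x - (h₀ - x + 1))) :=
    ((Real.summable_nat_rpow.2 hp).mul_left _)
  refine Summable.of_norm_bounded_eventually_nat hg ?_
  rw [Filter.eventually_atTop]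
  refine ⟨⌈max 1 (max h₀ (max h₂ h₃)) + x⌉₊, fun μ hμ => ?_⟩
  have hμ0 : max 1 (max h₀ (max h₂ h₃)) + x ≤ (μ : ℝ) := le_trans (Nat.le_ceil _) (by exact_mod_cast hμ)
  have hm1 : 1 ≤ max 1 (max h₀ (max h₂ h₃)) := le_max_left _ _
  have hμ' : max 1 (max h₀ (max h₂ h₃)) ≤ (μ : ℝ) := by linarith
  have hμ1 : (1 : ℝ) ≤ μ := by linarith
  have hμx : x ≤ (μ : ℝ) := by linarith
  have hμpos : (0 : ℝ) < μ := by linarith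
  have G0 := Real.Gamma_pos_of_pos (show 0 < h₀ + μ by positivity)
  have Gx := Real.Gamma_pos_of_pos (show 0 < x + μ by positivity)
  have G2 := Real.Gamma_pos_of_pos (show 0 < h₂ + μ by positivity)
  have G3 := Real.Gamma_pos_of_pos (show 0 < h₃ + μ by positivity)
  have G1 := Real.Gamma_pos_of_pos (show 0 < (μ : ℝ) + 1 by positivity)
  have Gx' := Real.Gamma_pos_of_pos (show 0 < h₀ - x + 1 + μ by linarith)
  have G2' := Real.Gamma_pos_of_pos (show 0 < h₀ - h₂ + 1 + μ by linarith)
  have G3' := Real.Gamma_pos_of_pos (show 0 < h₀ - h₃ + 1 + μ by linarith)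
  have hnn : 0 ≤ (h₀ + 2 * μ) *
      (Real.Gamma (h₀ + μ) * Real.Gamma (x + μ) * Real.Gamma (h₂ + μ) * Real.Gamma (h₃ + μ)) /
      (Real.Gamma ((μ : ℝ) + 1) * Real.Gamma (h₀ - x + 1 + μ) * Real.Gamma (h₀ - h₂ + 1 + μ) *
        Real.Gamma (h₀ - h₃ + 1 + μ)) := by positivity
  rw [Real.norm_of_nonneg hnn]
  have e : (h₀ + 2 * μ) *
      (Real.Gamma (h₀ + μ) * Real.Gamma (x + μ) * Real.Gamma (h₂ + μ) * Real.Gamma (h₃ + μ)) /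
      (Real.Gamma ((μ : ℝ) + 1) * Real.Gamma (h₀ - x + 1 + μ) * Real.Gamma (h₀ - h₂ + 1 + μ) *
        Real.Gamma (h₀ - h₃ + 1 + μ)) =
      (h₀ + 2 * μ) * (Real.Gamma (h₀ + μ) * Real.Gamma (h₂ + μ) * Real.Gamma (h₃ + μ)) /
        (Real.Gamma ((μ : ℝ) + 1) * Real.Gamma (h₀ - h₂ + 1 + μ) * Real.Gamma (h₀ - h₃ + 1 + μ)) *
        (Real.Gamma ((μ : ℝ) + x) / Real.Gamma ((μ : ℝ) + (h₀ - x + 1))) := by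
    rw [add_comm x (μ : ℝ), show h₀ - x + 1 + (μ : ℝ) = μ + (h₀ - x + 1) by ring]
    field_simp
  rw [e]
  have r := Gamma_ratio_le (a := x) (b := h₀ - x + 1) hμ1 hμx hx.le (by linarith)
  have hA := hK μ hμ'
  have hKnn : 0 ≤ K * (μ : ℝ) ^ (2 * (h₂ + h₃) - h₀ - 2) := le_trans (by positivity) hA
  calc _ ≤ K * (μ : ℝ) ^ (2 * (h₂ + h₃) - h₀ - 2) * (2 ^ (1 + x) * (μ : ℝ) ^ (x - (h₀ - x + 1))) :=
        mul_le_mul hA r (div_pos (Real.Gamma_pos_of_pos (by positivity))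
          (Real.Gamma_pos_of_pos (by linarith))).le hKnn
    _ = K * 2 ^ (1 + x) * (μ : ℝ) ^ (2 * (h₂ + h₃) - h₀ - 2 + (x - (h₀ - x + 1))) := by
        rw [Real.rpow_add hμpos]; ring

/-- `‖Γ(w+μ)‖ ≤ Γ(Re w) · ∏_{i<μ} (Re w + i)` for `Re w > 0`. [cite: Zudilin2004, §4 (supporting lemma)] -/
theorem norm_Gamma_add_nat_le {w : ℂ} (hw : 0 < w.re) (μ : ℕ) :
    ‖Complex.Gamma (w + μ)‖ ≤ Real.Gamma w.re * ∏ i ∈ range μ, (w.re + i) := by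
  have h := Literature.Analysis.SpecialFunctions.GammaVert.norm_Gamma_le_Gamma_re
    (x := (w + μ).re) (by simp; positivity) ((w + μ).im)
  rw [Complex.re_add_im] at h
  refine h.trans (le_of_eq ?_)
  rw [show (w + (μ : ℂ)).re = w.re + μ by simp, Gamma_add_nat_eq w.re hw μ]

/-- Each term of (9) is holomorphic in `w = h₁` on `0 < Re w < h₀+1` (for `h₂, h₃ < h₀+1`).
[cite: Zudilin2004, §4 (supporting lemma)] -/
theorem differentiableAt_term (h₀ h₂ h₃ : ℝ) (hh₂ : h₂ < h₀ + 1) (hh₃ : h₃ < h₀ + 1) (μ : ℕ) {w : ℂ}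
    (hw : 0 < w.re) (hw' : w.re < h₀ + 1) :
    DifferentiableAt ℂ (fun w : ℂ => ((h₀ : ℂ) + 2 * μ) *
        (Complex.Gamma ((h₀ : ℂ) + μ) * Complex.Gamma (w + μ) * Complex.Gamma ((h₂ : ℂ) + μ) *
          Complex.Gamma ((h₃ : ℂ) + μ)) /
        (Complex.Gamma ((μ : ℂ) + 1) * Complex.Gamma ((h₀ : ℂ) - w + 1 + μ) * Complex.Gamma ((h₀ : ℂ) - h₂ + 1 + μ) *
          Complex.Gamma ((h₀ : ℂ) - h₃ + 1 + μ))) w := by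
  have pole : ∀ {s : ℂ}, 0 < s.re → ∀ m : ℕ, s ≠ -(m : ℂ) := by
    intro s hs m h
    have := congrArg Complex.re h
    simp at this
    linarith [m.cast_nonneg (α := ℝ)]
  have d1 : DifferentiableAt ℂ (fun w : ℂ => Complex.Gamma (w + μ)) w :=
    (Complex.differentiableAt_Gamma _ (pole (by simp; positivity))).comp w (differentiableAt_id.add_const _)
  have d2 : DifferentiableAt ℂ (fun w : ℂ => Complex.Gamma ((h₀ : ℂ) - w + 1 + μ)) w :=
    (Complex.differentiableAt_Gamma _ (pole (by simp; linarith))).comp w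
      ((((differentiableAt_const _).sub differentiableAt_id).add_const _).add_const _)
  refine DifferentiableAt.div ?_ ?_ ?_
  · exact ((((differentiableAt_const _).mul d1).mul_const _).mul_const _).const_mul _
  · exact (((differentiableAt_const _).mul d2).mul_const _).mul_const _
  · have g1 : Complex.Gamma ((μ : ℂ) + 1) ≠ 0 := Complex.Gamma_ne_zero (pole (by simp; positivity))
    have g2 : Complex.Gamma ((h₀ : ℂ) - w + 1 + μ) ≠ 0 := Complex.Gamma_ne_zero (pole (by simp; linarith))
    have g3 : Complex.Gamma ((h₀ : ℂ) - h₂ + 1 + μ) ≠ 0 :=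
      Complex.Gamma_ne_zero (pole (by simp; linarith [μ.cast_nonneg (α := ℝ)]))
    have g4 : Complex.Gamma ((h₀ : ℂ) - h₃ + 1 + μ) ≠ 0 :=
      Complex.Gamma_ne_zero (pole (by simp; linarith [μ.cast_nonneg (α := ℝ)]))
    exact mul_ne_zero (mul_ne_zero (mul_ne_zero g1 g2) g3) g4

end Literature.NumberTheory.Irrationality.Zudilin2004.DougallParameterHolomorphy

end Part15

/-!
## Part 16 — port of `Summits/KontsevichZagierPeriods/Zeta5Search/DougallFullRange.lean` (1 declarations kept)

# Zudilin's (9) and the case `k = 1` of his theorem on the full positive range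

Declarations of this Part (verbatim port; each keeps its own docstring and citation): `differentiableOn_gammaSide`.

Reference keys (see `references.bib` and the declarations' citations): [Zudilin2004].
-/

section Part16

namespace Literature.NumberTheory.Irrationality.Zudilin2004.DougallFullRange

open _root_.Finset _root_.Filter _root_.Set _root_.Metric
open Literature.NumberTheory.Irrationality.Zudilin2002 (vwpSeries sorokinIntegral)

/-- The Gamma side of (9) is holomorphic in `w = h₁` on `D = {0 < Re w < 1+h₀−h₂−h₃}` (`h₂, h₃ > 0`).
[cite: Zudilin2004, §4 (supporting lemma)] -/
theorem differentiableOn_gammaSide (h₀ h₂ h₃ : ℝ) (hh₂ : 0 < h₂) (hh₃ : 0 < h₃) :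
    DifferentiableOn ℂ (fun w : ℂ => Complex.Gamma w * Complex.Gamma h₂ * Complex.Gamma h₃ *
        Complex.Gamma ((h₀ : ℂ) - w - h₂ - h₃ + 1) /
        (Complex.Gamma ((h₀ : ℂ) - w - h₂ + 1) * Complex.Gamma ((h₀ : ℂ) - w - h₃ + 1) *
          Complex.Gamma ((h₀ : ℂ) - h₂ - h₃ + 1)))
      {w : ℂ | 0 < w.re ∧ w.re < 1 + h₀ - h₂ - h₃} := by
  intro w hw
  obtain ⟨hw, hw'⟩ := hw
  have pole : ∀ {s : ℂ}, 0 < s.re → ∀ m : ℕ, s ≠ -(m : ℂ) := by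
    intro s hs m h
    have := congrArg Complex.re h
    simp at this
    linarith [m.cast_nonneg (α := ℝ)]
  have dw : DifferentiableAt ℂ Complex.Gamma w := Complex.differentiableAt_Gamma _ (pole hw)
  have dN : DifferentiableAt ℂ (fun w : ℂ => Complex.Gamma ((h₀ : ℂ) - w - h₂ - h₃ + 1)) w :=
    (Complex.differentiableAt_Gamma _ (pole (by simp; linarith))).comp w
      (((((differentiableAt_const _).sub differentiableAt_id).sub_const _).sub_const _).add_const _)
  have dD1 : DifferentiableAt ℂ (fun w : ℂ => Complex.Gamma ((h₀ : ℂ) - w - h₂ + 1)) w :=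
    (Complex.differentiableAt_Gamma _ (pole (by simp; linarith))).comp w
      ((((differentiableAt_const _).sub differentiableAt_id).sub_const _).add_const _)
  have dD2 : DifferentiableAt ℂ (fun w : ℂ => Complex.Gamma ((h₀ : ℂ) - w - h₃ + 1)) w :=
    (Complex.differentiableAt_Gamma _ (pole (by simp; linarith))).comp w
      ((((differentiableAt_const _).sub differentiableAt_id).sub_const _).add_const _)
  refine (DifferentiableAt.div (((dw.mul_const _).mul_const _).mul dN) ((dD1.mul dD2).mul_const _)
    ?_).differentiableWithinAt
  have g1 : Complex.Gamma ((h₀ : ℂ) - w - h₂ + 1) ≠ 0 := Complex.Gamma_ne_zero (pole (by simp; linarith))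
  have g2 : Complex.Gamma ((h₀ : ℂ) - w - h₃ + 1) ≠ 0 := Complex.Gamma_ne_zero (pole (by simp; linarith))
  have g3 : Complex.Gamma ((h₀ : ℂ) - h₂ - h₃ + 1) ≠ 0 := Complex.Gamma_ne_zero (pole (by simp; linarith))
  exact mul_ne_zero (mul_ne_zero g1 g2) g3

end Literature.NumberTheory.Irrationality.Zudilin2004.DougallFullRange

end Part16

/-!
## Part 17 — port of `Summits/KontsevichZagierPeriods/Zeta5Search/DougallComplexParameters.lean` (3 declarations kept)

# The series of Zudilin's (9) with complex co-parameters: estimates and holomorphy in one slot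

Declarations of this Part (verbatim port; each keeps its own docstring and citation): `norm_add_two_mul_le`, `differentiableAt_term_cparam`, `differentiableOn_gammaSide_cparam`.

Reference keys (see `references.bib` and the declarations' citations): [Zudilin2004].
-/

section Part17

namespace Literature.NumberTheory.Irrationality.Zudilin2004.DougallComplexParameters

open _root_.Finset _root_.Filter _root_.Set _root_.Metric
open Literature.NumberTheory.Irrationality.Zudilin2004.DougallCoefficientBounds (Gamma_add_nat_eq)
open Literature.NumberTheory.Irrationality.Zudilin2004.DougallParameterHolomorphy (summable_fourGamma norm_Gamma_add_nat_le)
open Literature.NumberTheory.Irrationality.BrownZudilin2022.BarnesMellin (ne_neg_nat_of_re_pos)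

/-- `‖h₀+2μ‖ ≤ max(1, ‖h₀‖/Re h₀)·(Re h₀+2μ)` for `Re h₀ > 0`. [cite: Zudilin2004, §4 (supporting lemma)] -/
theorem norm_add_two_mul_le (h₀ : ℂ) (hx : 0 < h₀.re) (μ : ℕ) :
    ‖h₀ + 2 * μ‖ ≤ max 1 (‖h₀‖ / h₀.re) * (h₀.re + 2 * μ) := by
  have hK1 : 1 ≤ max 1 (‖h₀‖ / h₀.re) := le_max_left _ _
  have hK2 : ‖h₀‖ / h₀.re ≤ max 1 (‖h₀‖ / h₀.re) := le_max_right _ _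
  have h1 : ‖h₀‖ ≤ max 1 (‖h₀‖ / h₀.re) * h₀.re := by
    rw [← div_le_iff₀ hx]; exact hK2
  have h2 : (2 * μ : ℝ) ≤ max 1 (‖h₀‖ / h₀.re) * (2 * μ) := by
    nlinarith [(μ.cast_nonneg : (0 : ℝ) ≤ μ)]
  calc ‖h₀ + 2 * μ‖ ≤ ‖h₀‖ + ‖(2 * μ : ℂ)‖ := norm_add_le _ _
    _ = ‖h₀‖ + 2 * μ := by
        rw [show (2 * μ : ℂ) = ((2 * μ : ℝ) : ℂ) by push_cast; ring, Complex.norm_real,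
          Real.norm_of_nonneg (by positivity)]
    _ ≤ _ := by rw [mul_add]; exact add_le_add h1 h2

/-- Each term is holomorphic in `w` on `0 < Re w < Re h₀ + 1` (complex co-parameters with `Re h₂, Re h₃ < Re h₀ + 1`).
[cite: Zudilin2004, §4 (supporting lemma)] -/
theorem differentiableAt_term_cparam (h₀ h₂ h₃ : ℂ) (h2' : h₂.re < h₀.re + 1) (h3' : h₃.re < h₀.re + 1) (μ : ℕ)
    {w : ℂ} (hw : 0 < w.re) (hw' : w.re < h₀.re + 1) :
    DifferentiableAt ℂ (fun w : ℂ => (h₀ + 2 * μ) *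
        (Complex.Gamma (h₀ + μ) * Complex.Gamma (w + μ) * Complex.Gamma (h₂ + μ) * Complex.Gamma (h₃ + μ)) /
        (Complex.Gamma ((μ : ℂ) + 1) * Complex.Gamma (h₀ - w + 1 + μ) * Complex.Gamma (h₀ - h₂ + 1 + μ) *
          Complex.Gamma (h₀ - h₃ + 1 + μ))) w := by
  have d1 : DifferentiableAt ℂ (fun w : ℂ => Complex.Gamma (w + μ)) w :=
    (Complex.differentiableAt_Gamma _ (ne_neg_nat_of_re_pos (by simp; positivity))).comp w
      (differentiableAt_id.add_const _)
  have d2 : DifferentiableAt ℂ (fun w : ℂ => Complex.Gamma (h₀ - w + 1 + μ)) w :=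
    (Complex.differentiableAt_Gamma _ (ne_neg_nat_of_re_pos (by simp; linarith [μ.cast_nonneg (α := ℝ)]))).comp w
      ((((differentiableAt_const _).sub differentiableAt_id).add_const _).add_const _)
  refine DifferentiableAt.div ?_ ?_ ?_
  · exact ((((differentiableAt_const _).mul d1).mul_const _).mul_const _).const_mul _
  · exact (((differentiableAt_const _).mul d2).mul_const _).mul_const _
  · have g1 : Complex.Gamma ((μ : ℂ) + 1) ≠ 0 := Complex.Gamma_ne_zero (ne_neg_nat_of_re_pos (by simp; positivity))
    have g2 : Complex.Gamma (h₀ - w + 1 + μ) ≠ 0 :=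
      Complex.Gamma_ne_zero (ne_neg_nat_of_re_pos (by simp; linarith [μ.cast_nonneg (α := ℝ)]))
    have g3 : Complex.Gamma (h₀ - h₂ + 1 + μ) ≠ 0 :=
      Complex.Gamma_ne_zero (ne_neg_nat_of_re_pos (by simp; linarith [μ.cast_nonneg (α := ℝ)]))
    have g4 : Complex.Gamma (h₀ - h₃ + 1 + μ) ≠ 0 :=
      Complex.Gamma_ne_zero (ne_neg_nat_of_re_pos (by simp; linarith [μ.cast_nonneg (α := ℝ)]))
    exact mul_ne_zero (mul_ne_zero (mul_ne_zero g1 g2) g3) g4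

/-- The Gamma side of (9) is holomorphic in `w = h₁` on `D` for complex co-parameters (`Re h₂, Re h₃ > 0`).
[cite: Zudilin2004, §4 (supporting lemma)] -/
theorem differentiableOn_gammaSide_cparam (h₀ h₂ h₃ : ℂ) (hx₂ : 0 < h₂.re) (hx₃ : 0 < h₃.re) :
    DifferentiableOn ℂ (fun w : ℂ => Complex.Gamma w * Complex.Gamma h₂ * Complex.Gamma h₃ *
        Complex.Gamma (h₀ - w - h₂ - h₃ + 1) /
        (Complex.Gamma (h₀ - w - h₂ + 1) * Complex.Gamma (h₀ - w - h₃ + 1) * Complex.Gamma (h₀ - h₂ - h₃ + 1)))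
      {w : ℂ | 0 < w.re ∧ w.re < 1 + h₀.re - h₂.re - h₃.re} := by
  intro w hw
  obtain ⟨hw, hw'⟩ := hw
  have dw : DifferentiableAt ℂ Complex.Gamma w := Complex.differentiableAt_Gamma _ (ne_neg_nat_of_re_pos hw)
  have dN : DifferentiableAt ℂ (fun w : ℂ => Complex.Gamma (h₀ - w - h₂ - h₃ + 1)) w :=
    (Complex.differentiableAt_Gamma _ (ne_neg_nat_of_re_pos (by simp; linarith))).comp w
      (((((differentiableAt_const _).sub differentiableAt_id).sub_const _).sub_const _).add_const _)
  have dD1 : DifferentiableAt ℂ (fun w : ℂ => Complex.Gamma (h₀ - w - h₂ + 1)) w :=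
    (Complex.differentiableAt_Gamma _ (ne_neg_nat_of_re_pos (by simp; linarith))).comp w
      ((((differentiableAt_const _).sub differentiableAt_id).sub_const _).add_const _)
  have dD2 : DifferentiableAt ℂ (fun w : ℂ => Complex.Gamma (h₀ - w - h₃ + 1)) w :=
    (Complex.differentiableAt_Gamma _ (ne_neg_nat_of_re_pos (by simp; linarith))).comp w
      ((((differentiableAt_const _).sub differentiableAt_id).sub_const _).add_const _)
  refine (DifferentiableAt.div (((dw.mul_const _).mul_const _).mul dN) ((dD1.mul dD2).mul_const _)
    ?_).differentiableWithinAt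
  have g1 : Complex.Gamma (h₀ - w - h₂ + 1) ≠ 0 := Complex.Gamma_ne_zero (ne_neg_nat_of_re_pos (by simp; linarith))
  have g2 : Complex.Gamma (h₀ - w - h₃ + 1) ≠ 0 := Complex.Gamma_ne_zero (ne_neg_nat_of_re_pos (by simp; linarith))
  have g3 : Complex.Gamma (h₀ - h₂ - h₃ + 1) ≠ 0 := Complex.Gamma_ne_zero (ne_neg_nat_of_re_pos (by simp; linarith))
  exact mul_ne_zero (mul_ne_zero g1 g2) g3

end Literature.NumberTheory.Irrationality.Zudilin2004.DougallComplexParameters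

end Part17

/-!
## Part 18 — port of `Summits/KontsevichZagierPeriods/Zeta5Search/VWPSeriesHolomorphyH0.lean` (2 declarations kept)

# Holomorphy of Zudilin's very-well-poised series `F_m` in the parameter `h₀`

Declarations of this Part (verbatim port; each keeps its own docstring and citation): `differentiableAt_term`, `prod_update_zero`.

Reference keys (see `references.bib` and the declarations' citations): [Zudilin2004].
-/

section Part18

namespace Literature.NumberTheory.Irrationality.Zudilin2004.VWPSeriesHolomorphyH0

open _root_.Metric
open Literature.Analysis.SpecialFunctions.GammaVert (norm_Gamma_le_Gamma_re)
open Literature.NumberTheory.Irrationality.BrownZudilin2022.BarnesMellin (ne_neg_nat_of_re_pos)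
open Literature.NumberTheory.Irrationality.Zudilin2004.DougallCoefficientBounds (Gamma_add_nat_eq)
open Literature.NumberTheory.Irrationality.Zudilin2004.DougallParameterHolomorphy (norm_Gamma_add_nat_le)

/-- Termwise holomorphy in `v` where `Re v > 0` and `Re(1+v−h_i) > 0`. [cite: Zudilin2004, §4 (supporting lemma)] -/
theorem differentiableAt_term (m : ℕ) (h : ℕ → ℂ) (μ : ℕ) {v : ℂ} (hv : 0 < v.re) (hb : ∀ i ∈ Finset.Icc 1 m, 0 < (1 + v - h i).re) :
    DifferentiableAt ℂ (fun v : ℂ => (v + 2 * μ) * (Complex.Gamma (v + μ) / Complex.Gamma (1 + μ) *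
        ∏ i ∈ Finset.Icc 1 m, Complex.Gamma (h i + μ) / Complex.Gamma (1 + v - h i + μ)) * (-1 : ℂ) ^ ((m + 1) * μ)) v := by
  have d0 : DifferentiableAt ℂ (fun v : ℂ => Complex.Gamma (v + μ)) v :=
    (Complex.differentiableAt_Gamma _ (ne_neg_nat_of_re_pos (by simp; positivity))).comp v (differentiableAt_id.add_const _)
  have dj : ∀ i ∈ Finset.Icc 1 m, DifferentiableAt ℂ (fun v : ℂ => Complex.Gamma (h i + μ) / Complex.Gamma (1 + v - h i + μ)) v := by
    intro i hi
    have hbi := hb i hi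
    have hre : 0 < (1 + v - h i + (μ : ℂ)).re := by
      simp only [Complex.add_re, Complex.sub_re, Complex.one_re, Complex.natCast_re] at hbi ⊢
      linarith [μ.cast_nonneg (α := ℝ)]
    refine (differentiableAt_const _).div ?_ (Complex.Gamma_ne_zero_of_re_pos hre)
    exact (Complex.differentiableAt_Gamma _ (ne_neg_nat_of_re_pos hre)).comp v
      ((((differentiableAt_const _).add differentiableAt_id).sub_const _).add_const _)
  refine DifferentiableAt.mul (DifferentiableAt.mul (differentiableAt_id.add_const _) ((d0.div_const _).mul ?_))
    (differentiableAt_const _)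
  exact DifferentiableAt.fun_finsetProd (f := fun i v => Complex.Gamma (h i + μ) / Complex.Gamma (1 + v - h i + μ)) dj

/-- With `h' = Function.update h 0 v`: `∏_{i<m+1} Γ(h'_i+μ)/Γ(1+h'₀−h'_i+μ) = [Γ(v+μ)/Γ(1+μ)] · ∏_{i∈Icc 1 m} Γ(h_i+μ)/Γ(1+v−h_i+μ)`.
[cite: Zudilin2004, §4 (supporting lemma)] -/
theorem prod_update_zero (m : ℕ) (h : ℕ → ℂ) (v : ℂ) (μ : ℕ) :
    ∏ i ∈ Finset.range (m + 1), Complex.Gamma (Function.update h 0 v i + μ) /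
        Complex.Gamma (1 + Function.update h 0 v 0 - Function.update h 0 v i + μ) =
      Complex.Gamma (v + μ) / Complex.Gamma (1 + μ) * ∏ i ∈ Finset.Icc 1 m, Complex.Gamma (h i + μ) / Complex.Gamma (1 + v - h i + μ) := by
  have hset : Finset.range (m + 1) = insert (0 : ℕ) (Finset.Icc 1 m) := by ext i; simp; omega
  rw [hset, Finset.prod_insert (by simp)]
  simp only [Function.update_self, add_sub_cancel_right]
  refine congrArg (fun z => Complex.Gamma (v + μ) / Complex.Gamma (1 + μ) * z) (Finset.prod_congr rfl fun i hi => ?_)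
  have hi0 : i ≠ 0 := by have := (Finset.mem_Icc.1 hi).1; omega
  rw [Function.update_of_ne hi0]

end Literature.NumberTheory.Irrationality.Zudilin2004.VWPSeriesHolomorphyH0

end Part18

/-!
## Part 19 — port of `Summits/KontsevichZagierPeriods/Zeta5Search/SorokinConvergenceVWP.lean` (3 declarations kept)

# The typed right-hand side of Zudilin's (4) is an honest integral

Declarations of this Part (verbatim port; each keeps its own docstring and citation): `chain_lt`, `sum_Icc_odd`, `integrableOn_sorokinIntegrand_vwp`.

Reference keys (see `references.bib` and the declarations' citations): [Zudilin2004].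
-/

section Part19

namespace Literature.NumberTheory.Irrationality.Zudilin2004.SorokinConvergenceVWP

open _root_.MeasureTheory _root_.Set
open Literature.NumberTheory.Irrationality.Zudilin2002 (sorokinIntegrand)
open Literature.NumberTheory.Irrationality.Zudilin2004.SorokinConvergence

/-- **The mixed corners**: for `2i+2 ≤ k`,
`h₁ < Σ_{m ≤ i} (1 + h₀ − h_{2m+3} − h_{2m+2}) + h_{2i+3}` (i.e. `h₁ + ⋯ + h_{2i+2} < (i+1)(1+h₀)`), from `h₁ + h₂ < 1 + h₀`
and the printed (6) `h_j < 1 + h₀ − h_{j+1}` (`2 ≤ j ≤ k+1`). [cite: Zudilin2004, §4 (supporting lemma)] -/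
theorem chain_lt (h : ℕ → ℝ) {k : ℕ} (h6 : ∀ j ∈ Finset.Icc 2 (k + 1), 0 < h j ∧ h j < 1 + h 0 - h (j + 1))
    (h12 : h 1 + h 2 < 1 + h 0) :
    ∀ i : ℕ, 2 * i + 2 ≤ k →
      h 1 < (∑ m ∈ Finset.range (i + 1), (1 + h 0 - h (2 * m + 3) - h (2 * m + 2))) + h (2 * i + 1 + 2) := by
  intro i
  induction i with
  | zero =>
    intro _
    simp
    linarith
  | succ i ih =>
    intro hi
    have hprev := ih (by omega)
    have hpair := (h6 (2 * i + 3) (Finset.mem_Icc.2 ⟨by omega, by omega⟩)).2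
    rw [Finset.sum_range_succ, show 2 * (i + 1) + 3 = 2 * i + 5 by ring, show 2 * (i + 1) + 2 = 2 * i + 4 by ring]
    rw [show 2 * i + 1 + 2 = 2 * i + 3 by ring] at hprev
    rw [show 2 * i + 3 + 1 = 2 * i + 4 by ring] at hpair
    linarith

/-- Bookkeeping: `Σ_{j=1}^{2r+3} h_j = h₁ + Σ_{m ≤ r} (h_{2m+2} + h_{2m+3})`.
[cite: Zudilin2004, §4 (supporting lemma)] -/
theorem sum_Icc_odd (h : ℕ → ℝ) : ∀ r : ℕ,
    ∑ j ∈ Finset.Icc 1 (2 * r + 3), h j = h 1 + ∑ m ∈ Finset.range (r + 1), (h (2 * m + 2) + h (2 * m + 3))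
  | 0 => by
    have : Finset.Icc 1 (2 * 0 + 3) = {1, 2, 3} := by decide
    rw [this]
    simp [Finset.sum_insert]
  | r + 1 => by
    rw [show 2 * (r + 1) + 3 = 2 * r + 3 + 1 + 1 by ring, Finset.sum_Icc_succ_top (by omega),
      Finset.sum_Icc_succ_top (by omega), sum_Icc_odd h r,
      Finset.sum_range_succ (fun m => h (2 * m + 2) + h (2 * m + 3)) (r + 1),
      show 2 * r + 3 + 1 + 1 = 2 * (r + 1) + 3 by ring, show 2 * r + 3 + 1 = 2 * (r + 1) + 2 by ring]
    ring

/-- **The typed right-hand side of Zudilin's (4) converges under the typed hypotheses** [Zudilin math/0206177, Theorem with (5)–(6);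
the hypotheses are those of the tree's `Zudilin2002.vwp_eq_integral_of_pos`]: for `k ≥ 1` and real `h` with
(5) `(2/(k+1)) Σ_{j=1}^{k+2} h_j < 1 + h₀`, (6) `0 < h_j < 1 + h₀ − h_{j+1}` (`2 ≤ j ≤ k+1`), `0 ≤ h₁` and `h₁ + h₂ < 1 + h₀`,
the integrand of `J_k(h₁; h₂, …, h_{k+1} | 1+h₀−h₃, …, 1+h₀−h_{k+2})` is integrable on `[0,1]^k`.
[cite: Zudilin2004, §4 (supporting lemma)] -/
theorem integrableOn_sorokinIntegrand_vwp {k : ℕ} (hk : 1 ≤ k) (h : ℕ → ℝ)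
    (h5 : (2 / ((k : ℝ) + 1)) * (∑ j ∈ Finset.Icc 1 (k + 2), h j) < 1 + h 0)
    (h6 : ∀ j ∈ Finset.Icc 2 (k + 1), 0 < h j ∧ h j < 1 + h 0 - h (j + 1))
    (h1 : 0 ≤ h 1) (h12 : h 1 + h 2 < 1 + h 0) :
    IntegrableOn (sorokinIntegrand k (h 1) (fun i => h (i + 2)) (fun i => 1 + h 0 - h (i + 3)))
      (Set.pi univ fun _ : Fin k => Icc (0 : ℝ) 1) volume := by
  refine integrableOn_sorokinIntegrand hk h1 (fun j hj => ?_) (fun i hi => ?_) (fun hodd => ?_)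
  · -- edges: (6) at `j+2`
    have h' := h6 (j + 2) (Finset.mem_Icc.2 ⟨by omega, by omega⟩)
    rw [show j + 2 + 1 = j + 3 by ring] at h'
    exact ⟨h'.1, by linarith [h'.2]⟩
  · -- mixed corners
    exact chain_lt h h6 h12 i hi
  · -- the deepest corner for odd `k = 2r+1`: exactly (5)
    obtain ⟨r, rfl⟩ := hodd
    rw [show (2 * r + 1 + 1) / 2 = r + 1 by omega]
    rw [show 2 * r + 1 + 2 = 2 * r + 3 by ring, sum_Icc_odd h r] at h5
    have hpos : (0 : ℝ) < ((2 * r + 1 : ℕ) : ℝ) + 1 := by positivity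
    rw [div_mul_eq_mul_div, div_lt_iff₀ hpos] at h5
    have hcast : (1 + h 0) * (((2 * r + 1 : ℕ) : ℝ) + 1) = 2 * (((r : ℝ) + 1) * (1 + h 0)) := by push_cast; ring
    rw [hcast] at h5
    have hs : ∑ m ∈ Finset.range (r + 1), (1 + h 0 - h (2 * m + 3) - h (2 * m + 2)) =
        ((r : ℝ) + 1) * (1 + h 0) - ∑ m ∈ Finset.range (r + 1), (h (2 * m + 2) + h (2 * m + 3)) := by
      rw [eq_sub_iff_add_eq, ← Finset.sum_add_distrib,
        Finset.sum_congr rfl (fun m _ => (by ring : (1 + h 0 - h (2 * m + 3) - h (2 * m + 2)) + (h (2 * m + 2) + h (2 * m + 3)) =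
          1 + h 0)), Finset.sum_const, Finset.card_range, nsmul_eq_mul]
      push_cast
      ring
    rw [hs]
    linarith

end Literature.NumberTheory.Irrationality.Zudilin2004.SorokinConvergenceVWP

end Part19

/-!
## Part 20 — port of `Summits/KontsevichZagierPeriods/Zeta5Search/VWPContinuationH0.lean` (3 declarations kept)

# Continuation in `h₀` of Zudilin's identity (4): from a sub-ray to the whole admissible half-plane

Declarations of this Part (verbatim port; each keeps its own docstring and citation): `eqOn_of_eventually_eq_ofReal`, `corner_of_vwp`, `differentiableAt_rhs`.

Reference keys (see `references.bib` and the declarations' citations): [Zudilin2004].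
-/

section Part20

namespace Literature.NumberTheory.Irrationality.Zudilin2004.VWPContinuationH0

open _root_.MeasureTheory _root_.Set _root_.Filter
open scoped _root_.Topology
open Literature.NumberTheory.Irrationality.Zudilin2002 (nestedQ)
open Literature.NumberTheory.Irrationality.Zudilin2004.SorokinHolomorphyH0 (differentiableAt_shift)
open Literature.NumberTheory.Irrationality.Zudilin2004.VWPSeriesHolomorphyH0 (prod_update_zero)
open Literature.NumberTheory.Irrationality.Zudilin2004.SorokinConvergenceVWP (chain_lt sum_Icc_odd)
open Literature.NumberTheory.Irrationality.BrownZudilin2022.BarnesMellin (ne_neg_nat_of_re_pos)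

/-- **Identity theorem, real points near one real point**: `U` open preconnected, `↑x₀ ∈ U`, `f, g` holomorphic on `U`, and `f t = g t` for
all real `t` in a neighbourhood of `x₀` ⇒ `f = g` on `U` (variant of `Literature.Analysis.Complex.ConeTubeIdentity.eqOn_of_isPreconnected_of_eq_ofReal`).
[cite: Zudilin2004, §4 (supporting lemma)] -/
theorem eqOn_of_eventually_eq_ofReal {U : Set ℂ} (hU : IsOpen U) (hUc : IsPreconnected U) {x₀ : ℝ} (hx₀ : (x₀ : ℂ) ∈ U)
    {f g : ℂ → ℂ} (hf : DifferentiableOn ℂ f U) (hg : DifferentiableOn ℂ g U) (h : ∀ᶠ t : ℝ in 𝓝 x₀, f t = g t) : EqOn f g U := by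
  refine (hf.analyticOnNhd hU).eqOn_of_preconnected_of_frequently_eq (hg.analyticOnNhd hU) hUc hx₀ ?_
  have htend : Tendsto (fun t : ℝ => (t : ℂ)) (𝓝[≠] x₀) (𝓝[≠] (x₀ : ℂ)) :=
    Complex.continuous_ofReal.continuousWithinAt.tendsto_nhdsWithin (fun t ht => by simpa using ht)
  exact htend.frequently (h.filter_mono nhdsWithin_le_nhds).frequently

/-- **Corner conditions from the typed hypotheses** (real vector `r`): edges, mixed corners (`chain_lt`) and the deepest corner for odd `k`
(`sum_Icc_odd`), for `a₀ = r₁`, `a_j = r_{j+2}`, `b_j = 1 + r₀ − r_{j+3}`.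
[cite: Zudilin2004, §4 (supporting lemma)] -/
theorem corner_of_vwp {k : ℕ} (r : ℕ → ℝ) (h5 : (2 / ((k : ℝ) + 1)) * (∑ j ∈ Finset.Icc 1 (k + 2), r j) < 1 + r 0)
    (h6 : ∀ j ∈ Finset.Icc 2 (k + 1), 0 < r j ∧ r j < 1 + r 0 - r (j + 1)) (h12 : r 1 + r 2 < 1 + r 0) :
    (∀ j, j < k → 0 < r (j + 2) ∧ r (j + 2) < 1 + r 0 - r (j + 3)) ∧
    (∀ i, 2 * i + 2 ≤ k →
      r 1 < (∑ m ∈ Finset.range (i + 1), ((1 + r 0 - r (2 * m + 3)) - r (2 * m + 2))) + r (2 * i + 1 + 2)) ∧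
    (Odd k → r 1 < ∑ m ∈ Finset.range ((k + 1) / 2), ((1 + r 0 - r (2 * m + 3)) - r (2 * m + 2))) := by
  refine ⟨fun j hj => ?_, fun i hi => ?_, fun hodd => ?_⟩
  · have h' := h6 (j + 2) (Finset.mem_Icc.2 ⟨by omega, by omega⟩)
    rw [show j + 2 + 1 = j + 3 by ring] at h'
    exact h'
  · exact chain_lt r h6 h12 i hi
  · obtain ⟨q, rfl⟩ := hodd
    rw [show (2 * q + 1 + 1) / 2 = q + 1 by omega]
    rw [show 2 * q + 1 + 2 = 2 * q + 3 by ring, sum_Icc_odd r q] at h5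
    have hpos : (0 : ℝ) < ((2 * q + 1 : ℕ) : ℝ) + 1 := by positivity
    rw [div_mul_eq_mul_div, div_lt_iff₀ hpos] at h5
    have hcast : (1 + r 0) * (((2 * q + 1 : ℕ) : ℝ) + 1) = 2 * (((q : ℝ) + 1) * (1 + r 0)) := by push_cast; ring
    rw [hcast] at h5
    have hs : ∑ m ∈ Finset.range (q + 1), ((1 + r 0 - r (2 * m + 3)) - r (2 * m + 2)) =
        ((q : ℝ) + 1) * (1 + r 0) - ∑ m ∈ Finset.range (q + 1), (r (2 * m + 2) + r (2 * m + 3)) := by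
      rw [eq_sub_iff_add_eq, ← Finset.sum_add_distrib,
        Finset.sum_congr rfl (fun m _ => (by ring : ((1 + r 0 - r (2 * m + 3)) - r (2 * m + 2)) + (r (2 * m + 2) + r (2 * m + 3)) =
          1 + r 0)), Finset.sum_const, Finset.card_range, nsmul_eq_mul]
      push_cast
      ring
    rw [hs]
    linarith

/-- **The J-side**: `w ↦ J_n(h₁; h_{j+2} | 1+w−h_{j+3})` is holomorphic at every `v` at which the typed hypotheses hold for the real parts
(`n ≥ 1`, `Re h₁ ≥ 0`). [cite: Zudilin2004, §4 (supporting lemma)] -/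
theorem differentiableAt_rhs {n : ℕ} (hn : 1 ≤ n) (h : ℕ → ℂ) (v : ℂ) (h1 : 0 ≤ (h 1).re)
    (h5 : (2 / ((n : ℝ) + 1)) * (∑ j ∈ Finset.Icc 1 (n + 2), (h j).re) < 1 + v.re)
    (h6 : ∀ j ∈ Finset.Icc 2 (n + 1), 0 < (h j).re ∧ (h j).re < 1 + v.re - (h (j + 1)).re)
    (h12 : (h 1).re + (h 2).re < 1 + v.re) :
    DifferentiableAt ℂ (fun w : ℂ => ∫ x in Set.pi univ (fun _ : Fin n => Icc (0 : ℝ) 1),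
      (∏ j : Fin n, ((x j : ℝ) : ℂ) ^ (h (j + 2) - 1) * (1 - ((x j : ℝ) : ℂ)) ^ ((1 + w - h (j + 3)) - h (j + 2) - 1)) *
        ((nestedQ (List.ofFn x) : ℝ) : ℂ) ^ (-h 1)) v := by
  -- the real vector of (4) at `h₀ = v`
  set r : ℕ → ℝ := fun j => if j = 0 then v.re else (h j).re with hr
  have hr0 : r 0 = v.re := by simp [hr]
  have hrj : ∀ j, j ≠ 0 → r j = (h j).re := fun j hj => by simp [hr, hj]
  have h5' : (2 / ((n : ℝ) + 1)) * (∑ j ∈ Finset.Icc 1 (n + 2), r j) < 1 + r 0 := by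
    rw [hr0, Finset.sum_congr rfl (fun j hj => hrj j (by have := (Finset.mem_Icc.1 hj).1; omega))]; exact h5
  have h6' : ∀ j ∈ Finset.Icc 2 (n + 1), 0 < r j ∧ r j < 1 + r 0 - r (j + 1) := fun j hj => by
    have hj2 := (Finset.mem_Icc.1 hj).1
    rw [hrj j (by omega), hrj (j + 1) (by omega), hr0]; exact h6 j hj
  have h12' : r 1 + r 2 < 1 + r 0 := by rw [hrj 1 (by omega), hrj 2 (by omega), hr0]; exact h12
  obtain ⟨hE, hA, hAodd⟩ := corner_of_vwp (k := n) r h5' h6' h12'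
  have hsum : ∀ s : Finset ℕ, ∑ m ∈ s, ((1 + r 0 - r (2 * m + 3)) - r (2 * m + 2)) =
      ∑ m ∈ s, ((1 + v - h (2 * m + 3)).re - (h (2 * m + 2)).re) := fun s =>
    Finset.sum_congr rfl fun m _ => by rw [hrj (2 * m + 3) (by omega), hrj (2 * m + 2) (by omega), hr0]; simp
  have hdiff := differentiableAt_shift hn (h 1) h1 (fun j => h (j + 2)) (fun j => h (j + 3)) v
    (fun j hj => by
      have hEj := hE j hj
      rw [hrj (j + 2) (by omega), hrj (j + 3) (by omega), hr0] at hEj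
      simpa using hEj)
    (fun i hi => by
      have hAi := hA i hi
      rw [hrj 1 (by omega), hrj (2 * i + 1 + 2) (by omega), hsum] at hAi
      simpa [add_assoc] using hAi)
    (fun hodd => by
      have hAo := hAodd hodd
      rw [hrj 1 (by omega), hsum] at hAo
      simpa using hAo)
  simpa using hdiff

end Literature.NumberTheory.Irrationality.Zudilin2004.VWPContinuationH0

end Part20

/-!
## Part 21 — port of `Summits/KontsevichZagierPeriods/Zeta5Search/DougallComplexH0.lean` (3 declarations kept)

# Zudilin's (9) with all four parameters complex: the slot `h₀`

Declarations of this Part (verbatim port; each keeps its own docstring and citation): `summable_gammaRatios`, `differentiableAt_term_h0`, `differentiableOn_gammaSide_h0`.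

Reference keys (see `references.bib` and the declarations' citations): [Zudilin2004].
-/

section Part21

namespace Literature.NumberTheory.Irrationality.Zudilin2004.DougallComplexH0

open _root_.Finset _root_.Filter _root_.Set _root_.Metric
open Literature.NumberTheory.Irrationality.Zudilin2004.DougallCoefficientBounds (Gamma_add_nat_eq Gamma_ratio_le)
open Literature.NumberTheory.Irrationality.Zudilin2004.DougallParameterHolomorphy (norm_Gamma_add_nat_le)
open Literature.NumberTheory.Irrationality.BrownZudilin2022.BarnesMellin (ne_neg_nat_of_re_pos)

/-- **Summability of a product of Gamma ratios**: for positive `a₀,…,a₃, b₁, b₂, b₃`, `R ≥ 0` and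
`a₀ + (a₁−b₁) + (a₂−b₂) + (a₃−b₃) < −1`,
`Σ_μ (R+2μ)·Γ(a₀+μ)Γ(a₁+μ)Γ(a₂+μ)Γ(a₃+μ)/(Γ(μ+1)Γ(b₁+μ)Γ(b₂+μ)Γ(b₃+μ)) < ∞` (the term is `O(μ^{a₀+Σ(aⱼ−bⱼ)})`).
[cite: Zudilin2004, §4 (supporting lemma)] -/
theorem summable_gammaRatios (R a₀ a₁ a₂ a₃ b₁ b₂ b₃ : ℝ) (hR : 0 ≤ R) (ha₀ : 0 < a₀) (ha₁ : 0 < a₁) (ha₂ : 0 < a₂)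
    (ha₃ : 0 < a₃) (hb₁ : 0 < b₁) (hb₂ : 0 < b₂) (hb₃ : 0 < b₃)
    (hexp : a₀ + (a₁ - b₁) + (a₂ - b₂) + (a₃ - b₃) < -1) :
    Summable fun μ : ℕ => (R + 2 * μ) *
      (Real.Gamma (a₀ + μ) * Real.Gamma (a₁ + μ) * Real.Gamma (a₂ + μ) * Real.Gamma (a₃ + μ)) /
      (Real.Gamma ((μ : ℝ) + 1) * Real.Gamma (b₁ + μ) * Real.Gamma (b₂ + μ) * Real.Gamma (b₃ + μ)) := by
  set K : ℝ := 3 * 2 ^ (1 + a₀) * 2 ^ (1 + a₁) * 2 ^ (1 + a₂) * 2 ^ (1 + a₃) with hK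
  set p : ℝ := 1 + (a₀ - 1) + (a₁ - b₁) + (a₂ - b₂) + (a₃ - b₃) with hp
  have hp1 : p < -1 := by rw [hp]; linarith
  have hg : Summable fun μ : ℕ => K * (μ : ℝ) ^ p := (Real.summable_nat_rpow.2 hp1).mul_left K
  refine Summable.of_norm_bounded_eventually_nat hg ?_
  rw [Filter.eventually_atTop]
  refine ⟨⌈1 + R + a₀ + a₁ + a₂ + a₃⌉₊, fun μ hμ => ?_⟩
  have hμ0 : 1 + R + a₀ + a₁ + a₂ + a₃ ≤ (μ : ℝ) := le_trans (Nat.le_ceil _) (by exact_mod_cast hμ)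
  set x : ℝ := (μ : ℝ) with hx
  have hx1 : 1 ≤ x := by linarith
  have hx0 : 0 < x := by linarith
  have G0 := Real.Gamma_pos_of_pos (show 0 < a₀ + x by positivity)
  have G1 := Real.Gamma_pos_of_pos (show 0 < a₁ + x by positivity)
  have G2 := Real.Gamma_pos_of_pos (show 0 < a₂ + x by positivity)
  have G3 := Real.Gamma_pos_of_pos (show 0 < a₃ + x by positivity)
  have Gf := Real.Gamma_pos_of_pos (show 0 < x + 1 by positivity)
  have Gb1 := Real.Gamma_pos_of_pos (show 0 < b₁ + x by positivity)
  have Gb2 := Real.Gamma_pos_of_pos (show 0 < b₂ + x by positivity)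
  have Gb3 := Real.Gamma_pos_of_pos (show 0 < b₃ + x by positivity)
  have hnn : 0 ≤ (R + 2 * x) *
      (Real.Gamma (a₀ + x) * Real.Gamma (a₁ + x) * Real.Gamma (a₂ + x) * Real.Gamma (a₃ + x)) /
      (Real.Gamma (x + 1) * Real.Gamma (b₁ + x) * Real.Gamma (b₂ + x) * Real.Gamma (b₃ + x)) := by positivity
  rw [Real.norm_of_nonneg hnn]
  have e : (R + 2 * x) *
      (Real.Gamma (a₀ + x) * Real.Gamma (a₁ + x) * Real.Gamma (a₂ + x) * Real.Gamma (a₃ + x)) /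
      (Real.Gamma (x + 1) * Real.Gamma (b₁ + x) * Real.Gamma (b₂ + x) * Real.Gamma (b₃ + x)) =
      (R + 2 * x) * (Real.Gamma (x + a₀) / Real.Gamma (x + 1)) * (Real.Gamma (x + a₁) / Real.Gamma (x + b₁)) *
        (Real.Gamma (x + a₂) / Real.Gamma (x + b₂)) * (Real.Gamma (x + a₃) / Real.Gamma (x + b₃)) := by
    rw [add_comm a₀ x, add_comm a₁ x, add_comm a₂ x, add_comm a₃ x, add_comm b₁ x, add_comm b₂ x, add_comm b₃ x]
    field_simp
  rw [e]
  have r0 := Gamma_ratio_le (a := a₀) (b := 1) hx1 (by linarith) ha₀.le zero_le_one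
  have r1 := Gamma_ratio_le (a := a₁) (b := b₁) hx1 (by linarith) ha₁.le hb₁.le
  have r2 := Gamma_ratio_le (a := a₂) (b := b₂) hx1 (by linarith) ha₂.le hb₂.le
  have r3 := Gamma_ratio_le (a := a₃) (b := b₃) hx1 (by linarith) ha₃.le hb₃.le
  have hlin : R + 2 * x ≤ 3 * x ^ (1 : ℝ) := by rw [Real.rpow_one]; linarith
  rw [add_comm x a₀, add_comm x a₁, add_comm x a₂, add_comm x a₃, add_comm x b₁, add_comm x b₂, add_comm x b₃] at *
  have hE : (3 * x ^ (1 : ℝ)) * (2 ^ (1 + a₀) * x ^ (a₀ - 1)) * (2 ^ (1 + a₁) * x ^ (a₁ - b₁)) *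
      (2 ^ (1 + a₂) * x ^ (a₂ - b₂)) * (2 ^ (1 + a₃) * x ^ (a₃ - b₃)) = K * x ^ p := by
    have : x ^ (1 : ℝ) * x ^ (a₀ - 1) * x ^ (a₁ - b₁) * x ^ (a₂ - b₂) * x ^ (a₃ - b₃) = x ^ p := by
      rw [← Real.rpow_add hx0, ← Real.rpow_add hx0, ← Real.rpow_add hx0, ← Real.rpow_add hx0]
    rw [hK, ← this]; ring
  rw [← hE]
  have P0 : 0 ≤ Real.Gamma (a₀ + x) / Real.Gamma (x + 1) := by positivity
  have P1 : 0 ≤ Real.Gamma (a₁ + x) / Real.Gamma (b₁ + x) := by positivity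
  have P2 : 0 ≤ Real.Gamma (a₂ + x) / Real.Gamma (b₂ + x) := by positivity
  have P3 : 0 ≤ Real.Gamma (a₃ + x) / Real.Gamma (b₃ + x) := by positivity
  have h3x : 0 ≤ 3 * x ^ (1 : ℝ) := by positivity
  exact mul_le_mul (mul_le_mul (mul_le_mul (mul_le_mul hlin r0 P0 h3x) r1 P1 (by positivity)) r2 P2
    (by positivity)) r3 P3 (by positivity)

/-- Each term of (9) is holomorphic in `v = h₀` where `Re v > Re hⱼ − 1` (`j = 1, 2, 3`) and `Re v > 0`.
[cite: Zudilin2004, §4 (supporting lemma)] -/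
theorem differentiableAt_term_h0 (h₁ h₂ h₃ : ℂ) (μ : ℕ) {v : ℂ} (hv : 0 < v.re) (hv₁ : h₁.re - 1 < v.re)
    (hv₂ : h₂.re - 1 < v.re) (hv₃ : h₃.re - 1 < v.re) :
    DifferentiableAt ℂ (fun v : ℂ => (v + 2 * μ) *
        (Complex.Gamma (v + μ) * Complex.Gamma (h₁ + μ) * Complex.Gamma (h₂ + μ) * Complex.Gamma (h₃ + μ)) /
        (Complex.Gamma ((μ : ℂ) + 1) * Complex.Gamma (v - h₁ + 1 + μ) * Complex.Gamma (v - h₂ + 1 + μ) *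
          Complex.Gamma (v - h₃ + 1 + μ))) v := by
  have d0 : DifferentiableAt ℂ (fun v : ℂ => Complex.Gamma (v + μ)) v :=
    (Complex.differentiableAt_Gamma _ (ne_neg_nat_of_re_pos (by simp; positivity))).comp v
      (differentiableAt_id.add_const _)
  have dj : ∀ {h : ℂ}, h.re - 1 < v.re → DifferentiableAt ℂ (fun v : ℂ => Complex.Gamma (v - h + 1 + μ)) v := by
    intro h hh
    exact (Complex.differentiableAt_Gamma _ (ne_neg_nat_of_re_pos (by simp; linarith [μ.cast_nonneg (α := ℝ)]))).comp v
      (((differentiableAt_id.sub_const _).add_const _).add_const _)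
  refine DifferentiableAt.div ?_ ?_ ?_
  · exact (differentiableAt_id.add_const _).mul (((d0.mul_const _).mul_const _).mul_const _)
  · exact (((differentiableAt_const _).mul (dj hv₁)).mul (dj hv₂)).mul (dj hv₃)
  · have g0 : Complex.Gamma ((μ : ℂ) + 1) ≠ 0 := Complex.Gamma_ne_zero (ne_neg_nat_of_re_pos (by simp; positivity))
    have gj : ∀ {h : ℂ}, h.re - 1 < v.re → Complex.Gamma (v - h + 1 + μ) ≠ 0 := fun hh =>
      Complex.Gamma_ne_zero (ne_neg_nat_of_re_pos (by simp; linarith [μ.cast_nonneg (α := ℝ)]))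
    exact mul_ne_zero (mul_ne_zero (mul_ne_zero g0 (gj hv₁)) (gj hv₂)) (gj hv₃)

/-- The Gamma side of (9) is holomorphic in `v = h₀` on `E` (complex `h₁, h₂, h₃` with positive real parts).
[cite: Zudilin2004, §4 (supporting lemma)] -/
theorem differentiableOn_gammaSide_h0 (h₁ h₂ h₃ : ℂ) (hx₁ : 0 < h₁.re) (hx₂ : 0 < h₂.re) (hx₃ : 0 < h₃.re) :
    DifferentiableOn ℂ (fun v : ℂ => Complex.Gamma h₁ * Complex.Gamma h₂ * Complex.Gamma h₃ *
        Complex.Gamma (v - h₁ - h₂ - h₃ + 1) /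
        (Complex.Gamma (v - h₁ - h₂ + 1) * Complex.Gamma (v - h₁ - h₃ + 1) * Complex.Gamma (v - h₂ - h₃ + 1)))
      {v : ℂ | h₁.re + h₂.re + h₃.re - 1 < v.re ∧ 0 < v.re} := by
  intro v hv
  obtain ⟨hv, hv'⟩ := hv
  have dN : DifferentiableAt ℂ (fun v : ℂ => Complex.Gamma (v - h₁ - h₂ - h₃ + 1)) v :=
    (Complex.differentiableAt_Gamma _ (ne_neg_nat_of_re_pos (by simp; linarith))).comp v
      ((((differentiableAt_id.sub_const _).sub_const _).sub_const _).add_const _)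
  have dD : ∀ {a b : ℂ}, a.re + b.re - 1 < v.re →
      DifferentiableAt ℂ (fun v : ℂ => Complex.Gamma (v - a - b + 1)) v ∧ Complex.Gamma (v - a - b + 1) ≠ 0 := by
    intro a b hab
    have hre : 0 < (v - a - b + 1).re := by simp; linarith
    exact ⟨(Complex.differentiableAt_Gamma _ (ne_neg_nat_of_re_pos hre)).comp v
      (((differentiableAt_id.sub_const _).sub_const _).add_const _), Complex.Gamma_ne_zero (ne_neg_nat_of_re_pos hre)⟩
  obtain ⟨d12, g12⟩ := dD (a := h₁) (b := h₂) (by linarith)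
  obtain ⟨d13, g13⟩ := dD (a := h₁) (b := h₃) (by linarith)
  obtain ⟨d23, g23⟩ := dD (a := h₂) (b := h₃) (by linarith)
  exact (DifferentiableAt.div ((differentiableAt_const _).mul dN) ((d12.mul d13).mul d23)
    (mul_ne_zero (mul_ne_zero g12 g13) g23)).differentiableWithinAt

end Literature.NumberTheory.Irrationality.Zudilin2004.DougallComplexH0

end Part21

/-!
## Part 22 — port of `Summits/KontsevichZagierPeriods/Zeta5Search/VWPBaseCase.lean` (1 declarations kept)

# The base case `S(1)` of Zudilin's identity (4) at complex parameters

Declarations of this Part (verbatim port; each keeps its own docstring and citation): `J_one_eq`.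

Reference keys (see `references.bib` and the declarations' citations): [Zudilin2004].
-/

section Part22

namespace Literature.NumberTheory.Irrationality.Zudilin2004.VWPBaseCase

open _root_.MeasureTheory _root_.Set
open Literature.NumberTheory.Irrationality.Zudilin2002 (nestedQ)
open Literature.NumberTheory.Irrationality.BrownZudilin2022.BarnesCube (integral_beta_Ioo)

/-- **`J₁` at complex parameters**: `∫_{[0,1]^1} x₀^{a−1}(1−x₀)^{b−a−1} Q₁^{−a₀} = Γ(a)Γ(b−a−a₀)/Γ(b−a₀)` for `Re a > 0`, `Re(b−a−a₀) > 0`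
(`Q₁(x₀) = 1 − x₀`; Euler's Beta integral). [cite: Zudilin2004, §4 (supporting lemma)] -/
theorem J_one_eq (a₀ a b : ℂ) (ha : 0 < a.re) (hb : 0 < (b - a - a₀).re) :
    ∫ x in Set.pi univ (fun _ : Fin 1 => Icc (0 : ℝ) 1),
        (∏ j : Fin 1, ((x j : ℝ) : ℂ) ^ (a - 1) * (1 - ((x j : ℝ) : ℂ)) ^ (b - a - 1)) * ((nestedQ (List.ofFn x) : ℝ) : ℂ) ^ (-a₀) =
      Complex.Gamma a * Complex.Gamma (b - a - a₀) / Complex.Gamma (b - a₀) := by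
  have hQ : ∀ x : Fin 1 → ℝ, nestedQ (List.ofFn x) = 1 - x 0 := fun x => by simp [nestedQ, List.ofFn_succ]
  have hpre : Set.pi Set.univ (fun _ : Fin 1 => Icc (0 : ℝ) 1) = MeasurableEquiv.funUnique (Fin 1) ℝ ⁻¹' Icc 0 1 := by
    ext x
    simp [MeasurableEquiv.funUnique, Fin.default_eq_zero, Pi.le_def, Fin.forall_fin_one]
  have htrans := (volume_preserving_funUnique (Fin 1) ℝ).setIntegral_preimage_emb
    (MeasurableEquiv.funUnique (Fin 1) ℝ).measurableEmbedding
    (fun t : ℝ => (t : ℂ) ^ (a - 1) * (1 - (t : ℂ)) ^ (b - a - 1) * ((1 - t : ℝ) : ℂ) ^ (-a₀)) (Icc 0 1)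
  have hlhs : (∫ x in Set.pi univ (fun _ : Fin 1 => Icc (0 : ℝ) 1),
        (∏ j : Fin 1, ((x j : ℝ) : ℂ) ^ (a - 1) * (1 - ((x j : ℝ) : ℂ)) ^ (b - a - 1)) * ((nestedQ (List.ofFn x) : ℝ) : ℂ) ^ (-a₀)) =
      ∫ t in Icc (0 : ℝ) 1, (t : ℂ) ^ (a - 1) * (1 - (t : ℂ)) ^ (b - a - 1) * ((1 - t : ℝ) : ℂ) ^ (-a₀) := by
    rw [hpre, ← htrans]
    refine setIntegral_congr_fun ((MeasurableEquiv.funUnique (Fin 1) ℝ).measurable measurableSet_Icc) fun x _ => ?_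
    rw [Fin.prod_univ_one, hQ x]
    simp [MeasurableEquiv.funUnique, Fin.default_eq_zero]
  rw [hlhs, integral_Icc_eq_integral_Ioo]
  have hcongr : EqOn (fun t : ℝ => (t : ℂ) ^ (a - 1) * (1 - (t : ℂ)) ^ (b - a - 1) * ((1 - t : ℝ) : ℂ) ^ (-a₀))
      (fun t : ℝ => (t : ℂ) ^ (a - 1) * (1 - (t : ℂ)) ^ ((b - a - a₀) - 1)) (Ioo (0 : ℝ) 1) := by
    intro t ht
    have h1t : (1 : ℂ) - (t : ℂ) ≠ 0 := by
      have : (0 : ℝ) < 1 - t := by linarith [ht.2]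
      exact_mod_cast this.ne'
    simp only
    push_cast
    rw [mul_assoc, ← Complex.cpow_add _ _ h1t]
    ring_nf
  rw [setIntegral_congr_fun measurableSet_Ioo hcongr, integral_beta_Ioo ha hb]
  ring_nf

end Literature.NumberTheory.Irrationality.Zudilin2004.VWPBaseCase

end Part22

/-!
## Part 23 — port of `Summits/KontsevichZagierPeriods/Zeta5Search/SorokinIntegrableVWP.lean` (1 declarations kept)

# Integrability of Zudilin's `J_k`-integrand at complex parameters in the parametrisation of (4)

Declarations of this Part (verbatim port; each keeps its own docstring and citation): `integrableOn_integrand_vwp`.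

Reference keys (see `references.bib` and the declarations' citations): [Zudilin2004].
-/

section Part23

namespace Literature.NumberTheory.Irrationality.Zudilin2004.SorokinIntegrableVWP

open _root_.MeasureTheory _root_.Set _root_.Filter
open Literature.NumberTheory.Irrationality.Zudilin2002 (nestedQ sorokinIntegrand)
open Literature.NumberTheory.Irrationality.Zudilin2004.SorokinIntegrandBounds
open Literature.NumberTheory.Irrationality.Zudilin2004.SorokinLastVariable
open Literature.NumberTheory.Irrationality.Zudilin2004.SorokinConvergenceVWP

/-- **Integrability of the `J_k`-integrand of (4) at complex parameters** under the typed hypotheses on the real parts.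
[cite: Zudilin2004, §4 (supporting lemma)] -/
theorem integrableOn_integrand_vwp {k : ℕ} (hk : 1 ≤ k) (h : ℕ → ℂ)
    (h5 : (2 / ((k : ℝ) + 1)) * (∑ j ∈ Finset.Icc 1 (k + 2), (h j).re) < 1 + (h 0).re)
    (h6 : ∀ j ∈ Finset.Icc 2 (k + 1), 0 < (h j).re ∧ (h j).re < 1 + (h 0).re - (h (j + 1)).re)
    (h1 : 0 ≤ (h 1).re) (h12 : (h 1).re + (h 2).re < 1 + (h 0).re) :
    IntegrableOn (fun x : Fin k → ℝ =>
      (∏ j : Fin k, ((x j : ℝ) : ℂ) ^ (h ((j : ℕ) + 2) - 1) *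
          (1 - ((x j : ℝ) : ℂ)) ^ ((1 + h 0 - h ((j : ℕ) + 3)) - h ((j : ℕ) + 2) - 1)) *
        ((nestedQ (List.ofFn x) : ℝ) : ℂ) ^ (-h 1)) (Set.pi univ fun _ : Fin k => Icc (0 : ℝ) 1) volume := by
  have hreal := integrableOn_sorokinIntegrand_vwp hk (fun n => (h n).re) h5 h6 h1 h12
  have hae : (Set.pi univ fun _ : Fin k => Icc (0 : ℝ) 1) =ᵐ[volume] (Set.pi univ fun _ : Fin k => Ioo (0 : ℝ) 1) := by
    rw [volume_pi]; exact Measure.pi_Ioo_ae_eq_pi_Icc.symm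
  rw [IntegrableOn, Measure.restrict_congr_set hae] at hreal ⊢
  refine hreal.mono' (measurable_integrand k (h 1) (fun i => h (i + 2)) (fun i => 1 + h 0 - h (i + 3))).aestronglyMeasurable ?_
  filter_upwards [ae_restrict_mem (MeasurableSet.univ_pi fun _ => measurableSet_Ioo)] with x hx
  have hx' : ∀ j, x j ∈ Ioo (0 : ℝ) 1 := fun j => hx j (mem_univ _)
  have hn := norm_integrand k (h 1) (fun i => h (i + 2)) (fun i => 1 + h 0 - h (i + 3)) hx'
  have e : (fun n => (1 + h 0 - h (n + 3)).re) = fun n => 1 + (h 0).re - (h (n + 3)).re := by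
    funext n; simp
  rw [e] at hn
  exact hn.le

end Literature.NumberTheory.Irrationality.Zudilin2004.SorokinIntegrableVWP

end Part23

/-!
## Part 24 — port of `Summits/KontsevichZagierPeriods/Zeta5Search/VWPOfReal.lean` (3 declarations kept)

# The complex-parameter forms of Zudilin's `F_m` and `J_k` restrict to the typed real ones

Declarations of this Part (verbatim port; each keeps its own docstring and citation): `integrand_ofReal`, `setIntegral_ofReal`, `vwpSeries_ofReal`.

Reference keys (see `references.bib` and the declarations' citations): [Zudilin2004].
-/

section Part24

namespace Literature.NumberTheory.Irrationality.Zudilin2004.VWPOfReal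

open _root_.MeasureTheory _root_.Set
open Literature.NumberTheory.Irrationality.Zudilin2002 (nestedQ sorokinIntegrand sorokinIntegral vwpSeries)
open Literature.NumberTheory.Irrationality.Zudilin2004.SorokinIntegrandBounds

/-! ### 1. The integral side -/

/-- On the closed cube, at REAL parameters the complex-parameter integrand is the cast of the typed real integrand.
[cite: Zudilin2004, §4 (supporting lemma)] -/
theorem integrand_ofReal (k : ℕ) (a₀ : ℝ) (a b : ℕ → ℝ) {x : Fin k → ℝ} (hx : ∀ j, x j ∈ Icc (0 : ℝ) 1) :
    (∏ j : Fin k, ((x j : ℝ) : ℂ) ^ (((a j : ℝ) : ℂ) - 1) * (1 - ((x j : ℝ) : ℂ)) ^ (((b j : ℝ) : ℂ) - ((a j : ℝ) : ℂ) - 1)) *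
        ((nestedQ (List.ofFn x) : ℝ) : ℂ) ^ (-((a₀ : ℝ) : ℂ)) =
      ((sorokinIntegrand k a₀ a b x : ℝ) : ℂ) := by
  rw [sorokinIntegrand_eq k a₀ a b hx, neg_zero, Real.rpow_zero, mul_one, Complex.ofReal_mul, Complex.ofReal_prod,
    Complex.ofReal_cpow (nestedQ_ofFn_mem_Icc hx).1]
  congr 1
  · refine Finset.prod_congr rfl fun j _ => ?_
    rw [Complex.ofReal_mul, Complex.ofReal_cpow (hx j).1, Complex.ofReal_cpow (by linarith [(hx j).2] : (0 : ℝ) ≤ 1 - x j)]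
    push_cast
    rfl
  · push_cast
    rfl

/-- **`J_k` at real parameters**: the integral over `[0,1]^k` of the complex-parameter integrand at `(↑a₀, ↑a, ↑b)` is the cast of the
typed `sorokinIntegral k a₀ a b`. [cite: Zudilin2004, §4 (supporting lemma)] -/
theorem setIntegral_ofReal (k : ℕ) (a₀ : ℝ) (a b : ℕ → ℝ) :
    ∫ x in Set.pi univ (fun _ : Fin k => Icc (0 : ℝ) 1),
        (∏ j : Fin k, ((x j : ℝ) : ℂ) ^ (((a j : ℝ) : ℂ) - 1) * (1 - ((x j : ℝ) : ℂ)) ^ (((b j : ℝ) : ℂ) - ((a j : ℝ) : ℂ) - 1)) *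
          ((nestedQ (List.ofFn x) : ℝ) : ℂ) ^ (-((a₀ : ℝ) : ℂ)) =
      ((sorokinIntegral k a₀ a b : ℝ) : ℂ) := by
  rw [sorokinIntegral, ← integral_complex_ofReal]
  exact setIntegral_congr_fun (MeasurableSet.univ_pi fun _ => measurableSet_Icc) fun x hx =>
    integrand_ofReal k a₀ a b fun j => hx j (mem_univ _)

/-! ### 2. The series side -/

/-- **`F_m` at real parameters**: the complex very-well-poised series at `h ↦ (h n : ℂ)` is the cast of the typed `vwpSeries m h`.
[cite: Zudilin2004, §4 (supporting lemma)] -/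
theorem vwpSeries_ofReal (m : ℕ) (h : ℕ → ℝ) :
    (∑' μ : ℕ, (((h 0 : ℝ) : ℂ) + 2 * μ) *
        (∏ j ∈ Finset.range (m + 1), Complex.Gamma (((h j : ℝ) : ℂ) + μ) / Complex.Gamma (1 + ((h 0 : ℝ) : ℂ) - ((h j : ℝ) : ℂ) + μ)) *
        (-1 : ℂ) ^ ((m + 1) * μ)) =
      ((vwpSeries m h : ℝ) : ℂ) := by
  rw [vwpSeries, Complex.ofReal_tsum]
  refine tsum_congr fun μ => ?_
  have hΓ : ∀ r : ℝ, ((Real.Gamma r : ℝ) : ℂ) = Complex.Gamma (r : ℂ) := fun r => (Complex.Gamma_ofReal r).symm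
  push_cast
  simp_rw [hΓ]
  push_cast
  rfl

end Literature.NumberTheory.Irrationality.Zudilin2004.VWPOfReal

end Part24

/-!
## Part 25 — port of `Summits/KontsevichZagierPeriods/Zeta5Search/WedgeDictionaryDescent22Transport.lean` (4 declarations kept)

# Transport of Brown–Zudilin (22) to the dual side: the dictionary lemmas

Declarations of this Part (verbatim port; each keeps its own docstring and citation): `Gamma_int_add_one`, `sorokinIntegral_congr3`, `Gamma_pair`, `Gamma_slot`.

Reference keys (see `references.bib` and the declarations' citations): [Zudilin2004].
-/

section Part25

open _root_.Finset

namespace Literature.NumberTheory.Irrationality.Zudilin2004.WedgeDictionary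

open Literature.NumberTheory.Irrationality.BrownZudilin2022 (vwpDual hOfB bOfA pOf qOf Converges cellularIntegral QOf zchoose)
open Literature.NumberTheory.Irrationality.Zudilin2002 (vwpSeries sorokinIntegral sorokinIntegrand vwp_eq_integral_of_pos)
open Literature.NumberTheory.Irrationality.Zudilin2004 (Admissible cParams piNorm tau134 baileyTransform vwpDual_comp_swap)
open Literature.NumberTheory.Transcendental (zetaValue)

/-- `Γ(c + 1) = c!` for an integer `c ≥ 0`. [cite: Zudilin2004, §4 (supporting lemma)] -/
theorem Gamma_int_add_one {c : ℤ} (hc : 0 ≤ c) : Real.Gamma ((c : ℝ) + 1) = (c.toNat.factorial : ℝ) := by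
  obtain ⟨n, rfl⟩ := Int.eq_ofNat_of_zero_le hc
  simp [Real.Gamma_nat_eq_factorial]

/-- `sorokinIntegral 3` only reads its parameter functions below `3`. [cite: Zudilin2004, §4 (supporting lemma)] -/
theorem sorokinIntegral_congr3 {a₀ a₀' : ℝ} {f f' g g' : ℕ → ℝ} (h0 : a₀ = a₀')
    (hf : ∀ i < 3, f i = f' i) (hg : ∀ i < 3, g i = g' i) :
    sorokinIntegral 3 a₀ f g = sorokinIntegral 3 a₀' f' g' := by
  subst h0
  unfold Literature.NumberTheory.Irrationality.Zudilin2002.sorokinIntegral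
    Literature.NumberTheory.Irrationality.Zudilin2002.sorokinIntegrand
  congr 1
  funext x
  congr 1
  exact Finset.prod_congr rfl fun j _ => by rw [hf j j.isLt, hg j j.isLt]

/-- **(i)** For strictly admissible `B(k)`: `J₃(p₀,p₁,p₂,p₃−k; q₁,q₂,q₃−p₆+k) = λ_k · F̃₅(B(k))` (from the cited Zudilin 2002 theorem,
k = 3; the relation `p₃ + q₃ = p₆ + q₁ + q₂` of (18) holds identically on the 8-parameter family).
[cite: Zudilin2004, §4 (supporting lemma)] -/
theorem Gamma_pair (B : ℕ → ℤ) {j l : ℕ} (hj : j ≠ 0) (hl : l ≠ 0) (hc : 0 ≤ B 0 - B j - B l) :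
    Real.Gamma (1 + hOfB B 0 - hOfB B j - hOfB B l) = ((B 0 - B j - B l).toNat.factorial : ℝ) := by
  rw [show (1 + hOfB B 0 - hOfB B j - hOfB B l) = ((B 0 - B j - B l : ℤ) : ℝ) + 1 by
    simp [hOfB, hj, hl]; ring]
  exact Gamma_int_add_one hc

/-- `Γ(h_j) = B_j!` for a slot parameter `B_j ≥ 0` (`h_j = B_j + 1`). [cite: Zudilin2004, §4 (supporting lemma)] -/
theorem Gamma_slot (B : ℕ → ℤ) {j : ℕ} (hj : j ≠ 0) (hc : 0 ≤ B j) :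
    Real.Gamma (hOfB B j) = ((B j).toNat.factorial : ℝ) := by
  rw [show hOfB B j = ((B j : ℤ) : ℝ) + 1 by simp [hOfB, hj]]
  exact Gamma_int_add_one hc

end Literature.NumberTheory.Irrationality.Zudilin2004.WedgeDictionary

end Part25

/-!
## Part 26 — port of `Summits/KontsevichZagierPeriods/Zeta5Search/BaileyFromSorokinReflection.lean` (9 declarations kept)

# Bailey's `₇F₆` involution from the reflection symmetry of Zudilin's triple integral

Declarations of this Part (verbatim port; each keeps its own docstring and citation): `refl_refl`, `measurable_refl`, `measurableEmbedding_refl`, `measurePreserving_refl`, `refl_preimage_cube`, `sorokinIntegrand_refl`, `sorokinIntegral_three_reflect`, `weakAdmissible_comp_swap13`, `weakAdmissible_comp_swap45`.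

Reference keys (see `references.bib` and the declarations' citations): [Zudilin2002VWPIntegrals], [Zudilin2004].
-/

section Part26

open _root_.MeasureTheory _root_.Set _root_.Finset

namespace Literature.NumberTheory.Irrationality.Zudilin2004.BaileyFromSorokinReflection

open Literature.NumberTheory.Irrationality.Zudilin2002 (sorokinIntegral sorokinIntegrand nestedQ vwp_eq_integral_of_pos)
open Literature.NumberTheory.Irrationality.Zudilin2004 (Admissible WeakAdmissible cParams piNorm tau baileyTransform
  baileyTransformClosed baileyTransform_of_closed vwpDual_comp_swap piNorm_comp_swap weakAdmissible_tau)
open Literature.NumberTheory.Irrationality.BrownZudilin2022 (vwpDual hOfB)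
open Literature.NumberTheory.Irrationality.Zudilin2004.WedgeDictionary (sorokinIntegral_congr3)

/-- `ρ₃` is an involution. [cite: Zudilin2002VWPIntegrals, eq. (2)–(3) and the remark on `(x_{k−1},x_k) ↦ (1−x_k,1−x_{k−1})`] -/
theorem refl_refl (x : Fin 3 → ℝ) : (fun x : Fin 3 → ℝ => (![x 0, 1 - x 2, 1 - x 1] : Fin 3 → ℝ)) ((fun x : Fin 3 → ℝ => (![x 0, 1 - x 2, 1 - x 1] : Fin 3 → ℝ)) x) = x := by
  ext i
  fin_cases i <;> simp

/-- `ρ₃` is measurable. [cite: Zudilin2002VWPIntegrals, eq. (2)–(3) and the remark on `(x_{k−1},x_k) ↦ (1−x_k,1−x_{k−1})`] -/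
theorem measurable_refl : Measurable (fun x : Fin 3 → ℝ => (![x 0, 1 - x 2, 1 - x 1] : Fin 3 → ℝ)) := by
  refine measurable_pi_lambda _ fun i => ?_
  fin_cases i <;> simp <;> fun_prop

/-- `ρ₃` is a measurable embedding (it is a measurable involution). [cite: Zudilin2002VWPIntegrals, eq. (2)–(3) and the remark on `(x_{k−1},x_k) ↦ (1−x_k,1−x_{k−1})`] -/
theorem measurableEmbedding_refl : MeasurableEmbedding (fun x : Fin 3 → ℝ => (![x 0, 1 - x 2, 1 - x 1] : Fin 3 → ℝ)) :=
  (⟨⟨(fun x : Fin 3 → ℝ => (![x 0, 1 - x 2, 1 - x 1] : Fin 3 → ℝ)), (fun x : Fin 3 → ℝ => (![x 0, 1 - x 2, 1 - x 1] : Fin 3 → ℝ)), refl_refl, refl_refl⟩,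
    measurable_refl, measurable_refl⟩ : (Fin 3 → ℝ) ≃ᵐ (Fin 3 → ℝ)).measurableEmbedding

/-- `ρ₃` preserves Lebesgue measure on `ℝ³` (a swap of two coordinates followed by two reflections `t ↦ 1 − t`). [cite: Zudilin2002VWPIntegrals, eq. (2)–(3) and the remark on `(x_{k−1},x_k) ↦ (1−x_k,1−x_{k−1})`] -/
theorem measurePreserving_refl : MeasurePreserving (fun x : Fin 3 → ℝ => (![x 0, 1 - x 2, 1 - x 1] : Fin 3 → ℝ)) volume volume := by
  set s : Fin 3 ≃ Fin 3 := Equiv.swap 1 2 with hs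
  have hS := volume_measurePreserving_piCongrLeft (fun _ : Fin 3 => ℝ) s
  have hT : ∀ (w : Fin 3 → ℝ) (k : Fin 3), MeasurableEquiv.piCongrLeft (fun _ : Fin 3 => ℝ) s w k = w (s k) := by
    intro w k
    have := MeasurableEquiv.piCongrLeft_apply_apply (β := fun _ : Fin 3 => ℝ) s w (s k)
    have hss : s (s k) = k := by simp [hs, Equiv.swap_apply_self]
    rw [hss] at this
    exact this
  have hf : ∀ i : Fin 3, MeasurePreserving (fun t : ℝ => if i = 1 ∨ i = 2 then 1 - t else t) volume volume := by
    intro i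
    by_cases h : i = 1 ∨ i = 2
    · simp only [h, if_true]
      exact Measure.measurePreserving_sub_left volume 1
    · simp only [h, if_false]
      exact MeasurePreserving.id volume
  have hP := volume_preserving_pi hf
  have hfun : (fun x : Fin 3 → ℝ => (![x 0, 1 - x 2, 1 - x 1] : Fin 3 → ℝ)) =
      (fun (x : Fin 3 → ℝ) (i : Fin 3) => if i = 1 ∨ i = 2 then 1 - x i else x i) ∘
      (MeasurableEquiv.piCongrLeft (fun _ : Fin 3 => ℝ) s) := by
    funext x
    funext i
    simp only [Function.comp_apply, hT]
    fin_cases i <;> simp [hs, Equiv.swap_apply_of_ne_of_ne]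
  rw [hfun]
  exact hP.comp hS

/-- The cube `[0,1]³` is invariant under `ρ₃`. [cite: Zudilin2002VWPIntegrals, eq. (2)–(3) and the remark on `(x_{k−1},x_k) ↦ (1−x_k,1−x_{k−1})`] -/
theorem refl_preimage_cube :
    (fun x : Fin 3 → ℝ => (![x 0, 1 - x 2, 1 - x 1] : Fin 3 → ℝ)) ⁻¹' (Set.pi Set.univ fun _ : Fin 3 => Icc (0 : ℝ) 1) =
      Set.pi Set.univ fun _ => Icc (0 : ℝ) 1 := by
  ext x
  simp only [Set.mem_preimage, Set.mem_univ_pi, Set.mem_Icc]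
  constructor
  · intro h i
    fin_cases i
    · show 0 ≤ x 0 ∧ x 0 ≤ 1
      simpa using h 0
    · show 0 ≤ x 1 ∧ x 1 ≤ 1
      have := h 2
      simp at this
      constructor <;> linarith [this.1, this.2]
    · show 0 ≤ x 2 ∧ x 2 ≤ 1
      have := h 1
      simp at this
      constructor <;> linarith [this.1, this.2]
  · intro h i
    fin_cases i
    · show 0 ≤ (![x 0, 1 - x 2, 1 - x 1] : Fin 3 → ℝ) 0 ∧ (![x 0, 1 - x 2, 1 - x 1] : Fin 3 → ℝ) 0 ≤ 1
      simpa using h 0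
    · show 0 ≤ (![x 0, 1 - x 2, 1 - x 1] : Fin 3 → ℝ) 1 ∧ (![x 0, 1 - x 2, 1 - x 1] : Fin 3 → ℝ) 1 ≤ 1
      have := h 2
      simp
      constructor <;> linarith [this.1, this.2]
    · show 0 ≤ (![x 0, 1 - x 2, 1 - x 1] : Fin 3 → ℝ) 2 ∧ (![x 0, 1 - x 2, 1 - x 1] : Fin 3 → ℝ) 2 ≤ 1
      have := h 1
      simp
      constructor <;> linarith [this.1, this.2]

/-- The kernel `Q₃` is `ρ₃`-invariant and the Euler factors of `x₂, x₃` are exchanged with the reflected parameters: the integrand of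
`(a₀; a₁, b₃−a₃, b₂−a₂ | b₁, b₃, b₂)` at `ρ₃ x` is the integrand of `(a₀; a | b)` at `x`, for every `x ∈ ℝ³` (0-based parameter rows).
[cite: Zudilin2002VWPIntegrals, eq. (2)–(3) and the remark on `(x_{k−1},x_k) ↦ (1−x_k,1−x_{k−1})`] -/
theorem sorokinIntegrand_refl (a₀ : ℝ) (a b : ℕ → ℝ) (x : Fin 3 → ℝ) :
    sorokinIntegrand 3 a₀ (fun j => if j = 1 then b 2 - a 2 else if j = 2 then b 1 - a 1 else a j)
        (fun j => if j = 1 then b 2 else if j = 2 then b 1 else b j) (![x 0, 1 - x 2, 1 - x 1] : Fin 3 → ℝ) =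
      sorokinIntegrand 3 a₀ a b x := by
  simp [sorokinIntegrand, Fin.prod_univ_three, List.ofFn_succ, nestedQ]
  ring_nf

/-- **Reflection symmetry of Zudilin's triple integral** (all real parameters, no convergence hypothesis — both sides are the same
Bochner integral after a measure-preserving involution of the cube):
`J₃(a₀; a₁, b₃−a₃, b₂−a₂ | b₁, b₃, b₂) = J₃(a₀; a₁, a₂, a₃ | b₁, b₂, b₃)` (0-based rows: slots `1, 2` reflected).
[cite: Zudilin2002VWPIntegrals, eq. (2)–(3) and the remark on `(x_{k−1},x_k) ↦ (1−x_k,1−x_{k−1})`] -/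
theorem sorokinIntegral_three_reflect (a₀ : ℝ) (a b : ℕ → ℝ) :
    sorokinIntegral 3 a₀ (fun j => if j = 1 then b 2 - a 2 else if j = 2 then b 1 - a 1 else a j)
        (fun j => if j = 1 then b 2 else if j = 2 then b 1 else b j) =
      sorokinIntegral 3 a₀ a b := by
  unfold Literature.NumberTheory.Irrationality.Zudilin2002.sorokinIntegral
  have key := measurePreserving_refl.setIntegral_preimage_emb measurableEmbedding_refl
    (sorokinIntegrand 3 a₀ (fun j => if j = 1 then b 2 - a 2 else if j = 2 then b 1 - a 1 else a j)
      (fun j => if j = 1 then b 2 else if j = 2 then b 1 else b j)) (Set.pi Set.univ fun _ : Fin 3 => Icc (0 : ℝ) 1)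
  rw [refl_preimage_cube] at key
  rw [← key]
  congr 1
  ext x
  exact sorokinIntegrand_refl a₀ a b x

/-- Weak admissibility is symmetric under the transposition of the slots `1, 3`. [cite: Zudilin2004, Sect. 4, (4.7)] -/
theorem weakAdmissible_comp_swap13 {B : ℕ → ℤ} (hB : WeakAdmissible B) : WeakAdmissible (B ∘ Equiv.swap 1 3) := by
  unfold WeakAdmissible cParams at hB ⊢
  simp only [List.mem_cons, List.not_mem_nil, or_false, forall_eq_or_imp, forall_eq] at hB ⊢
  have s0 : Equiv.swap (1 : ℕ) 3 0 = 0 := Equiv.swap_apply_of_ne_of_ne (by norm_num) (by norm_num)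
  have s2 : Equiv.swap (1 : ℕ) 3 2 = 2 := Equiv.swap_apply_of_ne_of_ne (by norm_num) (by norm_num)
  have s4 : Equiv.swap (1 : ℕ) 3 4 = 4 := Equiv.swap_apply_of_ne_of_ne (by norm_num) (by norm_num)
  have s5 : Equiv.swap (1 : ℕ) 3 5 = 5 := Equiv.swap_apply_of_ne_of_ne (by norm_num) (by norm_num)
  have s1 : Equiv.swap (1 : ℕ) 3 1 = 3 := Equiv.swap_apply_left _ _
  have s3 : Equiv.swap (1 : ℕ) 3 3 = 1 := Equiv.swap_apply_right _ _
  simp only [Function.comp, s0, s1, s2, s3, s4, s5]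
  omega

/-- Weak admissibility is symmetric under the transposition of the slots `4, 5`. [cite: Zudilin2004, Sect. 4, (4.7)] -/
theorem weakAdmissible_comp_swap45 {B : ℕ → ℤ} (hB : WeakAdmissible B) : WeakAdmissible (B ∘ Equiv.swap 4 5) := by
  unfold WeakAdmissible cParams at hB ⊢
  simp only [List.mem_cons, List.not_mem_nil, or_false, forall_eq_or_imp, forall_eq] at hB ⊢
  have s0 : Equiv.swap (4 : ℕ) 5 0 = 0 := Equiv.swap_apply_of_ne_of_ne (by norm_num) (by norm_num)
  have s1 : Equiv.swap (4 : ℕ) 5 1 = 1 := Equiv.swap_apply_of_ne_of_ne (by norm_num) (by norm_num)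
  have s2 : Equiv.swap (4 : ℕ) 5 2 = 2 := Equiv.swap_apply_of_ne_of_ne (by norm_num) (by norm_num)
  have s3 : Equiv.swap (4 : ℕ) 5 3 = 3 := Equiv.swap_apply_of_ne_of_ne (by norm_num) (by norm_num)
  have s4 : Equiv.swap (4 : ℕ) 5 4 = 5 := Equiv.swap_apply_left _ _
  have s5 : Equiv.swap (4 : ℕ) 5 5 = 4 := Equiv.swap_apply_right _ _
  simp only [Function.comp, s0, s1, s2, s3, s4, s5]
  omega

end Literature.NumberTheory.Irrationality.Zudilin2004.BaileyFromSorokinReflection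

end Part26

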